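import Literature.NumberTheory.EllipticCurves.PAdicHeightsLogProofs
import Literature.NumberTheory.EllipticCurves.SelmerCorankControlRatProofs
import Mathlib.GroupTheory.Archimedean
import Mathlib.Data.Fintype.Pigeonhole
import Literature.NumberTheory.EllipticCurves.IwasawaSelmerControlAwayFromPProofs
import Literature.NumberTheory.EllipticCurves.IwasawaSelmerControlKernelCardProofs
import Literature.NumberTheory.EllipticCurves.IsogenyQuotientPlacesProofs
import Mathlib.Data.ZMod.QuotientGroup
import Literature.NumberTheory.EllipticCurves.Greenberg1999.LocalCyclotomicTowerLayerProofs
import Literature.NumberTheory.EllipticCurves.Greenberg1999.SplitMultiplicativeLocalTowerKernelPTorsionProofs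
import Literature.NumberTheory.EllipticCurves.Greenberg1999.LocalTowerTransferCoinvariantCocyclesProofs
import HarnessLib

/-!
# The order of the `p`-primary local tower kernel at a split multiplicative prime: `2`-adic depth, non-norm elements, counts and bounds, exactness, the prime `2` (re-homed proofs, exact-order cone file 2 of 3)

Family `bsd` material RE-HOMED into `Literature/` by the Hodge foundations lane (`lit-hodgefound`, seat p20, generation 35),
file 2 of 3 of the EXACT-ORDER cone (continuing `LocalCyclotomicTowerLayerProofs` / `SplitMultiplicativeLocalTowerKernelPTorsionProofs`, whose
twelve modules are imported, not repeated): verbatim ports, in dependency order and each with its original module docstring (Parts 1–10), of the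
cell `bsd-2adic` TOWER-road modules (route `ByReductionTypeAtTwo`, crux `MultUpperHalfAtTwo`, item stmt-BirchSwinnertonDyer-19922)
ByReductionTypeAtTwoMultTowerSplitOrderTwoAdicDepth, ByReductionTypeAtTwoMultTowerSplitOrderPrelims, ByReductionTypeAtTwoMultTowerSplitOrderNonNorm, ByReductionTypeAtTwoMultTowerSplitOrderCount, ByReductionTypeAtTwoGoodOrdTowerControlCocycleFixed, LocalTowerKernelPrimaryExact, ByReductionTypeAtTwoMultTowerSplitOrderBound, ByReductionTypeAtTwoEulerCharCoinvExact, ByReductionTypeAtTwoMultTowerSplitExactLower, ByReductionTypeAtTwoMultTowerSplitExactTwo (under `Summits/BirchSwinnertonDyer/BirchSwinnertonDyer/Theorems/`, resp. `Summits/BirchSwinnertonDyer/Rank1Residual/Additive/`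
for `LocalZpExtension` / `LocalTowerKernelPrimaryExact`), namespaces re-rooted `Summit.BirchSwinnertonDyer.BirchSwinnertonDyer.Theorems.{MultTowerNS2,
MultTowerSP1, MultTowerSplitExact, MultTowerSplitOrder, GoodOrdTower}` ↦ `Literature.NumberTheory.EllipticCurves.Greenberg1999.{…}` and
`Summit.BirchSwinnertonDyer.Rank1Residual.Additive` ↦ `Literature.NumberTheory.EllipticCurves.Greenberg1999.Rank1ResidualAdditive`; theorems only
(no definition, no named fact), imports Literature/Mathlib only; all `[folklore]` helpers privatised — Part 0 re-proves privately, verbatim with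
their scope context, the `[folklore]` helpers of the earlier files that this file's parts use (they are private there); `open` commands of shadowed
Mathlib roots made `_root_`-explicit; the originals' section-wide instance declaration for `AdicCompletion.nontriviallyNormedField` is dropped (the one proof that
needs it, `MultTowerSplitOrder.exists_tateUniformisation_tateJ` of file 1, now binds it with a proof-local `letI`).  CONTENT: the `2`-adic depth and preliminaries of the split ORDER computation, non-norm elements and the order count/bound (Parts 1–4, 7), fixed cocycles (Part 5), exactness of the `p`-primary local tower kernel (Part 6), the Euler-characteristic of coinvariants (Part 8), the LOWER bound and the prime `2` (Parts 9–10).  WHY: the three files complete, inside `Literature/`, the only proof in the tree of the Literature named fact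
`NumberTheory.EllipticCurves.Greenberg1999.sec3_natCard_localTowerKerPrimary_splitMultiplicative_rat` (Greenberg LNM 1716 §3, PDF pp. 90–93: for
`W/ℚ` globally minimal with a Tate parameter datum at `p` and `log_p q_E ≠ 0`, `κ` cyclotomic, `v ∋ p`, there is `e` with `e + ord_p(2p) =
ord_p(log_p q_E)` such that at EVERY layer the `p`-primary local tower kernel `𝒦_{v,n}[p^∞]` is finite of order `p^e`), which `Literature/`
could not import.  The Summits originals stay in place (transitional duplication; cited here).  Honest framing of the originals stands: nothing is
booked, BSD is not proved by any of this.
-/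

noncomputable section

/-! ## Part 0 — 18 `[folklore]` helper(s) of the earlier tower files (private there), re-proved privately (verbatim, with their scope context) -/

section Part0

-- from `ByReductionTypeAtTwoMultTowerNS2LocalLayerField`
set_option autoImplicit false
section
namespace Literature.NumberTheory.EllipticCurves.Greenberg1999.MultTowerNS2
open _root_.NumberField _root_.IsDedekindDomain _root_.Field Literature.NumberTheory.EllipticCurves
  Literature.NumberTheory.GaloisRepresentations
universe u
/-- `localSubgroup H E = res⁻¹(H)` is open in `Γ_E` when `H` is open in `Γ_K` (the restriction `resGal E` is
continuous). [folklore] -/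
private theorem isOpen_localSubgroup {K : Type u} [Field K] (H : Subgroup (absoluteGaloisGroup K))
    (hH : IsOpen (H : Set (absoluteGaloisGroup K))) (E : Type u) [Field E] [Algebra K E] :
    IsOpen (localSubgroup H E : Set (absoluteGaloisGroup E)) :=
  hH.preimage (resGal (K := K) E).continuous_toFun
end Literature.NumberTheory.EllipticCurves.Greenberg1999.MultTowerNS2
end

-- from `ByReductionTypeAtTwoMultTowerNS2TwoAdicUnits`
set_option autoImplicit false
section
open scoped _root_.Classical
namespace Literature.NumberTheory.EllipticCurves.Greenberg1999.MultTowerNS2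
open _root_.PadicInt _root_.Polynomial
/-- `x ≡ y (mod 2^n)` in `ℤ₂` iff `‖x − y‖ ≤ 2^{−n}`. [folklore] -/
private theorem toZModPow_eq_iff_norm_sub_le (n : ℕ) (x y : ℤ_[2]) :
    toZModPow n x = toZModPow n y ↔ ‖x - y‖ ≤ (2 : ℝ) ^ (-(n : ℤ)) := by
  rw [← sub_eq_zero, ← map_sub, ← RingHom.mem_ker, ker_toZModPow, ← norm_le_pow_iff_mem_span_pow]
  norm_num
end Literature.NumberTheory.EllipticCurves.Greenberg1999.MultTowerNS2
end

-- from `ByReductionTypeAtTwoMultTowerNS2TwoAdicUnits`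
set_option autoImplicit false
section
open scoped _root_.Classical
namespace Literature.NumberTheory.EllipticCurves.Greenberg1999.MultTowerNS2
open _root_.PadicInt _root_.Polynomial
/-- `‖2‖ = 2⁻¹` in `ℤ₂`. [folklore] -/
private theorem norm_two_padicInt : ‖(2 : ℤ_[2])‖ = (2 : ℝ)⁻¹ := by
  have h : ‖((2 : ℕ) : ℤ_[2])‖ = ((2 : ℕ) : ℝ)⁻¹ := norm_p
  simpa using h
end Literature.NumberTheory.EllipticCurves.Greenberg1999.MultTowerNS2
end

-- from `ByReductionTypeAtTwoMultTowerNS2TwoAdicUnits`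
set_option autoImplicit false
section
open scoped _root_.Classical
namespace Literature.NumberTheory.EllipticCurves.Greenberg1999.MultTowerNS2
open _root_.PadicInt _root_.Polynomial
/-- If `z ≡ 1 (mod 4)` then `‖z² − 1‖ = ‖z − 1‖ · ‖2‖` (`z + 1 = 2·unit`). [folklore] -/
private theorem norm_sq_sub_one_of_norm_sub_one_lt {z : ℤ_[2]} (hz : ‖z - 1‖ < ‖(2 : ℤ_[2])‖) :
    ‖z ^ 2 - 1‖ = ‖z - 1‖ * ‖(2 : ℤ_[2])‖ := by
  have hfac : z ^ 2 - 1 = (z - 1) * (z + 1) := by ring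
  have hz1 : ‖z + 1‖ = ‖(2 : ℤ_[2])‖ := by
    have h : z + 1 = (z - 1) + 2 := by ring
    rw [h]
    rw [PadicInt.norm_add_eq_max_of_ne (ne_of_lt hz), max_eq_right hz.le]
  rw [hfac, norm_mul, hz1]
end Literature.NumberTheory.EllipticCurves.Greenberg1999.MultTowerNS2
end

-- from `ByReductionTypeAtTwoMultTowerNS2TwoAdicUnits`
set_option autoImplicit false
section
open scoped _root_.Classical
namespace Literature.NumberTheory.EllipticCurves.Greenberg1999.MultTowerNS2
open _root_.PadicInt _root_.Polynomial
/-- `‖2^j‖ = 2^{−j}` in `ℚ₂`. [folklore] -/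
private theorem norm_two_zpow_padic (j : ℤ) : ‖(2 : ℚ_[2]) ^ j‖ = (2 : ℝ) ^ (-j) := by
  rw [norm_zpow, show ((2 : ℚ_[2]) = ((2 : ℕ) : ℚ_[2])) by norm_cast, Padic.norm_p]
  rw [show ((2 : ℕ) : ℝ)⁻¹ = (2 : ℝ) ^ (-1 : ℤ) by norm_num, ← zpow_mul]
  ring_nf
end Literature.NumberTheory.EllipticCurves.Greenberg1999.MultTowerNS2
end

-- from `ByReductionTypeAtTwoMultTowerNS2TwoAdicUnits`
set_option autoImplicit false
section
open scoped _root_.Classical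
namespace Literature.NumberTheory.EllipticCurves.Greenberg1999.MultTowerNS2
open _root_.PadicInt _root_.Polynomial
/-- **`ℚ₂ˣ = 2^ℤ · ℤ₂ˣ`**: every non-zero `x ∈ ℚ₂` is `2^j · w` with `j ∈ ℤ` and `w ∈ ℤ₂ˣ`. [folklore] -/
private theorem exists_eq_two_zpow_mul_units (x : ℚ_[2]) (hx : x ≠ 0) :
    ∃ (j : ℤ) (w : ℤ_[2]ˣ), x = (2 : ℚ_[2]) ^ j * ((w : ℤ_[2]) : ℚ_[2]) := by
  have h2 : (2 : ℚ_[2]) ≠ 0 := by norm_num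
  set j : ℤ := x.valuation with hj
  have hw : ‖x * (2 : ℚ_[2]) ^ (-j)‖ = 1 := by
    rw [norm_mul, norm_two_zpow_padic, neg_neg, Padic.norm_eq_zpow_neg_valuation hx, ← hj,
      show (((2 : ℕ) : ℝ)) = (2 : ℝ) by norm_num, ← zpow_add₀ (by norm_num : (2 : ℝ) ≠ 0)]
    simp
  refine ⟨j, PadicInt.mkUnits hw, ?_⟩
  rw [PadicInt.mkUnits_eq, mul_comm, mul_assoc, ← zpow_add₀ h2, neg_add_cancel, zpow_zero, mul_one]
end Literature.NumberTheory.EllipticCurves.Greenberg1999.MultTowerNS2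
end

-- from `ByReductionTypeAtTwoMultTowerNS2TwoAdicUnits`
set_option autoImplicit false
section
open scoped _root_.Classical
namespace Literature.NumberTheory.EllipticCurves.Greenberg1999.MultTowerNS2
open _root_.PadicInt _root_.Polynomial
/-- Uniqueness of `x = 2^j · w`: the exponent and the unit are determined. [folklore] -/
private theorem two_zpow_mul_units_inj {j j' : ℤ} {w w' : ℤ_[2]ˣ}
    (h : (2 : ℚ_[2]) ^ j * ((w : ℤ_[2]) : ℚ_[2]) = (2 : ℚ_[2]) ^ j' * ((w' : ℤ_[2]) : ℚ_[2])) :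
    j = j' ∧ w = w' := by
  have h2 : (2 : ℚ_[2]) ≠ 0 := by norm_num
  have hn := congrArg (fun z : ℚ_[2] ↦ ‖z‖) h
  simp only [norm_mul, norm_two_zpow_padic] at hn
  rw [show ‖((w : ℤ_[2]) : ℚ_[2])‖ = 1 from PadicInt.norm_units w,
    show ‖((w' : ℤ_[2]) : ℚ_[2])‖ = 1 from PadicInt.norm_units w', mul_one, mul_one] at hn
  have hjj : j = j' := by
    have := zpow_right_injective₀ (by norm_num : (0 : ℝ) < 2) (by norm_num : (2 : ℝ) ≠ 1) hn
    linarith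
  subst hjj
  refine ⟨rfl, ?_⟩
  have hw := mul_left_cancel₀ (zpow_ne_zero j h2) h
  exact Units.ext (Subtype.ext hw)
end Literature.NumberTheory.EllipticCurves.Greenberg1999.MultTowerNS2
end

-- from `ByReductionTypeAtTwoMultTowerNS2TwistedTateAlgebra`
set_option autoImplicit false
section
open scoped _root_.Classical _root_.IntermediateField
namespace Literature.NumberTheory.EllipticCurves.Greenberg1999.MultTowerNS2
open _root_.NumberField _root_.IsDedekindDomain _root_.Field _root_.PadicInt Literature.NumberTheory.EllipticCurves
  Literature.NumberTheory.GaloisRepresentations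
variable {K : Type*} [Field K]
/-- `N(w₁ w₂) = N(w₁) N(w₂)`. [folklore] -/
private theorem prod_smul_mul (g : absoluteGaloisGroup K) (m : ℕ) (w₁ w₂ : AlgebraicClosure K) :
    (∏ i ∈ Finset.range m, (g ^ i) • (w₁ * w₂)) =
      (∏ i ∈ Finset.range m, (g ^ i) • w₁) * ∏ i ∈ Finset.range m, (g ^ i) • w₂ := by
  rw [← Finset.prod_mul_distrib]
  exact Finset.prod_congr rfl fun i _ ↦ smul_mul' _ _ _
end Literature.NumberTheory.EllipticCurves.Greenberg1999.MultTowerNS2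
end

-- from `ByReductionTypeAtTwoMultTowerNS2TwistedTateAlgebra`
set_option autoImplicit false
section
open scoped _root_.Classical _root_.IntermediateField
namespace Literature.NumberTheory.EllipticCurves.Greenberg1999.MultTowerNS2
open _root_.NumberField _root_.IsDedekindDomain _root_.Field _root_.PadicInt Literature.NumberTheory.EllipticCurves
  Literature.NumberTheory.GaloisRepresentations
variable {K : Type*} [Field K]
/-- `N(w⁻¹) = N(w)⁻¹`. [folklore] -/
private theorem prod_smul_inv (g : absoluteGaloisGroup K) (m : ℕ) (w : AlgebraicClosure K) :
    (∏ i ∈ Finset.range m, (g ^ i) • w⁻¹) = (∏ i ∈ Finset.range m, (g ^ i) • w)⁻¹ := by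
  rw [← Finset.prod_inv_distrib]
  exact Finset.prod_congr rfl fun i _ ↦ smul_inv'' _ _
end Literature.NumberTheory.EllipticCurves.Greenberg1999.MultTowerNS2
end

-- from `ByReductionTypeAtTwoMultTowerNS2TwistedTateAlgebra`
set_option autoImplicit false
section
open scoped _root_.Classical _root_.IntermediateField
namespace Literature.NumberTheory.EllipticCurves.Greenberg1999.MultTowerNS2
open _root_.NumberField _root_.IsDedekindDomain _root_.Field _root_.PadicInt Literature.NumberTheory.EllipticCurves
  Literature.NumberTheory.GaloisRepresentations
variable {K : Type*} [Field K]
/-- `N_m(g w) = N_m(w)` when `g^m w = w`. [folklore] -/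
private theorem prod_smul_smul_eq (g : absoluteGaloisGroup K) (m : ℕ) {w : AlgebraicClosure K} (hw : (g ^ m) • w = w) :
    (∏ i ∈ Finset.range m, (g ^ i) • (g • w)) = ∏ i ∈ Finset.range m, (g ^ i) • w := by
  have h : ∀ i, (g ^ i) • (g • w) = (g ^ (i + 1)) • w := fun i ↦ by rw [← mul_smul, ← pow_succ]
  simp_rw [h]
  by_cases hw0 : w = 0
  · simp [hw0]
  -- `(∏_{i<m} g^{i+1} w) · g^0 w = ∏_{i<m+1} g^i w = (∏_{i<m} g^i w) · g^m w`
  have h1 := Finset.prod_range_succ' (fun i ↦ (g ^ i) • w) m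
  rw [Finset.prod_range_succ, hw, pow_zero, one_smul] at h1
  exact mul_right_cancel₀ hw0 h1.symm
end Literature.NumberTheory.EllipticCurves.Greenberg1999.MultTowerNS2
end

-- from `ByReductionTypeAtTwoMultTowerNS2TwistedTateAlgebra`
set_option autoImplicit false
section
open scoped _root_.Classical _root_.IntermediateField
namespace Literature.NumberTheory.EllipticCurves.Greenberg1999.MultTowerNS2
open _root_.NumberField _root_.IsDedekindDomain _root_.Field _root_.PadicInt Literature.NumberTheory.EllipticCurves
  Literature.NumberTheory.GaloisRepresentations
variable {K : Type*} [Field K]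
/-- `g^m N_m(w) = N_m(w)` when `g^m w = w`. [folklore] -/
private theorem pow_smul_prod_smul_eq (g : absoluteGaloisGroup K) (m : ℕ) {w : AlgebraicClosure K} (hw : (g ^ m) • w = w) :
    (g ^ m) • (∏ i ∈ Finset.range m, (g ^ i) • w) = ∏ i ∈ Finset.range m, (g ^ i) • w := by
  rw [Finset.smul_prod']
  refine Finset.prod_congr rfl fun i _ ↦ ?_
  rw [← mul_smul, ← pow_add, add_comm, pow_add, mul_smul, hw]
end Literature.NumberTheory.EllipticCurves.Greenberg1999.MultTowerNS2
end

-- from `ByReductionTypeAtTwoMultTowerNS2TwistedTateAlgebra`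
set_option autoImplicit false
section
open scoped _root_.Classical _root_.IntermediateField
namespace Literature.NumberTheory.EllipticCurves.Greenberg1999.MultTowerNS2
open _root_.NumberField _root_.IsDedekindDomain _root_.Field _root_.PadicInt Literature.NumberTheory.EllipticCurves
  Literature.NumberTheory.GaloisRepresentations
variable {K : Type*} [Field K]
/-- `N_{2m}(w) = N_m(w) · g^m N_m(w)` (splitting the range `[0, 2m)`). [folklore] -/
private theorem prod_smul_range_two_mul (g : absoluteGaloisGroup K) (m : ℕ) (w : AlgebraicClosure K) :
    (∏ i ∈ Finset.range (2 * m), (g ^ i) • w) =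
      (∏ i ∈ Finset.range m, (g ^ i) • w) * (g ^ m) • ∏ i ∈ Finset.range m, (g ^ i) • w := by
  rw [two_mul, Finset.prod_range_add, Finset.smul_prod']
  congr 1
  exact Finset.prod_congr rfl fun i _ ↦ by rw [pow_add, mul_smul]
end Literature.NumberTheory.EllipticCurves.Greenberg1999.MultTowerNS2
end

-- from `ByReductionTypeAtTwoMultTowerNS2TwistedTateAlgebra`
set_option autoImplicit false
section
open scoped _root_.Classical _root_.IntermediateField
namespace Literature.NumberTheory.EllipticCurves.Greenberg1999.MultTowerNS2
open _root_.NumberField _root_.IsDedekindDomain _root_.Field _root_.PadicInt Literature.NumberTheory.EllipticCurves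
  Literature.NumberTheory.GaloisRepresentations
variable {K : Type*} [Field K]
/-- `N_m` of a `g`-fixed element is its `m`-th power. [folklore] -/
private theorem prod_smul_eq_pow_of_smul_eq (g : absoluteGaloisGroup K) (m : ℕ) {w : AlgebraicClosure K} (hw : g • w = w) :
    (∏ i ∈ Finset.range m, (g ^ i) • w) = w ^ m := by
  have h : ∀ i, (g ^ i) • w = w := fun i ↦ by
    induction i with
    | zero => rw [pow_zero, one_smul]
    | succ i ih => rw [pow_succ, mul_smul, hw, ih]
  simp_rw [h]
  rw [Finset.prod_const, Finset.card_range]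
end Literature.NumberTheory.EllipticCurves.Greenberg1999.MultTowerNS2
end

-- from `ByReductionTypeAtTwoMultTowerSplitTowerAlgebra`
set_option autoImplicit false
section
open scoped _root_.Classical _root_.IntermediateField
universe u
namespace Literature.NumberTheory.EllipticCurves.Greenberg1999.MultTowerSP1
open _root_.NumberField _root_.IsDedekindDomain _root_.Field _root_.PadicInt Literature.NumberTheory.EllipticCurves
  Literature.NumberTheory.GaloisRepresentations
variable {p : ℕ} [Fact p.Prime] {κ : ZpExtension ℚ p}
section Orbit
variable {K : Type*} [Field K]
/-- `N_m(w^k) = N_m(w)^k`. [folklore] -/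
private theorem prod_smul_pow (g : absoluteGaloisGroup K) (m k : ℕ) (w : AlgebraicClosure K) :
    (∏ i ∈ Finset.range m, (g ^ i) • (w ^ k)) = (∏ i ∈ Finset.range m, (g ^ i) • w) ^ k := by
  rw [← Finset.prod_pow]
  exact Finset.prod_congr rfl fun i _ ↦ smul_pow' _ _ _
end Orbit
end Literature.NumberTheory.EllipticCurves.Greenberg1999.MultTowerSP1
end

-- from `ByReductionTypeAtTwoMultTowerSplitTowerAlgebra`
set_option autoImplicit false
section
open scoped _root_.Classical _root_.IntermediateField
universe u
namespace Literature.NumberTheory.EllipticCurves.Greenberg1999.MultTowerSP1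
open _root_.NumberField _root_.IsDedekindDomain _root_.Field _root_.PadicInt Literature.NumberTheory.EllipticCurves
  Literature.NumberTheory.GaloisRepresentations
variable {p : ℕ} [Fact p.Prime] {κ : ZpExtension ℚ p}
section Orbit
variable {K : Type*} [Field K]
/-- `N_{mk}(w) = N_m(w)^k` when `g^m w = w` (splitting the range `[0, mk)` into `k` blocks of length `m`, each with
product `g^{mj} N_m(w) = N_m(w)`). [folklore] -/
private theorem prod_smul_range_mul_eq_pow (g : absoluteGaloisGroup K) (m : ℕ) {w : AlgebraicClosure K}
    (hw : (g ^ m) • w = w) (k : ℕ) :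
    (∏ i ∈ Finset.range (m * k), (g ^ i) • w) = (∏ i ∈ Finset.range m, (g ^ i) • w) ^ k := by
  have hfix : ∀ j : ℕ, (g ^ (m * j)) • (∏ i ∈ Finset.range m, (g ^ i) • w) = ∏ i ∈ Finset.range m, (g ^ i) • w := by
    intro j
    induction j with
    | zero => rw [mul_zero, pow_zero, one_smul]
    | succ j ih => rw [Nat.mul_succ, pow_add, mul_smul, MultTowerNS2.pow_smul_prod_smul_eq g m hw, ih]
  induction k with
  | zero => rw [mul_zero, Finset.prod_range_zero, pow_zero]
  | succ k ih =>
    rw [Nat.mul_succ, Finset.prod_range_add, ih, pow_succ]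
    congr 1
    rw [← hfix k, Finset.smul_prod']
    exact Finset.prod_congr rfl fun i _ ↦ by rw [pow_add, mul_smul]
end Orbit
end Literature.NumberTheory.EllipticCurves.Greenberg1999.MultTowerSP1
end

-- from `ByReductionTypeAtTwoGoodOrdTowerCoinvCocycle`
set_option autoImplicit false
section
open scoped _root_.Classical
universe u
namespace Literature.NumberTheory.EllipticCurves.Greenberg1999.GoodOrdTower
open _root_.NumberField _root_.IsDedekindDomain _root_.Field _root_.PadicInt Literature.NumberTheory.EllipticCurves
  Literature.NumberTheory.GaloisRepresentations _root_.WeierstrassCurve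
variable {p : ℕ} [Fact p.Prime] {κ : ZpExtension ℚ p}
section GeomSum
variable {G : Type u} [Group G] {X : TopRep.{u} ℤ G} (F : G)
/-- `S_i(n • b) = n • S_i(b)`. [folklore] -/
private theorem geomSum_nsmul (b₀ : X) (n i : ℕ) : geomSum F (n • b₀) i = n • geomSum F b₀ i := by
  simp only [geomSum, map_nsmul, Finset.smul_sum]
end GeomSum
end Literature.NumberTheory.EllipticCurves.Greenberg1999.GoodOrdTower
end

-- from `ByReductionTypeAtTwoGoodOrdTowerCoinvCocycle`
set_option autoImplicit false
section
open scoped _root_.Classical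
universe u
namespace Literature.NumberTheory.EllipticCurves.Greenberg1999.GoodOrdTower
open _root_.NumberField _root_.IsDedekindDomain _root_.Field _root_.PadicInt Literature.NumberTheory.EllipticCurves
  Literature.NumberTheory.GaloisRepresentations _root_.WeierstrassCurve
variable {p : ℕ} [Fact p.Prime] {κ : ZpExtension ℚ p}
section GeomSum
variable {G : Type u} [Group G] {X : TopRep.{u} ℤ G} (F : G)
/-- Telescoping: `S_i(F y − y) = F^i y − y`. [folklore] -/
private theorem geomSum_smul_sub_eq (y : X) (i : ℕ) : geomSum F (X.ρ F y - y) i = X.ρ (F ^ i) y - y := by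
  induction i with
  | zero => rw [geomSum_zero, pow_zero, map_one]; exact (sub_self _).symm
  | succ i ih =>
    rw [geomSum_succ, ih, map_sub, ← mul_apply_eq_comp, ← map_mul, ← pow_succ]
    abel
end GeomSum
end Literature.NumberTheory.EllipticCurves.Greenberg1999.GoodOrdTower
end

-- from `ByReductionTypeAtTwoGoodOrdTowerCoinvCocycle`
set_option autoImplicit false
section
open scoped _root_.Classical
universe u
namespace Literature.NumberTheory.EllipticCurves.Greenberg1999.GoodOrdTower
open _root_.NumberField _root_.IsDedekindDomain _root_.Field _root_.PadicInt Literature.NumberTheory.EllipticCurves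
  Literature.NumberTheory.GaloisRepresentations _root_.WeierstrassCurve
variable {p : ℕ} [Fact p.Prime] {κ : ZpExtension ℚ p}
section GeomSum
variable {G : Type u} [Group G] {X : TopRep.{u} ℤ G} (F : G)
/-- `S_{a k}(b) = k • S_a(b)` as soon as `F^a` fixes `S_a(b)` (the tree's `geomSum_mul_eq_smul` asks `F^a` to act
trivially on the whole module). [folklore] -/
private theorem geomSum_mul_eq_nsmul_of_apply_eq (b₀ : X) {a : ℕ} (ha : X.ρ (F ^ a) (geomSum F b₀ a) = geomSum F b₀ a)
    (k : ℕ) : geomSum F b₀ (a * k) = k • geomSum F b₀ a := by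
  have hak : ∀ k : ℕ, X.ρ (F ^ (a * k)) (geomSum F b₀ a) = geomSum F b₀ a := fun k ↦ by
    induction k with
    | zero => rw [mul_zero, pow_zero, map_one]; rfl
    | succ k ih => rw [Nat.mul_succ, pow_add, map_mul, mul_apply_eq_comp, ha, ih]
  induction k with
  | zero => rw [mul_zero, geomSum_zero, zero_smul]
  | succ k ih => rw [Nat.mul_succ, geomSum_add, ih, hak, succ_nsmul]
end GeomSum
end Literature.NumberTheory.EllipticCurves.Greenberg1999.GoodOrdTower
end

end Part0

/-!
## Part 1 — port of `Summits/BirchSwinnertonDyer/BirchSwinnertonDyer/Theorems/ByReductionTypeAtTwoMultTowerSplitOrderTwoAdicDepth.lean`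

# Route `ByReductionTypeAtTwo`, crux `MultUpperHalfAtTwo` (item stmt-BirchSwinnertonDyer-19922), TOWER road, the
# SPLIT rows: KERNEL BRICK S1 — the DEPTH of a `2`-adic unit: `‖1 − u²‖ = 2^{−(s+1)}` forces
# `u^{2^j a} ≢ ±1 (mod 2^{s+j+1})` (`a` odd), and `ord₂ log₂(2^k u) = s` (Iwasawa logarithm)

HONEST FRAMING (cell `bsd-2adic`, run/shared/lean/pub/bsd-2adic/, seat `bsd-2adic-mult` GEN 13, HUMAN RULINGS
D-0036 / D-0054 / D-0074): TOOL theorems only (no definition, no named fact, no `sorry`); closes nothing by itself;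
nothing booked; BSD is not proved by any of this. First brick of the KERNEL proof of the projection of the PRINT
named fact `Greenberg1999.sec3_natCard_localTowerKerPrimary_splitMultiplicative_rat` (Greenberg, LNM 1716, §3,
pp. 92–93: `|ker(r_{v_n})| ∼ log_p(N q_E)/2p[F_v ∩ ℚ_p^cyc : ℚ_p]`) that the split TOWER doors of item 19922 consume
(`MultTowerCert.atTwo_le_pow_of_split`: `#𝒦_{v,n}[2] ≤ 2^{k}` for `ord₂(log₂ q_E) ≤ k + 2`). This file is the
`2`-adic arithmetic, a DEPTH-`s` generalisation of tower-1's BRICK 12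
(`MultTowerNS2.toZModPow_pow_ne_one_and_ne_neg_one_of_tateUnit`, the case `s = 2`, `u ≡ ±3 (mod 8)`):

* `norm_pow_sub_one_of_odd` — `‖z^a − 1‖ = ‖z − 1‖` for `a` odd, `‖z − 1‖ < 1` (in `ℤ₂`);
* `norm_pow_two_pow_sub_one` — `‖y^{2^j} − 1‖ = ‖y − 1‖ · ‖2‖^j` for `‖y − 1‖ < ‖2‖`;
* `toZModPow_pow_ne_one_and_ne_neg_one_of_depth` — **`u^{2^j a} ≢ ±1 (mod 2^{s+j+1})`** for `‖u² − 1‖ = 2^{−(s+1)}`,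
  `s ≥ 1`, `a` odd (if `u^e ≡ ±1 (mod 2^{s+j+1})` then `‖u^{2e} − 1‖ < 2^{−(s+j+1)} = ‖(u²)^{2^j a} − 1‖`);
* `norm_units_sq_sub_one_le` — `‖u² − 1‖ ≤ 2^{−3}` for a unit `u` of `ℤ₂`;
* `norm_padicLog_units_eq` — **`‖log₂ u‖ = 2 · ‖u² − 1‖`** for a unit `u` (the tree's log isometry
  `norm_padicLogSeries_eq` at `y = u²`, `‖1 − u²‖ ≤ 1/8 < ‖2‖`, and `log u² = 2 log u`, `padicLog_mul_holds`);
* `padicLog_two_pow_mul` — `log₂(2^k x) = log₂ x` (Iwasawa's normalisation `log₂ 2 = 0`, `padicLog_natCast_self_holds`);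
* `exists_depth_of_padicLog` — for `q = 2^k u`, `log₂ q ≠ 0`, `ord₂(log₂ q) ≤ K + 2`: there is `s` with `2 ≤ s ≤ K + 2`
  and `‖u² − 1‖ = 2^{−(s+1)}` (so `ord₂ log₂ q = s`, the "depth" of the Tate unit; `k_q = s − 2`).

References: K. Iwasawa, *Lectures on p-adic L-functions* (1972), §4.4 (the logarithm); J.-P. Serre, *A Course in
Arithmetic*, II §3; R. Greenberg, LNM 1716 (1999), §3 pp. 92–93; cell memo HOME/mult/NOTE-SP1ONE.md §5.
-/

section Part1

set_option autoImplicit false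

open scoped _root_.Classical

namespace Literature.NumberTheory.EllipticCurves.Greenberg1999.MultTowerSplitOrder

open _root_.PadicInt Literature.NumberTheory.EllipticCurves
  Literature.NumberTheory.EllipticCurves.Greenberg1999.MultTowerNS2

/-! ### Norm computations in `ℤ₂` -/

/-- `‖2‖ < 1` in `ℤ₂`. [folklore] -/
private theorem norm_two_lt_one : ‖(2 : ℤ_[2])‖ < 1 := by
  rw [norm_two_padicInt]; norm_num

/-- For `‖z − 1‖ < 1` in `ℤ₂` one has `‖z + 1‖ < 1` (`z + 1 = (z − 1) + 2`). [folklore] -/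
private theorem norm_add_one_lt_one {z : ℤ_[2]} (hz : ‖z - 1‖ < 1) : ‖z + 1‖ < 1 := by
  have h : z + 1 = (z - 1) + 2 := by ring
  rw [h]
  exact lt_of_le_of_lt (PadicInt.nonarchimedean _ _) (max_lt hz norm_two_lt_one)

/-- **`‖z^a − 1‖ = ‖z − 1‖` for `a` odd and `‖z − 1‖ < 1`** (in `ℤ₂`): `z^{a+2} − 1 = z²(z^a − 1) + (z² − 1)` and
`‖z² − 1‖ = ‖z − 1‖‖z + 1‖ < ‖z − 1‖`. [folklore] -/
private theorem norm_pow_sub_one_of_odd {z : ℤ_[2]} (hz : ‖z - 1‖ < 1) {a : ℕ} (ha : Odd a) :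
    ‖z ^ a - 1‖ = ‖z - 1‖ := by
  by_cases hz1 : z = 1
  · subst hz1; simp
  have hz0 : 0 < ‖z - 1‖ := norm_pos_iff.mpr (sub_ne_zero.mpr hz1)
  have hzn : ‖z‖ = 1 := by
    have h : z = (z - 1) + 1 := by ring
    rw [h, PadicInt.norm_add_eq_max_of_ne (by rw [norm_one]; exact ne_of_lt hz), norm_one, max_eq_right hz.le]
  have hsq : ‖z ^ 2 - 1‖ < ‖z - 1‖ := by
    have hfac : z ^ 2 - 1 = (z - 1) * (z + 1) := by ring
    rw [hfac, norm_mul]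
    exact mul_lt_of_lt_one_right hz0 (norm_add_one_lt_one hz)
  obtain ⟨j, rfl⟩ := ha
  induction j with
  | zero => simp
  | succ j ih =>
    have hrec : z ^ (2 * (j + 1) + 1) - 1 = z ^ 2 * (z ^ (2 * j + 1) - 1) + (z ^ 2 - 1) := by ring
    have h1 : ‖z ^ 2 * (z ^ (2 * j + 1) - 1)‖ = ‖z - 1‖ := by rw [norm_mul, norm_pow, hzn, one_pow, one_mul, ih]
    rw [hrec, PadicInt.norm_add_eq_max_of_ne (by rw [h1]; exact (ne_of_lt hsq).symm), h1, max_eq_left hsq.le]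

/-- **`‖y^{2^j} − 1‖ = ‖y − 1‖ · ‖2‖^j` for `‖y − 1‖ < ‖2‖`** (in `ℤ₂`; each squaring multiplies the distance to `1`
by `‖2‖`, tower-1's `norm_sq_sub_one_of_norm_sub_one_lt`). [folklore] -/
private theorem norm_pow_two_pow_sub_one {y : ℤ_[2]} (hy : ‖y - 1‖ < ‖(2 : ℤ_[2])‖) (j : ℕ) :
    ‖y ^ 2 ^ j - 1‖ = ‖y - 1‖ * ‖(2 : ℤ_[2])‖ ^ j := by
  induction j with
  | zero => simp
  | succ j ih =>
    have hlt : ‖y ^ 2 ^ j - 1‖ < ‖(2 : ℤ_[2])‖ := by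
      rw [ih]
      calc ‖y - 1‖ * ‖(2 : ℤ_[2])‖ ^ j ≤ ‖y - 1‖ * 1 :=
            mul_le_mul_of_nonneg_left (pow_le_one₀ (norm_nonneg _) norm_two_lt_one.le) (norm_nonneg _)
        _ < ‖(2 : ℤ_[2])‖ := by rw [mul_one]; exact hy
    rw [pow_succ, pow_mul, norm_sq_sub_one_of_norm_sub_one_lt hlt, ih, pow_succ]
    ring

/-- **`‖(y)^{2^j a} − 1‖ = ‖y − 1‖ · ‖2‖^j`** for `‖y − 1‖ < ‖2‖` and `a` odd. [folklore] -/
private theorem norm_pow_two_pow_mul_sub_one {y : ℤ_[2]} (hy : ‖y - 1‖ < ‖(2 : ℤ_[2])‖) (j : ℕ) {a : ℕ} (ha : Odd a) :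
    ‖y ^ (2 ^ j * a) - 1‖ = ‖y - 1‖ * ‖(2 : ℤ_[2])‖ ^ j := by
  have hya : ‖y ^ a - 1‖ = ‖y - 1‖ := norm_pow_sub_one_of_odd (hy.trans norm_two_lt_one) ha
  rw [mul_comm, pow_mul, norm_pow_two_pow_sub_one (by rw [hya]; exact hy), hya]

/-- **`u^{2^j a} ≢ ±1 (mod 2^{s+j+1})`** for `u ∈ ℤ₂` with `‖u² − 1‖ = 2^{−(s+1)}`, `s ≥ 1`, `a` odd and every `j`.
If `u^e ≡ ε (mod 2^{s+j+1})`, `e = 2^j a`, `ε = ±1`, then `u^{2e} − 1 = (u^e − ε)(u^e + ε)` has norm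
`< 2^{−(s+j+1)}`, contradicting `‖(u²)^{2^j a} − 1‖ = ‖u² − 1‖ · 2^{−j}`. DEPTH-`s` form of tower-1's BRICK 12
(`s = 2` ⇔ `u ≡ ±3 (mod 8)`). [folklore] -/
private theorem toZModPow_pow_ne_one_and_ne_neg_one_of_depth {u : ℤ_[2]} {s : ℕ} (hs : 1 ≤ s)
    (hu : ‖u ^ 2 - 1‖ = (2 : ℝ) ^ (-((s : ℤ) + 1))) {a : ℕ} (ha : Odd a) (j : ℕ) :
    toZModPow (s + j + 1) (u ^ (2 ^ j * a)) ≠ 1 ∧ toZModPow (s + j + 1) (u ^ (2 ^ j * a)) ≠ -1 := by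
  set e : ℕ := 2 ^ j * a with he
  -- `‖u^{2e} − 1‖ = 2^{−(s+j+1)}`
  have hy : ‖u ^ 2 - 1‖ < ‖(2 : ℤ_[2])‖ := by
    rw [hu, norm_two_padicInt, ← zpow_neg_one]
    exact zpow_lt_zpow_right₀ (by norm_num) (by omega)
  have hnorm : ‖u ^ (2 * e) - 1‖ = (2 : ℝ) ^ (-((s : ℤ) + j + 1)) := by
    rw [pow_mul, he, norm_pow_two_pow_mul_sub_one hy j ha, hu, norm_two_padicInt, inv_pow, ← zpow_natCast,
      ← zpow_neg, ← zpow_add₀ (by norm_num : (2 : ℝ) ≠ 0)]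
    congr 1; ring
  -- if `u^e ≡ ε`, then `‖u^{2e} − 1‖ < 2^{−(s+j+1)}`
  have key : ∀ ε : ℤ_[2], ε ^ 2 = 1 → toZModPow (s + j + 1) (u ^ e) ≠ toZModPow (s + j + 1) ε := by
    intro ε hε hcong
    rw [toZModPow_eq_iff_norm_sub_le] at hcong
    have hεn : ‖ε‖ = 1 := by
      have h := congrArg (fun z : ℤ_[2] ↦ ‖z‖) hε
      simp only [norm_pow, norm_one] at h
      exact (pow_eq_one_iff_of_nonneg (norm_nonneg ε) two_ne_zero).mp h
    have hplus : ‖u ^ e + ε‖ < 1 := by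
      have h : u ^ e + ε = (u ^ e - ε) + 2 * ε := by ring
      rw [h]
      refine lt_of_le_of_lt (PadicInt.nonarchimedean _ _) (max_lt (lt_of_le_of_lt hcong ?_) ?_)
      · exact zpow_lt_one_of_neg₀ (by norm_num) (by push_cast; omega)
      · rw [norm_mul, hεn, mul_one]; exact norm_two_lt_one
    have hfac : u ^ (2 * e) - 1 = (u ^ e - ε) * (u ^ e + ε) := by
      rw [show u ^ (2 * e) = (u ^ e) ^ 2 by rw [mul_comm, pow_mul]]
      linear_combination hε
    have hlt : ‖u ^ (2 * e) - 1‖ < (2 : ℝ) ^ (-((s : ℤ) + j + 1)) := by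
      rw [hfac, norm_mul]
      have hpos : (0 : ℝ) < (2 : ℝ) ^ (-((s : ℤ) + j + 1)) := zpow_pos (by norm_num) _
      rcases eq_or_lt_of_le (norm_nonneg (u ^ e - ε)) with h0 | h0
      · rw [← h0, zero_mul]; exact hpos
      · calc ‖u ^ e - ε‖ * ‖u ^ e + ε‖ < ‖u ^ e - ε‖ * 1 := mul_lt_mul_of_pos_left hplus h0
          _ ≤ (2 : ℝ) ^ (-((s : ℤ) + j + 1)) := by
            rw [mul_one]; convert hcong using 2; push_cast; ring
    rw [hnorm] at hlt
    exact lt_irrefl _ hlt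
  constructor
  · have h := key 1 (one_pow 2)
    rwa [map_one] at h
  · have h := key (-1) (by ring)
    rwa [map_neg, map_one] at h

/-! ### Units of `ℤ₂`: `u² ≡ 1 (mod 8)` -/

/-- **`‖u² − 1‖ ≤ 2^{−3}` for every unit `u` of `ℤ₂`** (`u² ≡ 1 (mod 8)`). [folklore] -/
private theorem norm_units_sq_sub_one_le (u : ℤ_[2]ˣ) : ‖(u : ℤ_[2]) ^ 2 - 1‖ ≤ (2 : ℝ) ^ (-(3 : ℤ)) := by
  have key : ∀ t t' : ZMod (2 ^ 3), t * t' = 1 → t ^ 2 = 1 := by decide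
  have h1 : toZModPow 3 ((u : ℤ_[2]) ^ 2) = toZModPow 3 (1 : ℤ_[2]) := by
    rw [map_pow, map_one]
    exact key _ (toZModPow 3 ((u⁻¹ : ℤ_[2]ˣ) : ℤ_[2])) (by rw [← map_mul, Units.mul_inv, map_one])
  have h := (toZModPow_eq_iff_norm_sub_le 3 _ _).mp h1
  exact_mod_cast h

/-! ### The Iwasawa logarithm of a `2`-adic unit -/

/-- **`log₂(2^k · x) = log₂ x`** (`x ≠ 0`): Iwasawa's normalisation `log₂ 2 = 0` (`padicLog_natCast_self_holds`) and
multiplicativity (`padicLog_mul_holds`). [cite: Iwasawa1972PadicL, §4.4] -/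
theorem padicLog_two_pow_mul (k : ℕ) {x : ℚ_[2]} (hx : x ≠ 0) :
    padicLog 2 ((2 : ℚ_[2]) ^ k * x) = padicLog 2 x := by
  have h2 : padicLog 2 (2 : ℚ_[2]) = 0 := by
    have h := padicLog_natCast_self_holds 2
    unfold padicLog_natCast_self at h
    exact_mod_cast h
  induction k with
  | zero => rw [pow_zero, one_mul]
  | succ k ih =>
    rw [pow_succ, mul_assoc, mul_comm (2 : ℚ_[2]), ← mul_assoc,
      padicLog_mul_holds 2 (mul_ne_zero (pow_ne_zero _ two_ne_zero) hx) two_ne_zero, ih, h2, add_zero]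

/-- **`‖log₂ u‖ = 2 · ‖u² − 1‖` for a unit `u` of `ℤ₂`**: `2 log₂ u = log₂ u² = L(u²)` (the logarithmic series,
`padicLog_eq_padicLogSeries`) and `‖L(y)‖ = ‖1 − y‖` for `‖1 − y‖ < ‖2‖` (the tree's log isometry
`norm_padicLogSeries_eq`; here `‖1 − u²‖ ≤ 1/8`). [cite: Iwasawa1972PadicL, §4.4] -/
theorem norm_padicLog_units_eq (u : ℤ_[2]ˣ) :
    ‖padicLog 2 ((u : ℤ_[2]) : ℚ_[2])‖ = 2 * ‖(u : ℤ_[2]) ^ 2 - 1‖ := by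
  set y : ℚ_[2] := ((u : ℤ_[2]) : ℚ_[2]) ^ 2 with hy
  have hu0 : ((u : ℤ_[2]) : ℚ_[2]) ≠ 0 := by
    intro h; exact u.ne_zero (PadicInt.coe_eq_zero.mp h)
  have hyn : ‖1 - y‖ = ‖(u : ℤ_[2]) ^ 2 - 1‖ := by
    rw [← norm_neg, neg_sub, hy, PadicInt.norm_def, PadicInt.coe_sub, PadicInt.coe_pow, PadicInt.coe_one]
  have h8 : ‖1 - y‖ ≤ (2 : ℝ) ^ (-(3 : ℤ)) := by rw [hyn]; exact norm_units_sq_sub_one_le u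
  have htwo : ‖(2 : ℚ_[2])‖ = (2 : ℝ)⁻¹ := by
    have h : ‖((2 : ℕ) : ℚ_[2])‖ = ((2 : ℕ) : ℝ)⁻¹ := Padic.norm_p
    simpa using h
  have hy2 : ‖1 - y‖ < ‖(2 : ℚ_[2])‖ := by
    rw [htwo]; exact lt_of_le_of_lt h8 (by norm_num)
  have hy1 : ‖1 - y‖ < 1 := hy2.trans (by rw [htwo]; norm_num)
  -- `log y = L(y)`, `‖L(y)‖ = ‖1 − y‖`, `log y = 2 log u`
  have hlogy : padicLog 2 y = padicLogSeries 2 y := padicLog_eq_padicLogSeries hy1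
  have hiso : ‖padicLogSeries 2 y‖ = ‖1 - y‖ := norm_padicLogSeries_eq hy2
  have hmul : padicLog 2 y = 2 * padicLog 2 ((u : ℤ_[2]) : ℚ_[2]) := by
    rw [hy, sq, padicLog_mul_holds 2 hu0 hu0, two_mul]
  have h : ‖(2 : ℚ_[2])‖ * ‖padicLog 2 ((u : ℤ_[2]) : ℚ_[2])‖ = ‖(u : ℤ_[2]) ^ 2 - 1‖ := by
    rw [← norm_mul, ← hmul, hlogy, hiso, hyn]
  rw [htwo] at h
  linarith [h]

/-- **The depth of the Tate unit from the Iwasawa logarithm.** For `q = 2^k · u` (`u` a unit of `ℤ₂`) with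
`log₂ q ≠ 0` and `ord₂(log₂ q) ≤ K + 2`, there is `s` with `2 ≤ s ≤ K + 2` and `‖u² − 1‖ = 2^{−(s+1)}` (indeed
`ord₂ log₂ q = s`: `‖log₂ q‖ = ‖log₂ u‖ = 2‖u² − 1‖`). This converts the certificate `hkq` of the split TOWER doors
(`ord₂(log₂ q_E) ≤ k_q + 2`) into the `2`-adic depth hypothesis of the non-norm lemmas.
[cite: Iwasawa1972PadicL, §4.4] [cite: GreenbergLNM1716, §3, between Prop. 3.6 and Prop. 3.7 (PDF pp. 92–93)] -/
theorem exists_depth_of_padicLog {q : ℚ_[2]} {k : ℕ} {u : ℤ_[2]ˣ}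
    (hq : q = (2 : ℚ_[2]) ^ k * ((u : ℤ_[2]) : ℚ_[2])) (hlog : padicLog 2 q ≠ 0) {K : ℕ}
    (hK : (padicLog 2 q).valuation ≤ (K : ℤ) + 2) :
    ∃ s : ℕ, 2 ≤ s ∧ s ≤ K + 2 ∧ ‖(u : ℤ_[2]) ^ 2 - 1‖ = (2 : ℝ) ^ (-((s : ℤ) + 1)) := by
  have hu0 : ((u : ℤ_[2]) : ℚ_[2]) ≠ 0 := by
    intro h; exact u.ne_zero (PadicInt.coe_eq_zero.mp h)
  have hlogq : padicLog 2 q = padicLog 2 ((u : ℤ_[2]) : ℚ_[2]) := by rw [hq, padicLog_two_pow_mul k hu0]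
  have hnorm := norm_padicLog_units_eq u
  rw [← hlogq] at hnorm
  -- `x = u² − 1 ≠ 0`
  set x : ℤ_[2] := (u : ℤ_[2]) ^ 2 - 1 with hx
  have hx0 : x ≠ 0 := by
    intro h0
    rw [h0, norm_zero, mul_zero, norm_eq_zero] at hnorm
    exact hlog hnorm
  -- `‖x‖ = 2^{−v}` with `v ≥ 3`
  have hxv : ‖x‖ = (2 : ℝ) ^ (-(x.valuation : ℤ)) := by
    have h := PadicInt.norm_eq_zpow_neg_valuation hx0
    exact_mod_cast h
  have h3 : 3 ≤ x.valuation := by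
    have hle : ‖x‖ ≤ (2 : ℝ) ^ (-(3 : ℤ)) := norm_units_sq_sub_one_le u
    rw [hxv] at hle
    have := (zpow_le_zpow_iff_right₀ (by norm_num : (1 : ℝ) < 2)).mp hle
    omega
  -- `‖log q‖ = 2^{−(v − 1)}`, so `ord₂ log q = v − 1`
  have hlq : ‖padicLog 2 q‖ = (2 : ℝ) ^ (-((x.valuation : ℤ) - 1)) := by
    rw [hnorm, hxv, show -((x.valuation : ℤ) - 1) = 1 + -(x.valuation : ℤ) by ring,
      zpow_add₀ (by norm_num : (2 : ℝ) ≠ 0), zpow_one]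
  have hval : (padicLog 2 q).valuation = (x.valuation : ℤ) - 1 := by
    have h := Padic.norm_eq_zpow_neg_valuation hlog
    rw [hlq] at h
    have h' : -((x.valuation : ℤ) - 1) = -(padicLog 2 q).valuation :=
      zpow_right_injective₀ (by norm_num : (0 : ℝ) < 2) (by norm_num : (2 : ℝ) ≠ 1) (by exact_mod_cast h)
    omega
  refine ⟨x.valuation - 1, by omega, ?_, ?_⟩
  · have : (padicLog 2 q).valuation ≤ (K : ℤ) + 2 := hK
    rw [hval] at this
    omega
  · rw [hxv]
    congr 1
    omega

end Literature.NumberTheory.EllipticCurves.Greenberg1999.MultTowerSplitOrder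

end Part1

/-!
## Part 2 — port of `Summits/BirchSwinnertonDyer/BirchSwinnertonDyer/Theorems/ByReductionTypeAtTwoMultTowerSplitOrderPrelims.lean`

# Route `ByReductionTypeAtTwo`, crux `MultUpperHalfAtTwo` (item stmt-BirchSwinnertonDyer-19922), TOWER road, the
# SPLIT rows: KERNEL BRICK S4a — preliminaries for the split ORDER bound: the pigeonhole in a subgroup of `ℤ`,
# split reduction at the place `v ∋ p`, the ring isomorphism `ℚ_v ≃ ℚ_p` carrying Tate parameters, `ℚ₂ˣ ∩ {‖x‖<1} ⊆ 2^ℕ ℤ₂ˣ`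

HONEST FRAMING (cell `bsd-2adic`, run/shared/lean/pub/bsd-2adic/, seat `bsd-2adic-mult` GEN 13, HUMAN RULINGS
D-0036 / D-0054 / D-0074): TOOL theorems only (no definition, no named fact, no `sorry`); closes nothing by itself;
nothing booked; BSD is not proved by any of this. Small lemmas consumed by the count
(`ByReductionTypeAtTwoMultTowerSplitOrderCount.lean`) and the kernel theorem (`…SplitOrderBound.lean`) of the split ORDER
bound `#𝒦_{v,n}[2^∞] ≤ 2^k` (the projection of the PRINT named fact
`Greenberg1999.sec3_natCard_localTowerKerPrimary_splitMultiplicative_rat` consumed by `MultTowerCert.atTwo_le_pow_of_split`).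

* `exists_ne_modEq_of_mem_addSubgroup` — if `S ≤ ℤ` contains `2^R` (`R = j + w + 1`) and no `2^j · odd`, then among
  `N > 2^w` elements of `S` two are congruent mod `2^R` (`S = 2^c ℤ`, `j < c ≤ R`; Mathlib `Int.subgroup_cyclic`);
* `hasSplitMultiplicativeReductionAt_of_atPrime` — split at the rational prime `p` ⇒ split at the place `v ∋ p`;
* `exists_ringEquiv_tateParameter` — a ring isomorphism `e : ℚ_v ≃ ℚ_p` with `e(q) = Dq.q` for every local Tate parameter
  `q` (`tateJ q = j(W)`, `‖q‖ < 1`) and every `Dq : TateParameterData W p` (BRICK S3 `padicEquiv_eq_tateParameter`);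
* `exists_eq_two_pow_mul_units` — `x ∈ ℚ₂`, `x ≠ 0`, `‖x‖ < 1` ⇒ `x = 2^k u`, `k ∈ ℕ`, `u ∈ ℤ₂ˣ`.

References: R. Greenberg, LNM 1716 (1999), §3 pp. 92–93; J. Silverman, GTM 151, Lemma V.5.1, Thm. V.5.3.
-/

section Part2

set_option autoImplicit false

open scoped _root_.Classical

namespace Literature.NumberTheory.EllipticCurves.Greenberg1999.MultTowerSplitOrder

open _root_.NumberField _root_.IsDedekindDomain _root_.Field _root_.WeierstrassCurve _root_.PadicInt _root_.Rat.HeightOneSpectrum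
  Literature.NumberTheory.EllipticCurves Literature.NumberTheory.GaloisRepresentations
  Literature.NumberTheory.EllipticCurves.Greenberg1999.MultTowerNS2

/-! ### Arithmetic preliminaries -/

/-- **Pigeonhole in a subgroup of `ℤ`.** If `S ≤ ℤ` contains `2^R`, `R = j + w + 1`, and contains no `2^j · a` with `a`
odd, then among `N > 2^w` elements of `S` two are congruent mod `2^R` (`S = 2^c ℤ` with `j < c ≤ R`). [folklore] -/
private theorem exists_ne_modEq_of_mem_addSubgroup (S : AddSubgroup ℤ) {R j w : ℕ} (hR : R = j + w + 1)
    (hmem : ((2 : ℤ) ^ R) ∈ S) (hnot : ∀ a : ℕ, Odd a → ((2 : ℤ) ^ j * a) ∉ S)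
    {N : ℕ} (hN : 2 ^ w < N) (b : Fin N → ℤ) (hb : ∀ i, b i ∈ S) :
    ∃ i i' : Fin N, i ≠ i' ∧ b i ≡ b i' [ZMOD (2 : ℤ) ^ R] := by
  obtain ⟨d, hd⟩ := Int.subgroup_cyclic S
  have hmemS : ∀ x : ℤ, x ∈ S ↔ (d.natAbs : ℤ) ∣ x := by
    intro x
    rw [hd, AddSubgroup.mem_closure_singleton, Int.natAbs_dvd]
    constructor
    · rintro ⟨n, rfl⟩
      exact ⟨n, by rw [smul_eq_mul, mul_comm]⟩
    · rintro ⟨n, rfl⟩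
      exact ⟨n, by rw [smul_eq_mul, mul_comm]⟩
  -- `|d| = 2^c` with `j < c ≤ R`
  have hdvd : d.natAbs ∣ 2 ^ R := by
    have h := (hmemS _).mp hmem
    exact_mod_cast Int.natAbs_dvd_natAbs.mpr h
  obtain ⟨c, hcR, hc⟩ := (Nat.dvd_prime_pow Nat.prime_two).mp hdvd
  have hjc : j < c := by
    by_contra hle
    push Not at hle
    apply hnot 1 odd_one
    rw [hmemS, hc, Nat.cast_one, mul_one]
    exact_mod_cast pow_dvd_pow 2 hle
  -- `b i = 2^c * t i`
  have ht : ∀ i, ∃ t : ℤ, b i = (2 : ℤ) ^ c * t := fun i ↦ by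
    obtain ⟨t, ht⟩ := (hmemS _).mp (hb i)
    exact ⟨t, by rw [ht, hc]; push_cast; ring⟩
  choose t ht using ht
  -- pigeonhole on `t i mod 2^(R - c)`
  have hcard : Fintype.card (ZMod (2 ^ (R - c))) < Fintype.card (Fin N) := by
    rw [ZMod.card, Fintype.card_fin]
    calc 2 ^ (R - c) ≤ 2 ^ w := Nat.pow_le_pow_right (by norm_num) (by omega)
      _ < N := hN
  obtain ⟨i, i', hii', h⟩ := Fintype.exists_ne_map_eq_of_card_lt (fun i ↦ (t i : ZMod (2 ^ (R - c)))) hcard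
  refine ⟨i, i', hii', ?_⟩
  have hmod : t i ≡ t i' [ZMOD ((2 ^ (R - c) : ℕ) : ℤ)] := (ZMod.intCast_eq_intCast_iff _ _ _).mp h
  have h2 := Int.ModEq.mul_left' (c := (2 : ℤ) ^ c) hmod
  rw [← ht, ← ht] at h2
  have hRc : (2 : ℤ) ^ c * (((2 ^ (R - c) : ℕ)) : ℤ) = (2 : ℤ) ^ R := by
    push_cast
    rw [← pow_add, Nat.add_sub_cancel' hcR]
  rwa [hRc] at h2

/-- Split multiplicative reduction at the rational prime `p` gives it at the place `v ∋ p` (Mathlib's `ℚ_v ≃ ℚ_p`;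
the tree's `hasSplitMultiplicativeReductionAtPrime_iff_hasSplitMultiplicativeReductionAt`). [folklore] -/
private theorem hasSplitMultiplicativeReductionAt_of_atPrime (W : WeierstrassCurve ℚ) [W.IsElliptic] {p : ℕ} [Fact p.Prime]
    (v : HeightOneSpectrum (𝓞 ℚ)) (hv : ((p : ℕ) : 𝓞 ℚ) ∈ v.asIdeal) (h : W.HasSplitMultiplicativeReductionAtPrime p) :
    W.HasSplitMultiplicativeReductionAt v := by
  obtain rfl : ((primesEquiv v : Nat.Primes) : ℕ) = p := primesEquiv_eq_of_natCast_mem v (Fact.out) hv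
  exact (hasSplitMultiplicativeReductionAtPrime_iff_hasSplitMultiplicativeReductionAt W v).mp h

/-- **A ring isomorphism `ℚ_v ≃ ℚ_p` (`v ∋ p`) carrying every local Tate parameter to THE Tate parameter of any
`TateParameterData` at `p`** (Mathlib's `padicEquiv v`, BRICK S3 `padicEquiv_eq_tateParameter`). [folklore] -/
private theorem exists_ringEquiv_tateParameter (p : ℕ) [Fact p.Prime] (v : HeightOneSpectrum (𝓞 ℚ))
    (hv : ((p : ℕ) : 𝓞 ℚ) ∈ v.asIdeal) :
    ∃ e : v.adicCompletion ℚ ≃+* ℚ_[p], ∀ (W : WeierstrassCurve ℚ) [W.IsElliptic] (q : v.adicCompletion ℚ),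
      q ≠ 0 → ‖q‖ < 1 → tateJ q = algebraMap ℚ (v.adicCompletion ℚ) W.j →
        ∀ Dq : TateParameterData W p, e q = Dq.q := by
  obtain rfl : ((primesEquiv v : Nat.Primes) : ℕ) = p := primesEquiv_eq_of_natCast_mem v (Fact.out) hv
  exact ⟨(adicCompletion.padicEquiv (R := 𝓞 ℚ) v).toAlgEquiv.toRingEquiv,
    fun W _ q hq0 hq hqj Dq ↦ padicEquiv_eq_tateParameter W v hq0 hq hqj Dq⟩

/-- `ℚ₂ˣ ∩ {‖x‖ < 1} ⊆ 2^{ℕ} · ℤ₂ˣ`: a non-zero `x ∈ ℚ₂` with `‖x‖ < 1` is `2^k · u`, `k ∈ ℕ`, `u` a unit. [folklore] -/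
private theorem exists_eq_two_pow_mul_units {x : ℚ_[2]} (hx0 : x ≠ 0) (hx : ‖x‖ < 1) :
    ∃ (k : ℕ) (u : ℤ_[2]ˣ), x = (2 : ℚ_[2]) ^ k * ((u : ℤ_[2]) : ℚ_[2]) := by
  obtain ⟨j, u, hju⟩ := exists_eq_two_zpow_mul_units x hx0
  have hj : 0 ≤ j := by
    by_contra hneg
    push Not at hneg
    have hn : ‖x‖ = (2 : ℝ) ^ (-j) := by
      rw [hju, norm_mul, norm_two_zpow_padic, show ‖((u : ℤ_[2]) : ℚ_[2])‖ = 1 from PadicInt.norm_units u, mul_one]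
    have : (1 : ℝ) ≤ (2 : ℝ) ^ (-j) := one_le_zpow₀ (by norm_num) (by omega)
    linarith
  refine ⟨j.toNat, u, ?_⟩
  rw [hju, ← zpow_natCast, Int.toNat_of_nonneg hj]

end Literature.NumberTheory.EllipticCurves.Greenberg1999.MultTowerSplitOrder

end Part2

/-!
## Part 3 — port of `Summits/BirchSwinnertonDyer/BirchSwinnertonDyer/Theorems/ByReductionTypeAtTwoMultTowerSplitOrderNonNorm.lean`

# Route `ByReductionTypeAtTwo`, crux `MultUpperHalfAtTwo` (item stmt-BirchSwinnertonDyer-19922), TOWER road, the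
# SPLIT rows: KERNEL BRICK S2 — the DEPTH non-norm lemmas: `q^{2^j a} ∉ N(F_{j+w+1}ˣ)` for a Tate parameter
# `q = 2^k u` of depth `w` (`‖u² − 1‖ = 2^{−(w+3)}`, i.e. `ord₂ log₂ q = w + 2`), absolute and relative (orbit-product) form

HONEST FRAMING (cell `bsd-2adic`, run/shared/lean/pub/bsd-2adic/, seat `bsd-2adic-mult` GEN 13, HUMAN RULINGS
D-0036 / D-0054 / D-0074): TOOL theorems only (no definition, no named fact, no `sorry`); closes nothing by itself;
nothing booked; BSD is not proved by any of this. Second brick of the KERNEL proof of the projection of the PRINT named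
fact `Greenberg1999.sec3_natCard_localTowerKerPrimary_splitMultiplicative_rat` consumed by the split TOWER doors
(`MultTowerCert.atTwo_le_pow_of_split`). DEPTH-`w` generalisations of tower-1's BRICK 14 tail
(`MultTowerNS2.norm_ne_pow_of_tateUnit`, `w = 0`) and BRICK 15 tail (`MultTowerNS2.prod_smul_ne_pow_of_tateUnit`), with
the SAME proofs: the norm group of the `m`-th local layer `F_m` of the cyclotomic `ℤ₂`-tower at `v ∋ 2` is
`⟨2⟩ · ±(1 + 2^{m+2}ℤ₂)` (tower-1's `mem_range_norm_fixedField_layer_iff`, from the PROVED local class field axiom), and the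
unit part `u^{2^j a}` of `q^{2^j a}` is `≢ ±1 (mod 2^{j+w+3})` (BRICK S1 `toZModPow_pow_ne_one_and_ne_neg_one_of_depth`).
Setting: `κ` THE cyclotomic `ℤ₂`-extension, `v ∋ 2`, `H_m = localSubgroup (κ.layerSubgroup m) ℚ_v`, `F_m = K̄_v^{H_m}`,
`e : ℚ_v ≃+* ℚ₂` any ring isomorphism, `q ∈ ℚ_v` with `e q = 2^k u`, `u ∈ ℤ₂ˣ`.

* `prod_smul_two_pow_succ` / `prod_smul_two_pow_add` — orbit products one / several layers up: `N_{R+1}(x) = N_R(x)²`,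
  `N_{R+i}(x) = N_R(x)^{2^i}` when `g^{2^R} x = x` (any field);
* `norm_ne_pow_of_depth` — **`N_{F_m/ℚ_v}(f) ≠ q^{2^j a}`** for `m = j + w + 1`, `a` odd;
* `prod_smul_ne_pow_of_depth` — **`∏_{i<2^R} g^i f ≠ q^{2^j a}`** for `f ∈ K̄_v^{H_{n+R}}`, `R = j + w + 1`, `g` a topological
  generator of `H_n` mod `H_∞` (`κ(res g) = 2^n u_g`) — the relative non-norm lemma over `F_n` in the orbit-product
  form the split count consumes (representatives `g₀^i g^j` of `Γ/H_{n+R}` reduce it to the absolute one at level `n + R`).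

References: R. Greenberg, LNM 1716 (1999), §3 pp. 92–93; J. Neukirch, *ANT* V (1.1); L. Washington, GTM 83, §13.1;
cell memo HOME/mult/NOTE-SP1ONE.md §5.
-/

section Part3

set_option autoImplicit false

open scoped _root_.Classical _root_.IntermediateField

namespace Literature.NumberTheory.EllipticCurves.Greenberg1999.MultTowerSplitOrder

open _root_.NumberField _root_.IsDedekindDomain _root_.Field _root_.PadicInt Literature.NumberTheory.EllipticCurves
  Literature.NumberTheory.GaloisRepresentations
  Literature.NumberTheory.EllipticCurves.Greenberg1999.MultTowerNS2

/-! ### Orbit products several layers up -/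

section OrbitProducts

variable {K : Type*} [Field K]

/-- **`N_{R+1}(x) = N_R(x)²` when `g^{2^R} x = x`**: `∏_{i<2^{R+1}} g^i x = N_R(x) · g^{2^R} N_R(x)` and `g^{2^R}` fixes
`N_R(x)`. [folklore] -/
private theorem prod_smul_two_pow_succ (g : absoluteGaloisGroup K) (R : ℕ) {x : AlgebraicClosure K}
    (hx : (g ^ 2 ^ R) • x = x) :
    (∏ i ∈ Finset.range (2 ^ (R + 1)), (g ^ i) • x) = (∏ i ∈ Finset.range (2 ^ R), (g ^ i) • x) ^ 2 := by
  rw [pow_succ', prod_smul_range_two_mul, pow_smul_prod_smul_eq g (2 ^ R) hx, sq]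

/-- **`N_{R+i}(x) = N_R(x)^{2^i}` when `g^{2^R} x = x`.** [folklore] -/
private theorem prod_smul_two_pow_add (g : absoluteGaloisGroup K) (R : ℕ) {x : AlgebraicClosure K}
    (hx : (g ^ 2 ^ R) • x = x) (i : ℕ) :
    (∏ i ∈ Finset.range (2 ^ (R + i)), (g ^ i) • x) = (∏ i ∈ Finset.range (2 ^ R), (g ^ i) • x) ^ 2 ^ i := by
  induction i with
  | zero => simp
  | succ i ih =>
    have hxi : (g ^ 2 ^ (R + i)) • x = x := by
      rw [pow_add, pow_mul]
      -- `(g^{2^R})^{2^i} x = x`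
      have h : ∀ n : ℕ, ((g ^ 2 ^ R) ^ n) • x = x := fun n ↦ by
        induction n with
        | zero => rw [pow_zero, one_smul]
        | succ n ihn => rw [pow_succ, mul_smul, hx, ihn]
      exact h _
    rw [show R + (i + 1) = (R + i) + 1 by ring, prod_smul_two_pow_succ g (R + i) hxi, ih, ← pow_mul, ← pow_succ]

end OrbitProducts

/-! ### The absolute non-norm lemma at depth `w` -/

variable {κ : ZpExtension ℚ 2}

/-- Index bookkeeping for `toZModPow`: congruences `≡ ±1` at equal moduli. [folklore] -/
private theorem toZModPow_eq_one_or_iff_of_eq {N N' : ℕ} (h : N = N') (x : ℤ_[2]) :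
    (toZModPow N x = 1 ∨ toZModPow N x = -1) ↔ (toZModPow N' x = 1 ∨ toZModPow N' x = -1) := by
  subst h; exact Iff.rfl

/-- **The tower non-norm lemma at depth `w`, absolute form.** For `v ∋ 2`, a ring isomorphism `e : ℚ_v ≃ ℚ₂`, `q ∈ ℚ_v`
with `e q = 2^k · u`, `u ∈ ℤ₂ˣ` of depth `w` (`‖u² − 1‖ = 2^{−(w+3)}`, i.e. `ord₂ log₂ q = w + 2`, BRICK S1), `a` odd and
`m = j + w + 1`: **no element of the local layer `F_m` has norm `q^{2^j a}`** — norms from `F_m` have unit part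
`≡ ±1 (mod 2^{m+2})` (tower-1's `mem_range_norm_fixedField_layer_iff`), while `u^{2^j a} ≢ ±1 (mod 2^{j+w+3})` (BRICK S1).
The case `w = 0` (`u ≡ ±3 (mod 8)`) is tower-1's `norm_ne_pow_of_tateUnit`.
[cite: NeukirchANT1999, Ch. V §1 Thm. (1.1)] [cite: GreenbergLNM1716, §3, between Prop. 3.6 and Prop. 3.7 (PDF pp. 92–93)] -/
theorem norm_ne_pow_of_depth (hκ : κ.IsCyclotomic) (v : HeightOneSpectrum (𝓞 ℚ))
    (hv : ((2 : ℕ) : 𝓞 ℚ) ∈ v.asIdeal) (p : ℕ) [Fact p.Prime] (hp : p = 2)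
    (e : v.adicCompletion ℚ ≃+* ℚ_[p]) {q : v.adicCompletion ℚ} {k : ℕ} {u : ℤ_[p]ˣ}
    (hq : e q = (p : ℚ_[p]) ^ k * ((u : ℤ_[p]) : ℚ_[p])) {w : ℕ}
    (hu : ‖(u : ℤ_[p]) ^ 2 - 1‖ = (2 : ℝ) ^ (-((w : ℤ) + 3))) {a : ℕ} (ha : Odd a) {j m : ℕ} (hm : m = j + w + 1)
    (f : IntermediateField.fixedField (localSubgroup (κ.layerSubgroup m) (v.adicCompletion ℚ))) :
    Algebra.norm (v.adicCompletion ℚ) f ≠ q ^ (2 ^ j * a) := by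
  subst hp
  subst hm
  intro hf
  -- `q ≠ 0` and the norm is a unit of `ℚ_v`
  have hq' : e q = (2 : ℚ_[2]) ^ k * ((u : ℤ_[2]) : ℚ_[2]) := by simpa using hq
  have hq0 : q ≠ 0 := by
    intro h0
    rw [h0, map_zero, eq_comm, mul_eq_zero] at hq'
    rcases hq' with h | h
    · exact absurd h (pow_ne_zero _ (by norm_num))
    · exact u.ne_zero (PadicInt.coe_eq_zero.mp h)
  haveI := finiteDimensional_fixedField_localSubgroup_layerSubgroup (κ := κ) v (j + w + 1)
  have hmem : Units.mk0 (q ^ (2 ^ j * a)) (pow_ne_zero _ hq0) ∈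
      (Units.map (Algebra.norm (v.adicCompletion ℚ) :
        IntermediateField.fixedField (localSubgroup (κ.layerSubgroup (j + w + 1)) (v.adicCompletion ℚ)) →*
          v.adicCompletion ℚ)).range := by
    have hf0 : f ≠ 0 := by
      rintro rfl
      rw [Algebra.norm_zero] at hf
      exact pow_ne_zero _ hq0 hf.symm
    exact ⟨Units.mk0 f hf0, Units.ext (by simp [hf])⟩
  rw [mem_range_norm_fixedField_layer_iff hκ v hv (by omega) 2 rfl e] at hmem
  obtain ⟨j', w', hw', hjw⟩ := hmem
  have hlhs : e (q ^ (2 ^ j * a)) = (2 : ℚ_[2]) ^ (((k * (2 ^ j * a) : ℕ)) : ℤ) *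
      (((u ^ (2 ^ j * a) : ℤ_[2]ˣ) : ℤ_[2]) : ℚ_[2]) := by
    rw [map_pow, hq', mul_pow, ← pow_mul, zpow_natCast, Units.val_pow_eq_pow_val, PadicInt.coe_pow]
  rw [Units.val_mk0, hlhs] at hjw
  have hjw' : (2 : ℚ_[2]) ^ (((k * (2 ^ j * a) : ℕ)) : ℤ) * (((u ^ (2 ^ j * a) : ℤ_[2]ˣ) : ℤ_[2]) : ℚ_[2]) =
      (2 : ℚ_[2]) ^ j' * ((w' : ℤ_[2]) : ℚ_[2]) := by simpa using hjw
  obtain ⟨-, hwU⟩ := two_zpow_mul_units_inj hjw'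
  -- `w' = u ^ (2^j a)` has residue `≢ ±1 (mod 2^{j+w+3})`
  have hu' : ‖(u : ℤ_[2]) ^ 2 - 1‖ = (2 : ℝ) ^ (-(((w + 2 : ℕ) : ℤ) + 1)) := by
    rw [hu]; congr 1
  obtain ⟨h1, h2⟩ := toZModPow_pow_ne_one_and_ne_neg_one_of_depth (s := w + 2) (by omega) hu' ha j
  rw [← Units.val_pow_eq_pow_val, hwU] at h1 h2
  have hw'' := (toZModPow_eq_one_or_iff_of_eq (show j + w + 1 + 2 = w + 2 + j + 1 by ring) (w' : ℤ_[2])).mp hw'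
  rcases hw'' with h | h
  · exact h1 h
  · exact h2 h

/-! ### The relative non-norm lemma in orbit-product form -/

/-- **`∏_{i<2^R} g^i(f) ≠ q^{2^j a}` for `f ∈ F_{n+R}`, `R = j + w + 1`, `a` odd, `q` of depth `w`.** Here `κ` is the
cyclotomic `ℤ₂`-extension, `v ∋ 2`, `g ∈ Γ_{ℚ_v}` with `κ(res g) = 2^n u_g` (a topological generator of `H_n` modulo `H_∞`),
`e : ℚ_v ≃ ℚ₂` a ring isomorphism and `q ∈ ℚ_v` with `e q = 2^k u`, `‖u² − 1‖ = 2^{−(w+3)}`. With `g₀`, `κ(res g₀) = 1`, the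
elements `g₀^i g^j` (`i < 2^n`, `j < 2^R`) represent `Γ/H_{n+R}`, so `N_{F_{n+R}/ℚ_v}(f) = ∏_i g₀^i(∏_j g^j f)`; if the inner
product were `q^{2^j a} ∈ ℚ_v` the norm would be `q^{2^{n+j} a}`, contradicting `norm_ne_pow_of_depth` at level
`n + R = (n + j) + w + 1`. This is `q^{2^j a} ∉ N(F_{n+R}/F_n)` — the order of `[q]` in `F_nˣ/N(F_{n+R}ˣ)` is at least
`2^{R−w}` — in the form consumed by the split count; `w = 0` is tower-1's `prod_smul_ne_pow_of_tateUnit`.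
[cite: NeukirchANT1999, Ch. V §1 Thm. (1.1)] [cite: GreenbergLNM1716, §3, between Prop. 3.6 and Prop. 3.7 (PDF pp. 92–93)] -/
theorem prod_smul_ne_pow_of_depth (hκ : κ.IsCyclotomic) (v : HeightOneSpectrum (𝓞 ℚ))
    (hv : ((2 : ℕ) : 𝓞 ℚ) ∈ v.asIdeal) (p : ℕ) [Fact p.Prime] (hp : p = 2)
    (e : v.adicCompletion ℚ ≃+* ℚ_[p]) {q : v.adicCompletion ℚ} {k : ℕ} {u : ℤ_[p]ˣ}
    (hq : e q = (p : ℚ_[p]) ^ k * ((u : ℤ_[p]) : ℚ_[p])) {w : ℕ}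
    (hu : ‖(u : ℤ_[p]) ^ 2 - 1‖ = (2 : ℝ) ^ (-((w : ℤ) + 3)))
    (n : ℕ) {g : absoluteGaloisGroup (v.adicCompletion ℚ)} {ug : ℤ_[2]ˣ}
    (hug : ((κ (resGal (K := ℚ) (v.adicCompletion ℚ) g)).toAdd : ℤ_[2]) = 2 ^ n * (ug : ℤ_[2]))
    {a : ℕ} (ha : Odd a) {j R : ℕ} (hR : R = j + w + 1) {f : AlgebraicClosure (v.adicCompletion ℚ)}
    (hf : ∀ h ∈ localSubgroup (κ.layerSubgroup (n + R)) (v.adicCompletion ℚ), h • f = f) :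
    (∏ i ∈ Finset.range (2 ^ R), (g ^ i) • f) ≠
      algebraMap (v.adicCompletion ℚ) (AlgebraicClosure (v.adicCompletion ℚ)) (q ^ (2 ^ j * a)) := by
  intro hprod
  -- a local element `g₀` with `κ(res g₀) = 1`, and the representatives `g₀^i g^j` of `Γ/H_{n+R}`
  obtain ⟨g₀, hg₀'⟩ := surjective_kappa_comp_resGal hκ v hv (Multiplicative.ofAdd (1 : ℤ_[2]))
  have hg₀ : ((κ (resGal (K := ℚ) (v.adicCompletion ℚ) g₀)).toAdd : ℤ_[2]) = 2 ^ 0 * ((1 : ℤ_[2]ˣ) : ℤ_[2]) := by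
    have h := congrArg Multiplicative.toAdd hg₀'
    rw [toAdd_ofAdd] at h
    rw [pow_zero, Units.val_one, one_mul]
    exact h
  have hcov : ∀ σ : absoluteGaloisGroup (v.adicCompletion ℚ), ∃ ji : Fin (2 ^ n) × Fin (2 ^ R),
      σ⁻¹ * (g₀ ^ (ji.1 : ℕ) * g ^ (ji.2 : ℕ)) ∈ localSubgroup (κ.layerSubgroup (n + R)) (v.adicCompletion ℚ) := by
    intro σ
    have hσ0 : σ ∈ localSubgroup (κ.layerSubgroup 0) (v.adicCompletion ℚ) := by
      rw [mem_localSubgroup_iff, ZpExtension.mem_layerSubgroup, pow_zero]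
      exact one_dvd _
    obtain ⟨i, hi, hiσ⟩ := exists_pow_inv_mul_mem_localSubgroup_layerSubgroup (κ := κ) v 0 n hg₀ hσ0
    rw [Nat.zero_add] at hiσ
    obtain ⟨i', hi', hi'σ⟩ := exists_pow_inv_mul_mem_localSubgroup_layerSubgroup (κ := κ) v n R hug hiσ
    refine ⟨(⟨i, hi⟩, ⟨i', hi'⟩), ?_⟩
    have h := Subgroup.inv_mem _ hi'σ
    have heq : ((g ^ i')⁻¹ * ((g₀ ^ i)⁻¹ * σ))⁻¹ = σ⁻¹ * (g₀ ^ i * g ^ i') := by group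
    rw [heq] at h
    exact h
  -- the fixed field `F_{n+R}` and `f` as its element
  haveI := finiteDimensional_fixedField_localSubgroup_layerSubgroup (κ := κ) v (n + R)
  haveI := isGalois_fixedField_localSubgroup_layerSubgroup (κ := κ) v (n + R)
  have hrank := finrank_fixedField_localSubgroup_layerSubgroup hκ v hv (n + R)
  have hopen := isOpen_localSubgroup (κ.layerSubgroup (n + R)) (κ.isOpen_layerSubgroup (n + R)) (v.adicCompletion ℚ)
  let f' : IntermediateField.fixedField (localSubgroup (κ.layerSubgroup (n + R)) (v.adicCompletion ℚ)) :=
    ⟨f, (IntermediateField.mem_fixedField_iff _ _).mpr fun h hh ↦ hf h hh⟩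
  have hne := norm_ne_pow_of_depth hκ v hv p hp e hq hu ha (j := n + j) (m := n + R) (by omega) f'
  have hcard : Fintype.card (Fin (2 ^ n) × Fin (2 ^ R)) = Module.finrank (v.adicCompletion ℚ)
      (IntermediateField.fixedField (localSubgroup (κ.layerSubgroup (n + R)) (v.adicCompletion ℚ))) := by
    rw [hrank, Fintype.card_prod, Fintype.card_fin, Fintype.card_fin, pow_add]
  -- (`CharZero ℚ_v` only now: it changes the preferred `Algebra ℚ ℚ_v` instance, see tower-1's BRICK 14)
  haveI : CharZero (v.adicCompletion ℚ) :=
    charZero_of_injective_algebraMap (algebraMap ℚ (v.adicCompletion ℚ)).injective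
  have hfix := fixingSubgroup_fixedField_of_isOpen _ hopen
  have hH := fun σ ↦ SetLike.ext_iff.mp hfix σ
  have hnorm := algebraMap_norm_eq_prod_smul v _ hH (fun ji : Fin (2 ^ n) × Fin (2 ^ R) ↦ g₀ ^ (ji.1 : ℕ) * g ^ (ji.2 : ℕ))
    hcov hcard f'
  -- `∏_{i,j} g₀^i g^j f = ∏_i g₀^i (q^N) = q^{N 2^n}`
  have hinner : ∀ i : Fin (2 ^ n), (∏ i' : Fin (2 ^ R), (g₀ ^ (i : ℕ) * g ^ (i' : ℕ)) •
      (f' : AlgebraicClosure (v.adicCompletion ℚ))) =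
        algebraMap (v.adicCompletion ℚ) (AlgebraicClosure (v.adicCompletion ℚ)) (q ^ (2 ^ j * a)) := by
    intro i
    have h1 : (∏ i' : Fin (2 ^ R), (g₀ ^ (i : ℕ) * g ^ (i' : ℕ)) • (f' : AlgebraicClosure (v.adicCompletion ℚ))) =
        g₀ ^ (i : ℕ) • ∏ i' ∈ Finset.range (2 ^ R), (g ^ i') • f := by
      rw [← Fin.prod_univ_eq_prod_range (fun i' ↦ (g ^ i') • f) (2 ^ R), Finset.smul_prod']
      refine Finset.prod_congr rfl fun i' _ ↦ ?_
      rw [mul_smul]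
    rw [h1, hprod]
    exact AlgEquiv.commutes (absoluteGaloisGroup.toAlgEquiv _ (g₀ ^ (i : ℕ))) _
  rw [Fintype.prod_prod_type, Finset.prod_congr rfl (fun i _ ↦ hinner i), Finset.prod_const, Finset.card_univ,
    Fintype.card_fin, ← map_pow, ← pow_mul] at hnorm
  have hNe : Algebra.norm (v.adicCompletion ℚ) f' = q ^ (2 ^ j * a * 2 ^ n) :=
    (algebraMap (v.adicCompletion ℚ) (AlgebraicClosure (v.adicCompletion ℚ))).injective hnorm
  have hexp : 2 ^ j * a * 2 ^ n = 2 ^ (n + j) * a := by rw [pow_add]; ring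
  rw [hexp] at hNe
  exact hne hNe

end Literature.NumberTheory.EllipticCurves.Greenberg1999.MultTowerSplitOrder

end Part3

/-!
## Part 4 — port of `Summits/BirchSwinnertonDyer/BirchSwinnertonDyer/Theorems/ByReductionTypeAtTwoMultTowerSplitOrderCount.lean`

# Route `ByReductionTypeAtTwo`, crux `MultUpperHalfAtTwo` (item stmt-BirchSwinnertonDyer-19922), TOWER road, the
# SPLIT rows: KERNEL BRICK S4b — THE COUNT: the `2`-power torsion of the coinvariants `M_∞/(g−1)M_∞` of the split Tate
# module over the local cyclotomic `ℤ₂`-tower has at most `2^w` elements, `w = ord₂ log₂ q_E − 2`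

HONEST FRAMING (cell `bsd-2adic`, run/shared/lean/pub/bsd-2adic/, seat `bsd-2adic-mult` GEN 13, HUMAN RULINGS
D-0036 / D-0054 / D-0074): theorems only (no definition, no named fact, no `sorry`); closes nothing by itself; nothing
booked; BSD is not proved by any of this. The combinatorial heart of the KERNEL proof of the split ORDER bound
`#𝒦_{v,n}[2^∞] ≤ 2^k` (`…SplitOrderBound.lean`), i.e. of the projection of the PRINT named fact
`Greenberg1999.sec3_natCard_localTowerKerPrimary_splitMultiplicative_rat` (Greenberg, LNM 1716, §3 pp. 92–93) consumed by
`MultTowerCert.atTwo_le_pow_of_split`.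

THE PROOF (Greenberg pp. 92–93 made elementary; cell memo HOME/mult/NOTE-SP1ONE.md §5). `M_∞ = E(K̄_v)^{H_∞} = Φ(L)`,
`L = {x : hx = x ∀ h ∈ H_∞}` (untwisted Tate uniformisation, BRICK S3), `g` a topological generator of `H_n` mod `H_∞`,
`N_R(x) = ∏_{i<2^R} g^i x`. A `2`-power-torsion class `[Φ x]` of `M_∞/(g−1)M_∞` has `x^{2^a} = Q^b · gz/z`; at a level
`R` where `x, z ∈ F_{n+R}` one gets `N_R(x) = Q^{B}` after raising the level by `a` (`N_{R+i} = N_R^{2^i}`, BRICK S2).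
The exponents `B` of all `f ∈ F_{n+R}ˣ` with `N_R(f) ∈ Q^ℤ` form a subgroup `S ≤ ℤ` containing `2^R` and — by the depth
non-norm lemma (BRICK S2 `prod_smul_ne_pow_of_depth`) — missing `2^j · odd` for `R = j + w + 1`; so `S` meets at most
`2^w` classes mod `2^R` (BRICK S4a `exists_ne_modEq_of_mem_addSubgroup`). Two classes with `B ≡ B' (mod 2^R)` coincide:
`u = (x/x')·Q^{−(B−B')/2^R}` has `N_R(u) = 1`, so `u = gy/y` (tower-1's cyclic Hilbert 90
`exists_eq_smul_div_of_prod_smul_eq_one`), i.e. `Φx − Φx' = (g−1)Φy`. Hence among `2^w + 1` torsion classes two are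
equal. NO class field axiom is used (an UPPER bound).

* `finite_primaryComponent_coinvariants_and_card_le` — `#(M_∞/(g−1)M_∞)[2^∞] ≤ 2^w`.

References: R. Greenberg, LNM 1716 (1999), §3 pp. 85–93; J. Silverman, GTM 151, V.3–V.5; J. Neukirch, *ANT* IV (3.5);
cell memos NOTE-SP1ONE.md §5, SCOPE-hNS2one-kernel-GEN8.md.
-/

section Part4

set_option autoImplicit false

open scoped _root_.Classical

namespace Literature.NumberTheory.EllipticCurves.Greenberg1999.MultTowerSplitOrder

open _root_.NumberField _root_.IsDedekindDomain _root_.Field _root_.WeierstrassCurve _root_.PadicInt _root_.Rat.HeightOneSpectrum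
  Literature.NumberTheory.EllipticCurves Literature.NumberTheory.EllipticCurves.ResKernel
  Literature.NumberTheory.GaloisRepresentations
  Literature.NumberTheory.EllipticCurves.Greenberg1999.MultTowerNS2

/-! ### The count: `#(M_∞/(g−1)M_∞)[2^∞] ≤ 2^w` -/

variable {κ : ZpExtension ℚ 2}

/-- **The `2`-power torsion of the coinvariants of the split Tate module has at most `2^w` elements.** Setting: `κ`
the cyclotomic `ℤ₂`-extension, `v ∋ 2`, `Φ : K̄_vˣ ↠ E(K̄_v)` with kernel `q^ℤ` and `σ • Φ(u) = Φ(σu)` (BRICK S3),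
`e : ℚ_v ≃ ℚ₂` a ring isomorphism with `e q = 2^k u`, `‖u² − 1‖ = 2^{−(w+3)}` (depth `w`), `g ∈ H_n` generating `H_n`
topologically with `H_∞`, `M_∞ = E(K̄_v)^{H_∞}`. Then `(M_∞/(g−1)M_∞)[2^∞]` is finite of order `≤ 2^w`: among any
`2^w + 1` classes two coincide (representatives at a common level `R = j + w + 1`, exponents `B` of `N_R(x) = Q^B` in the
subgroup `S ≤ ℤ` of BRICK-S2-admissible exponents, pigeonhole `exists_ne_modEq_of_mem_addSubgroup`, cyclic Hilbert 90).
[cite: GreenbergLNM1716, §3 (pp. 85–93)] [cite: SilvermanATAEC1994, Thm. V.3.1 (c)(d), Thm. V.5.3]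
[cite: NeukirchANT1999, Ch. IV (3.5) and Ch. V §1 Thm. (1.1)] -/
theorem finite_primaryComponent_coinvariants_and_card_le (hκ : κ.IsCyclotomic) (v : HeightOneSpectrum (𝓞 ℚ))
    (hv : ((2 : ℕ) : 𝓞 ℚ) ∈ v.asIdeal) {W : WeierstrassCurve ℚ}
    {Φ : Additive (AlgebraicClosure (v.adicCompletion ℚ))ˣ →+ localPoints W (v.adicCompletion ℚ)}
    {q : v.adicCompletion ℚ} (hsurj : Function.Surjective Φ)
    (hker : ∀ u : (AlgebraicClosure (v.adicCompletion ℚ))ˣ, Φ (Additive.ofMul u) = 0 ↔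
      ∃ n : ℤ, (u : AlgebraicClosure (v.adicCompletion ℚ)) =
        algebraMap (v.adicCompletion ℚ) (AlgebraicClosure (v.adicCompletion ℚ)) q ^ n)
    (hequiv : ∀ (σ : absoluteGaloisGroup (v.adicCompletion ℚ)) (u u' : (AlgebraicClosure (v.adicCompletion ℚ))ˣ),
      (u' : AlgebraicClosure (v.adicCompletion ℚ)) = σ • (u : AlgebraicClosure (v.adicCompletion ℚ)) →
        σ • Φ (Additive.ofMul u) = Φ (Additive.ofMul u'))
    (hq0 : q ≠ 0) (hq1 : ‖q‖ < 1)
    (e : v.adicCompletion ℚ ≃+* ℚ_[2]) {k : ℕ} {u : ℤ_[2]ˣ} (hq : e q = (2 : ℚ_[2]) ^ k * ((u : ℤ_[2]) : ℚ_[2]))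
    {w : ℕ} (hu : ‖(u : ℤ_[2]) ^ 2 - 1‖ = (2 : ℝ) ^ (-((w : ℤ) + 3)))
    (n : ℕ) {g : absoluteGaloisGroup (v.adicCompletion ℚ)}
    (hgn : g ∈ localSubgroup (κ.layerSubgroup n) (v.adicCompletion ℚ))
    (hgen : ∀ U : Subgroup (absoluteGaloisGroup (v.adicCompletion ℚ)),
      IsOpen (U : Set (absoluteGaloisGroup (v.adicCompletion ℚ))) →
        localSubgroup κ.kerSubgroup (v.adicCompletion ℚ) ≤ U → g ∈ U →
          localSubgroup (κ.layerSubgroup n) (v.adicCompletion ℚ) ≤ U) :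
    Finite (AddCommGroup.primaryComponent
      (FixedPoints.addSubgroup (localSubgroup κ.kerSubgroup (v.adicCompletion ℚ)) (localPoints W (v.adicCompletion ℚ)) ⧸
        (subOne (localSubgroup κ.kerSubgroup (v.adicCompletion ℚ)) (localPoints W (v.adicCompletion ℚ)) g).range) 2) ∧
    Nat.card (AddCommGroup.primaryComponent
      (FixedPoints.addSubgroup (localSubgroup κ.kerSubgroup (v.adicCompletion ℚ)) (localPoints W (v.adicCompletion ℚ)) ⧸
        (subOne (localSubgroup κ.kerSubgroup (v.adicCompletion ℚ)) (localPoints W (v.adicCompletion ℚ)) g).range) 2) ≤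
      2 ^ w := by
  -- notation and the layer subgroups
  set K := AlgebraicClosure (v.adicCompletion ℚ) with hK
  set Hi := localSubgroup κ.kerSubgroup (v.adicCompletion ℚ) with hHi
  have hile : ∀ m : ℕ, Hi ≤ localSubgroup (κ.layerSubgroup m) (v.adicCompletion ℚ) := fun m τ hτ ↦ by
    rw [mem_localSubgroup_iff]
    rw [hHi, mem_localSubgroup_iff] at hτ
    exact κ.kerSubgroup_le_layerSubgroup m hτ
  have hanti : ∀ {m m' : ℕ}, m ≤ m' → localSubgroup (κ.layerSubgroup m') (v.adicCompletion ℚ) ≤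
      localSubgroup (κ.layerSubgroup m) (v.adicCompletion ℚ) := fun h ↦ Subgroup.comap_mono (κ.layerSubgroup_antitone h)
  -- the Tate parameter in `K̄_v`
  set Q : K := algebraMap (v.adicCompletion ℚ) K q with hQ
  have hQ0 : Q ≠ 0 := by rw [hQ]; exact (map_ne_zero _).mpr hq0
  have hQfix : ∀ σ : absoluteGaloisGroup (v.adicCompletion ℚ), σ • Q = Q := fun σ ↦
    AlgEquiv.commutes (absoluteGaloisGroup.toAlgEquiv _ σ) q
  have hQtor : ∀ j : ℤ, Q ^ j = 1 → j = 0 := by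
    intro j hj
    have hj' : q ^ j = 1 := by
      apply (algebraMap (v.adicCompletion ℚ) K).injective
      rw [map_zpow₀, map_one]; exact hj
    have hpow : ∀ m : ℕ, q ^ m = 1 → m = 0 := fun m hm ↦ by
      by_contra hm0
      have h1 : ‖q‖ ^ m < 1 := pow_lt_one₀ (norm_nonneg q) hq1 hm0
      rw [← norm_pow, hm, norm_one] at h1
      exact lt_irrefl _ h1
    cases j with
    | ofNat m =>
      rw [Int.ofNat_eq_natCast, zpow_natCast] at hj'
      rw [Int.ofNat_eq_natCast, hpow m hj']
      rfl
    | negSucc m =>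
      rw [zpow_negSucc, inv_eq_one] at hj'
      exact absurd (hpow (m + 1) hj') (Nat.succ_ne_zero m)
  -- `κ(res g) = 2^n · unit` (tower-1's BRICK 15) and its consequences
  obtain ⟨ug, hug⟩ := exists_units_kappa_resGal_eq_of_generate hκ v hv n hgn hgen
  have hgpow : ∀ R : ℕ, g ^ 2 ^ R ∈ localSubgroup (κ.layerSubgroup (n + R)) (v.adicCompletion ℚ) := fun R ↦
    (pow_mem_localSubgroup_layerSubgroup_iff (κ := κ) v n R hug (2 ^ R)).mpr dvd_rfl
  have hgiQ : ∀ i : ℕ, (g ^ i) • Q = Q := fun i ↦ hQfix _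
  -- orbit products
  have hNQ : ∀ (R : ℕ) (c : ℤ), (∏ i ∈ Finset.range (2 ^ R), (g ^ i) • (Q ^ c)) = Q ^ (c * 2 ^ R) := by
    intro R c
    rw [prod_smul_eq_pow_of_smul_eq g (2 ^ R) (by rw [smul_zpow₀', hQfix]), ← zpow_natCast, ← zpow_mul,
      Nat.cast_pow, Nat.cast_ofNat]
  -- the coinvariants
  set P := localPoints W (v.adicCompletion ℚ) with hP
  set M : AddSubgroup P := FixedPoints.addSubgroup Hi P with hM
  have memM : ∀ {a : P}, a ∈ M ↔ ∀ h ∈ Hi, h • a = a := fun {a} ↦ by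
    rw [hM, FixedPoints.mem_addSubgroup]
    exact ⟨fun H h hh ↦ H ⟨h, hh⟩, fun H h ↦ H h h.2⟩
  set d : M →+ M := subOne Hi P g with hd
  set T := AddCommGroup.primaryComponent (M ⧸ d.range) 2 with hT
  -- (A) representatives: every class in `T` is `[Φ x]` with `x ∈ F_{n+R₀}`, `N_{R₀}(x) = Q^B`
  have hrep : ∀ y : T, ∃ (x : Kˣ) (m : M) (R₀ : ℕ) (B : ℤ),
      ((m : M ⧸ d.range) = (y : M ⧸ d.range)) ∧ (m : P) = Φ (Additive.ofMul x) ∧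
      (∀ h ∈ localSubgroup (κ.layerSubgroup (n + R₀)) (v.adicCompletion ℚ), h • (x : K) = x) ∧
      (∏ i ∈ Finset.range (2 ^ R₀), (g ^ i) • (x : K)) = Q ^ B := by
    rintro ⟨y, hy⟩
    obtain ⟨a, ha⟩ := (AddCommGroup.mem_primaryComponent).mp hy
    obtain ⟨m, rfl⟩ := QuotientAddGroup.mk_surjective y
    obtain ⟨x, hxm, hxL⟩ := exists_unit_of_mem_fixedPoints_split (κ := κ) v hsurj hker hequiv hQfix hQ0 hQtor
      (memM.mp m.2)
    -- `2^a m ∈ (g-1) M_∞`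
    have h2m : ((2 ^ a) • m : M) ∈ d.range := by
      rw [← QuotientAddGroup.eq_zero_iff]
      exact ha
    obtain ⟨wM, hw⟩ := h2m
    obtain ⟨z, hzm, hzL⟩ := exists_unit_of_mem_fixedPoints_split (κ := κ) v hsurj hker hequiv hQfix hQ0 hQtor
      (memM.mp wM.2)
    -- `Φ (x^{2^a}) = Φ (gz / z)`, so `x^{2^a} = Q^b · gz/z`
    set gz : Kˣ := Units.mk0 (g • (z : K)) ((smul_ne_zero_iff_ne g).mpr z.ne_zero) with hgz
    have hgΦ : g • Φ (Additive.ofMul z) = Φ (Additive.ofMul gz) := hequiv g z gz rfl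
    have h3 : Φ (Additive.ofMul (x ^ 2 ^ a)) = Φ (Additive.ofMul (gz * z⁻¹)) := by
      rw [ofMul_pow, map_nsmul, hxm, ofMul_mul, ofMul_inv, map_add, map_neg, ← hgΦ, hzm, ← sub_eq_add_neg]
      have h4 := congrArg (fun b : M ↦ (b : P)) hw
      simp only [hd, AddSubgroupClass.coe_nsmul] at h4
      exact h4.symm
    rw [tatePsi_eq_iff v hker] at h3
    obtain ⟨b, hb⟩ := h3
    rw [Units.val_pow_eq_pow_val, Units.val_mul, Units.val_inv_eq_inv_val, hgz, Units.val_mk0] at hb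
    -- finite levels for `x` and `z`
    have hcl : IsClosed ((⊤ : Subgroup (absoluteGaloisGroup (v.adicCompletion ℚ))) :
        Set (absoluteGaloisGroup (v.adicCompletion ℚ))) := by
      rw [Subgroup.coe_top]; exact isClosed_univ
    obtain ⟨m₁, hm₁⟩ := exists_forall_mem_localSubgroup_layerSubgroup_smul_eq (κ := κ) v ⊤ hcl (x : K)
      (fun h hh _ ↦ hxL h hh)
    obtain ⟨m₂, hm₂⟩ := exists_forall_mem_localSubgroup_layerSubgroup_smul_eq (κ := κ) v ⊤ hcl (z : K)
      (fun h hh _ ↦ hzL h hh)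
    set R₁ : ℕ := m₁ + m₂ with hR₁
    have hxR₁ : ∀ h ∈ localSubgroup (κ.layerSubgroup (n + R₁)) (v.adicCompletion ℚ), h • (x : K) = x :=
      fun h hh ↦ hm₁ h (hanti (by omega) hh) (Subgroup.mem_top h)
    have hzR₁ : ∀ h ∈ localSubgroup (κ.layerSubgroup (n + R₁)) (v.adicCompletion ℚ), h • (z : K) = z :=
      fun h hh ↦ hm₂ h (hanti (by omega) hh) (Subgroup.mem_top h)
    have hgx : (g ^ 2 ^ R₁) • (x : K) = x := hxR₁ _ (hgpow R₁)
    have hgzR : (g ^ 2 ^ R₁) • (z : K) = z := hzR₁ _ (hgpow R₁)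
    -- `N_{R₁}(x)^{2^a} = Q^{b 2^{R₁}}`
    have hNz : (∏ i ∈ Finset.range (2 ^ R₁), (g ^ i) • (z : K)) ≠ 0 :=
      Finset.prod_ne_zero_iff.mpr fun i _ ↦ (smul_ne_zero_iff_ne _).mpr z.ne_zero
    have hN1 : (∏ i ∈ Finset.range (2 ^ R₁), (g ^ i) • (x : K)) ^ 2 ^ a = Q ^ (b * 2 ^ R₁) := by
      calc (∏ i ∈ Finset.range (2 ^ R₁), (g ^ i) • (x : K)) ^ 2 ^ a
          = ∏ i ∈ Finset.range (2 ^ R₁), (g ^ i) • ((x : K) ^ 2 ^ a) := by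
            rw [← Finset.prod_pow]
            exact Finset.prod_congr rfl fun i _ ↦ (smul_pow' _ _ _).symm
        _ = ∏ i ∈ Finset.range (2 ^ R₁), (g ^ i) • (Q ^ b * (g • (z : K) * (z : K)⁻¹)) := by rw [hb]
        _ = (∏ i ∈ Finset.range (2 ^ R₁), (g ^ i) • (Q ^ b)) *
              ((∏ i ∈ Finset.range (2 ^ R₁), (g ^ i) • (g • (z : K))) *
                ∏ i ∈ Finset.range (2 ^ R₁), (g ^ i) • (z : K)⁻¹) := by rw [prod_smul_mul, prod_smul_mul]
        _ = Q ^ (b * 2 ^ R₁) := by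
            rw [hNQ, prod_smul_smul_eq g (2 ^ R₁) hgzR, prod_smul_inv, mul_inv_cancel₀ hNz, mul_one]
    -- one more raise by `a` levels: `N_{R₁+a}(x) = N_{R₁}(x)^{2^a}`
    refine ⟨x, m, R₁ + a, b * 2 ^ R₁, rfl, hxm.symm, fun h hh ↦ hxR₁ h (hanti (by omega) hh), ?_⟩
    rw [prod_smul_two_pow_add g R₁ hgx a, hN1]
  -- (B) coincidence: equal exponents mod `2^R` at a common level give equal classes
  have hcoinc : ∀ (R : ℕ) (x₁ x₂ : Kˣ) (B₁ B₂ : ℤ),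
      (∀ h ∈ localSubgroup (κ.layerSubgroup (n + R)) (v.adicCompletion ℚ), h • (x₁ : K) = x₁) →
      (∀ h ∈ localSubgroup (κ.layerSubgroup (n + R)) (v.adicCompletion ℚ), h • (x₂ : K) = x₂) →
      (∏ i ∈ Finset.range (2 ^ R), (g ^ i) • (x₁ : K)) = Q ^ B₁ →
      (∏ i ∈ Finset.range (2 ^ R), (g ^ i) • (x₂ : K)) = Q ^ B₂ →
      B₁ ≡ B₂ [ZMOD (2 : ℤ) ^ R] →
      ∃ mw : M, (d mw : P) = Φ (Additive.ofMul x₁) - Φ (Additive.ofMul x₂) := by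
    intro R x₁ x₂ B₁ B₂ hx₁ hx₂ hN₁ hN₂ hmod
    obtain ⟨c, hc⟩ := (Int.modEq_iff_dvd.mp hmod.symm)
    -- `uel = (x₁/x₂) · Q^{-c}` has orbit product `1`
    set uel : K := (x₁ : K) * (x₂ : K)⁻¹ * Q ^ (-c) with huel
    have hufix : ∀ h ∈ localSubgroup (κ.layerSubgroup (n + R)) (v.adicCompletion ℚ), h • (1 : K) = 1 → h • uel = uel :=
      fun h hh _ ↦ by rw [huel, smul_mul', smul_mul', smul_inv'', hx₁ h hh, hx₂ h hh, smul_zpow₀', hQfix]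
    have hN : (∏ i ∈ Finset.range (2 ^ R), (g ^ i) • uel) = 1 := by
      have h3 : ∀ i : ℕ, (g ^ i) • uel = (g ^ i) • (x₁ : K) * (g ^ i) • (x₂ : K)⁻¹ * (g ^ i) • (Q ^ (-c)) := fun i ↦ by
        rw [huel, smul_mul', smul_mul']
      rw [Finset.prod_congr rfl (fun i _ ↦ h3 i), Finset.prod_mul_distrib, Finset.prod_mul_distrib, hN₁, prod_smul_inv,
        hN₂, hNQ, ← zpow_neg, ← zpow_add₀ hQ0, ← zpow_add₀ hQ0]
      have hexp : B₁ + -B₂ + -c * 2 ^ R = 0 := by linear_combination hc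
      rw [hexp, zpow_zero]
    have ht1 : ∀ σ : absoluteGaloisGroup (v.adicCompletion ℚ), σ • (1 : K) = 1 ∨ σ • (1 : K) = -1 :=
      fun σ ↦ Or.inl (smul_one σ)
    obtain ⟨y, hy0, hyfix, hyu⟩ :=
      exists_eq_smul_div_of_prod_smul_eq_one (κ := κ) v n R hug ht1 (smul_one g) hufix hN
    -- `Φ y ∈ M_∞` and `Φ x₁ − Φ x₂ = (g − 1) Φ y`
    set yU : Kˣ := Units.mk0 y hy0 with hyU
    have hyM : Φ (Additive.ofMul yU) ∈ M :=
      memM.mpr (apply_mem_fixedPoints_split v hequiv Hi (x := yU)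
        (fun h hh ↦ by rw [hyU, Units.val_mk0]; exact hyfix h (hile _ hh) (smul_one h)))
    set gy : Kˣ := Units.mk0 (g • y) ((smul_ne_zero_iff_ne g).mpr hy0) with hgy
    have hgΦ : g • Φ (Additive.ofMul yU) = Φ (Additive.ofMul gy) :=
      hequiv g yU gy (by rw [hgy, hyU, Units.val_mk0, Units.val_mk0])
    refine ⟨⟨Φ (Additive.ofMul yU), hyM⟩, ?_⟩
    have hdP : (d ⟨Φ (Additive.ofMul yU), hyM⟩ : P) = g • Φ (Additive.ofMul yU) - Φ (Additive.ofMul yU) := rfl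
    rw [hdP, hgΦ]
    have e1 : Φ (Additive.ofMul x₁) - Φ (Additive.ofMul x₂) = Φ (Additive.ofMul (x₁ * x₂⁻¹)) := by
      rw [ofMul_mul, ofMul_inv, map_add, map_neg, sub_eq_add_neg]
    have e2 : Φ (Additive.ofMul gy) - Φ (Additive.ofMul yU) = Φ (Additive.ofMul (gy * yU⁻¹)) := by
      rw [ofMul_mul, ofMul_inv, map_add, map_neg, sub_eq_add_neg]
    rw [e1, e2, tatePsi_eq_iff v hker]
    refine ⟨-c, ?_⟩
    rw [Units.val_mul, Units.val_inv_eq_inv_val, Units.val_mul, Units.val_inv_eq_inv_val, hgy, hyU, Units.val_mk0,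
      Units.val_mk0]
    -- goal: `g • y * y⁻¹ = Q ^ (-c) * (x₁ * x₂⁻¹)`
    have hx12 : (x₁ : K) * (x₂ : K)⁻¹ = g • y / y * Q ^ c := by
      rw [← hyu, huel, mul_assoc, ← zpow_add₀ hQ0, neg_add_cancel, zpow_zero, mul_one]
    rw [hx12, div_eq_mul_inv, mul_comm (g • y * y⁻¹) (Q ^ c), ← mul_assoc, ← zpow_add₀ hQ0, neg_add_cancel,
      zpow_zero, one_mul]
  -- (C) among `2^w + 1` classes two coincide
  have key : ∀ ys : Fin (2 ^ w + 1) → T, ∃ i i' : Fin (2 ^ w + 1), i ≠ i' ∧ ys i = ys i' := by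
    intro ys
    choose x m R₀ B hmy hmx hxR hNx using fun i ↦ hrep (ys i)
    -- a common level `R = j + w + 1`, `j = ∑ R₀`
    set j : ℕ := ∑ i, R₀ i with hj
    set R : ℕ := j + w + 1 with hR
    have hRi : ∀ i, R₀ i ≤ R := fun i ↦ by
      have : R₀ i ≤ j := by rw [hj]; exact Finset.single_le_sum (fun i _ ↦ Nat.zero_le _) (Finset.mem_univ i)
      omega
    have hxRR : ∀ i, ∀ h ∈ localSubgroup (κ.layerSubgroup (n + R)) (v.adicCompletion ℚ), h • (x i : K) = x i :=
      fun i h hh ↦ hxR i h (hanti (by linarith [hRi i]) hh)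
    -- exponents at level `R`
    have hNR : ∀ i, ∃ B' : ℤ, (∏ i' ∈ Finset.range (2 ^ R), (g ^ i') • (x i : K)) = Q ^ B' := by
      intro i
      obtain ⟨t, ht⟩ := Nat.exists_eq_add_of_le (hRi i)
      refine ⟨B i * 2 ^ t, ?_⟩
      rw [ht, prod_smul_two_pow_add g (R₀ i) (hxR i _ (hgpow (R₀ i))) t, hNx, ← zpow_natCast, ← zpow_mul,
        Nat.cast_pow, Nat.cast_ofNat]
    choose B' hB' using hNR
    -- the subgroup of admissible exponents
    let S : AddSubgroup ℤ :=
      { carrier := {c : ℤ | ∃ f : K, f ≠ 0 ∧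
          (∀ h ∈ localSubgroup (κ.layerSubgroup (n + R)) (v.adicCompletion ℚ), h • f = f) ∧
          (∏ i ∈ Finset.range (2 ^ R), (g ^ i) • f) = Q ^ c}
        add_mem' := by
          rintro c₁ c₂ ⟨f₁, hf₁, hf₁R, hN₁⟩ ⟨f₂, hf₂, hf₂R, hN₂⟩
          refine ⟨f₁ * f₂, mul_ne_zero hf₁ hf₂, fun h hh ↦ by rw [smul_mul', hf₁R h hh, hf₂R h hh], ?_⟩
          rw [prod_smul_mul, hN₁, hN₂, zpow_add₀ hQ0]
        zero_mem' := ⟨1, one_ne_zero, fun h _ ↦ smul_one h, by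
          rw [prod_smul_eq_pow_of_smul_eq g (2 ^ R) (smul_one g), one_pow, zpow_zero]⟩
        neg_mem' := by
          rintro c ⟨f, hf, hfR, hN⟩
          refine ⟨f⁻¹, inv_ne_zero hf, fun h hh ↦ by rw [smul_inv'', hfR h hh], ?_⟩
          rw [prod_smul_inv, hN, zpow_neg] }
    have hmemS : ((2 : ℤ) ^ R) ∈ S := ⟨Q, hQ0, fun h _ ↦ hQfix h, by
      rw [prod_smul_eq_pow_of_smul_eq g (2 ^ R) (hQfix g), ← zpow_natCast, Nat.cast_pow, Nat.cast_ofNat]⟩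
    have hnotS : ∀ a : ℕ, Odd a → ((2 : ℤ) ^ j * a) ∉ S := by
      rintro a ha ⟨f, hf, hfR, hN⟩
      have hne := prod_smul_ne_pow_of_depth hκ v hv 2 rfl e (q := q) (k := k) (u := u) (by simpa using hq)
        hu n hug ha hR hfR
      apply hne
      rw [hN, map_pow, ← zpow_natCast, Nat.cast_mul, Nat.cast_pow, Nat.cast_ofNat]
    have hBS : ∀ i, B' i ∈ S := fun i ↦ ⟨(x i : K), (x i).ne_zero, hxRR i, hB' i⟩
    obtain ⟨i, i', hii', hmodB⟩ :=
      exists_ne_modEq_of_mem_addSubgroup S hR hmemS hnotS (Nat.lt_succ_self _) B' hBS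
    refine ⟨i, i', hii', ?_⟩
    obtain ⟨mw, hmw⟩ := hcoinc R (x i) (x i') (B' i) (B' i') (hxRR i) (hxRR i') (hB' i) (hB' i') hmodB
    have hmm : (m i : M ⧸ d.range) = m i' := by
      rw [QuotientAddGroup.eq_iff_sub_mem]
      refine ⟨mw, Subtype.ext ?_⟩
      rw [AddSubgroupClass.coe_sub, hmx, hmx]
      exact hmw
    exact Subtype.ext (by rw [← hmy i, ← hmy i', hmm])
  -- hence `T` is finite of order `≤ 2^w`
  haveI hfin : Finite T := by
    by_contra hinf
    rw [not_finite_iff_infinite] at hinf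
    let emb := Infinite.natEmbedding T
    obtain ⟨i, i', hii', h⟩ := key (fun i : Fin (2 ^ w + 1) ↦ emb i)
    exact hii' (Fin.ext (emb.injective h))
  refine ⟨hfin, ?_⟩
  by_contra hlt
  push Not at hlt
  letI := Fintype.ofFinite T
  rw [Nat.card_eq_fintype_card] at hlt
  let emb : Fin (2 ^ w + 1) ↪ T := (Fin.castLEEmb hlt).trans (Fintype.equivFin _).symm.toEmbedding
  obtain ⟨i, i', hii', h⟩ := key emb
  exact hii' (emb.injective h)

end Literature.NumberTheory.EllipticCurves.Greenberg1999.MultTowerSplitOrder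

end Part4

/-!
## Part 5 — port of `Summits/BirchSwinnertonDyer/BirchSwinnertonDyer/Theorems/ByReductionTypeAtTwoGoodOrdTowerControlCocycleFixed.lean`

# Route `ByReductionTypeAtTwo`, item `OrdKatoHalfAtTwo` (stmt-BirchSwinnertonDyer-19271), TOWER road, the
# GOOD-ORDINARY local tower kernels at `v ∣ 2` at FULL `2`-power depth: BRICK B, part 1′ — the inflated cocycle of a
# `p^k`-torsion coinvariant class, finite level asked only of the `H_∞`-FIXED torsion

HONEST FRAMING (cell `bsd-2adic`, run/shared/lean/pub/bsd-2adic/, seat `bsd-2adic-tower-1` GEN 20, HUMAN RULINGS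
D-0036 / D-0054 / D-0074): TOOL theorems only (no definition, no named fact, no `sorry`); closes nothing by itself;
nothing booked; BSD is not proved by any of this. Brick B of the programme «UNIFORM layer bound
`∃ C, ∀ n, #𝒦_{v,n}[2^∞] ≤ C` at a good ordinary `2` over `ℚ`» ⇒ `WeierstrassCurve.Greenberg1999_kerG_bounded` at `p = 2`
⇒ Mazur's control theorem `WeierstrassCurve.selmer_control` over `ℚ` at `p = 2` (Greenberg, LNM 1716, Thm. 1.2). It is
the depth-`p^k` form of GEN 11's BRICKS G2/G3 (`…GoodOrdTowerCoinvCocycle.lean`, `…GoodOrdTowerCoinvKummer.lean`), whose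
depth-`p` form used that `Ê[p]` is fixed by `Γ` (automatic at `p = 2`); at depth `p^k`, `k ≥ 2`, the torsion `Ê[p^k]` is
NOT Galois-trivial, so the crossed homomorphisms become genuine continuous `1`-cocycles of the discrete `H_n`-module
`Z ≅ Ê[p^k]` and the count is against `#H¹(H_n, Z)` (Mathlib's continuous cohomology of `discreteTopRep H_n Z`).
Setting (as in G2/G3): `p` any prime, `κ` cyclotomic, `v ∋ p`, `K = ℚ_v`, `Γ = Gal(K̄/K)`, `H_n`, `H_∞`, `E(K̄_v) = localPoints W K`,
`g ∈ H_n` a topological generator modulo `H_∞`, `A₁ ≤ E(K̄_v)` a `Γ`-stable subgroup (`E₁(K̄_v) = Ê(𝔪̄)`).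

* `exists_contOneCocycles_inflate_pow` — G2 at depth `p^k`: for `x ∈ A₁`, `y` fixed by `H_∞` with `p^k x = g y − y`, if the
  `p^k`-torsion of `A₁` is fixed pointwise by some layer group `H_{m₀}` (finite level — `Ê[p^k]` is finite), there is a
  continuous `1`-cocycle `c` of `H_n` with values in `A₁`, vanishing on `H_∞`, `c(g) = x`, `p^k c(σ) = σ y − y`.
* `natCard_torsionBy_coinv_mul_card_quotient_le_card_H1` — G3 at depth `p^k`: with `M₁ = A₁ ∩ E(K̄_v)^{H_∞}`, `D₁ = g − 1`,
  `Aₙ = A₁ ∩ E(K̄_v)^{H_n}`, `A₁` `p^k`-divisible, and `Z` a discrete `Γ`-module mapped by an injective EQUIVARIANT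
  `ιZ : Z → E(K̄_v)` onto `A₁[p^k]`: if `H¹(H_n, Z)` is finite then `#(M₁/D₁M₁)[p^k] · #(Aₙ/p^k Aₙ) ≤ #H¹(H_n, Z)` (with
  finiteness). Proof as G3 but in `H¹`: the Kummer map `Aₙ → H¹(H_n, Z)`, `b ↦ [∂b̃]` (`p^k b̃ = b`; the class does not
  depend on the root), has kernel `p^k Aₙ`; `[x] ↦ [c − ∂ỹ] mod κ(Aₙ)` is injective (`χ − χ' = κ(b) + ∂t` forces
  `a = ỹ' − ỹ − b̃ − t ∈ M₁` on `H_∞` and `x − x' = (g − 1)(−a)` at `g`).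

References: R. Greenberg, LNM 1716 (1999), §3 Lemma 3.1 (p. 86), Lemma 3.4 (p. 89) with Prop. 2.5 (p. 80); J.-P. Serre,
*Local Fields*, XIII §1 Prop. 1; J. Silverman, *AEC* VIII §2 (Kummer pairing).
-/

section Part5

set_option autoImplicit false

open scoped _root_.Classical

universe u

namespace Literature.NumberTheory.EllipticCurves.Greenberg1999.GoodOrdTower

open _root_.NumberField _root_.IsDedekindDomain _root_.Field _root_.PadicInt Literature.NumberTheory.EllipticCurves
  Literature.NumberTheory.GaloisRepresentations _root_.WeierstrassCurve

variable {p : ℕ} [Fact p.Prime] {κ : ZpExtension ℚ p}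

/-! ### The inflated cocycle of a `p^k`-torsion coinvariant class -/

/-- **The inflated cocycle of a `p^k`-torsion coinvariant class** (BRICK G2 at depth `p^k`, finite level asked only of
the `H_∞`-fixed torsion). Let `A₁ ≤ E(K̄_v)` be a `Γ`-stable subgroup whose `H_∞`-FIXED `p^k`-torsion elements are fixed by
the layer group `H_{m₀}` (a finite level),
`g ∈ H_n` a topological generator of `H_n` modulo `H_∞`, and `x ∈ A₁`, `y ∈ E(K̄_v)` fixed by `H_∞` with `p^k x = g y − y`.
Then there is a continuous `1`-cocycle `c` of `H_n` with values in `E(K̄_v)` vanishing on `H_∞`, with `c(g) = x`,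
`c(σ) ∈ A₁` and `p^k c(σ) = σ y − y` for every `σ ∈ H_n`. Construction as in G2: `x`, `y` and `A₁[p^k]` are fixed by some
`H_{n+R₀}`; the geometric sums `S_i(x) = Σ_{j<i} g^j x` satisfy `S_{p^{R₀+k}}(x) = p^k S_{p^{R₀}}(x) = 0`
(`p^k S_{p^{R₀}}(x) = g^{p^{R₀}} y − y = 0`, so `S_{p^{R₀}}(x) ∈ A₁[p^k]` is fixed by `g^{p^{R₀}}`), hence
`σ = g^i h ↦ S_i(x)` (`h ∈ H_{n+R₀+k}`) is a cocycle of the cyclic quotient `H_n/H_{n+R₀+k}`, inflated to `H_n`.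
[cite: GreenbergLNM1716, §3 Lemma 3.1 (p. 86)] [cite: SerreLocalFields1979, XIII §1 Prop. 1] -/
theorem exists_contOneCocycles_inflate_pow_of_fixed (hκ : κ.IsCyclotomic) (v : HeightOneSpectrum (𝓞 ℚ))
    (hv : ((p : ℕ) : 𝓞 ℚ) ∈ v.asIdeal) (W : WeierstrassCurve ℚ) (n k m₀ : ℕ)
    {g : absoluteGaloisGroup (v.adicCompletion ℚ)}
    (hg : g ∈ localSubgroup (κ.layerSubgroup n) (v.adicCompletion ℚ))
    (hgen : ∀ U : Subgroup (absoluteGaloisGroup (v.adicCompletion ℚ)),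
      IsOpen (U : Set (absoluteGaloisGroup (v.adicCompletion ℚ))) →
        localSubgroup κ.kerSubgroup (v.adicCompletion ℚ) ≤ U → g ∈ U →
          localSubgroup (κ.layerSubgroup n) (v.adicCompletion ℚ) ≤ U)
    (A₁ : AddSubgroup (localPoints W (v.adicCompletion ℚ)))
    (hstab : ∀ (σ : absoluteGaloisGroup (v.adicCompletion ℚ)) (a : localPoints W (v.adicCompletion ℚ)),
      a ∈ A₁ → σ • a ∈ A₁)
    (hZ : ∀ a ∈ A₁, p ^ k • a = 0 →
      (∀ h ∈ localSubgroup κ.kerSubgroup (v.adicCompletion ℚ), h • a = a) →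
        ∀ h ∈ localSubgroup (κ.layerSubgroup m₀) (v.adicCompletion ℚ), h • a = a)
    {x y : localPoints W (v.adicCompletion ℚ)} (hx : x ∈ A₁)
    (hxi : ∀ h ∈ localSubgroup κ.kerSubgroup (v.adicCompletion ℚ), h • x = x)
    (hyi : ∀ h ∈ localSubgroup κ.kerSubgroup (v.adicCompletion ℚ), h • y = y)
    (hrel : p ^ k • x = g • y - y) :
    ∃ c : contOneCocycles (discreteTopRep (localSubgroup (κ.layerSubgroup n) (v.adicCompletion ℚ))
      (localPoints W (v.adicCompletion ℚ))),
      (∀ σ : localSubgroup (κ.layerSubgroup n) (v.adicCompletion ℚ),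
        (σ : absoluteGaloisGroup (v.adicCompletion ℚ)) ∈ localSubgroup κ.kerSubgroup (v.adicCompletion ℚ) →
          c.1 σ = 0) ∧
      c.1 ⟨g, hg⟩ = x ∧
      (∀ σ : localSubgroup (κ.layerSubgroup n) (v.adicCompletion ℚ), c.1 σ ∈ A₁) ∧
      (∀ σ : localSubgroup (κ.layerSubgroup n) (v.adicCompletion ℚ),
        p ^ k • c.1 σ = (σ : absoluteGaloisGroup (v.adicCompletion ℚ)) • y - y) := by
  -- notation (`let`, not `set`: no context rewriting)
  let K := v.adicCompletion ℚ
  let P : Type := localPoints W K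
  let Hn : Subgroup (absoluteGaloisGroup K) := localSubgroup (κ.layerSubgroup n) K
  let X : TopRep ℤ Hn := discreteTopRep Hn P
  let γ : Hn := ⟨g, hg⟩
  have hXρ : ∀ (σ : Hn) (m : P), X.ρ σ m = (σ : absoluteGaloisGroup K) • m := fun _ _ ↦ rfl
  have hXρpow : ∀ (j : ℕ) (m : P), X.ρ (γ ^ j) m = (g ^ j) • m := fun j m ↦ by
    rw [hXρ, SubgroupClass.coe_pow]
  -- `κ(res g) = p^n u`
  obtain ⟨u, hu⟩ := MultTowerSP1.exists_units_kappa_resGal_eq_of_generate hκ v hv n hg hgen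
  have hgi : ∀ (R i : ℕ), g ^ i ∈ localSubgroup (κ.layerSubgroup (n + R)) K ↔ p ^ R ∣ i := fun R i ↦
    MultTowerSP1.pow_mem_localSubgroup_layerSubgroup_iff (κ := κ) v n R hu i
  -- a common finite level `n + R₀` for `x`, `y` and the `p^k`-torsion of `A₁`
  obtain ⟨m₁, hm₁⟩ := exists_forall_mem_localSubgroup_layerSubgroup_smul_point_eq (κ := κ) v W x hxi
  obtain ⟨m₂, hm₂⟩ := exists_forall_mem_localSubgroup_layerSubgroup_smul_point_eq (κ := κ) v W y hyi
  obtain ⟨R₀, hxR₀, hyR₀, hZR₀⟩ : ∃ R₀ : ℕ, (∀ h ∈ localSubgroup (κ.layerSubgroup (n + R₀)) K, h • x = x) ∧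
      (∀ h ∈ localSubgroup (κ.layerSubgroup (n + R₀)) K, h • y = y) ∧
      (∀ a ∈ A₁, p ^ k • a = 0 → (∀ h ∈ localSubgroup κ.kerSubgroup K, h • a = a) →
        ∀ h ∈ localSubgroup (κ.layerSubgroup (n + R₀)) K, h • a = a) :=
    ⟨max (max m₁ m₂) m₀,
      fun h hh ↦ hm₁ h (MultTowerSP1.localSubgroup_layerSubgroup_antitone κ K
        (((le_max_left m₁ m₂).trans (le_max_left _ m₀)).trans (Nat.le_add_left _ n)) hh),
      fun h hh ↦ hm₂ h (MultTowerSP1.localSubgroup_layerSubgroup_antitone κ K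
        (((le_max_right m₁ m₂).trans (le_max_left _ m₀)).trans (Nat.le_add_left _ n)) hh),
      fun a ha hpa hai h hh ↦ hZ a ha hpa hai h (MultTowerSP1.localSubgroup_layerSubgroup_antitone κ K
        ((le_max_right _ m₀).trans (Nat.le_add_left _ n)) hh)⟩
  have hleR : localSubgroup (κ.layerSubgroup (n + (R₀ + k))) K ≤ localSubgroup (κ.layerSubgroup (n + R₀)) K :=
    MultTowerSP1.localSubgroup_layerSubgroup_antitone κ K (by omega)
  have hxR : ∀ h ∈ localSubgroup (κ.layerSubgroup (n + (R₀ + k))) K, h • x = x := fun h hh ↦ hxR₀ h (hleR hh)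
  have hyR : ∀ h ∈ localSubgroup (κ.layerSubgroup (n + (R₀ + k))) K, h • y = y := fun h hh ↦ hyR₀ h (hleR hh)
  -- the open normal subgroup `H = H_{n+R₀+k} ∩ H_n` of `H_n` and the cyclic quotient `H_n / H = ⟨ḡ⟩`
  have hnormal : (localSubgroup (κ.layerSubgroup (n + (R₀ + k))) K).Normal := by
    rw [localSubgroup_eq_comap]; exact Subgroup.Normal.comap inferInstance _
  let H : Subgroup Hn := (localSubgroup (κ.layerSubgroup (n + (R₀ + k))) K).subgroupOf Hn
  haveI hHnormal : H.Normal := Subgroup.normal_subgroupOf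
  have hmemH : ∀ σ : Hn, σ ∈ H ↔
      (σ : absoluteGaloisGroup K) ∈ localSubgroup (κ.layerSubgroup (n + (R₀ + k))) K :=
    fun σ ↦ Subgroup.mem_subgroupOf
  have hHopen : IsOpen (H : Set Hn) :=
    (MultTowerNS2.isOpen_localSubgroup _ (κ.isOpen_layerSubgroup (n + (R₀ + k))) K).preimage
      continuous_subtype_val
  have hgenQ : ∀ q : Hn ⧸ H, ∃ i : ℕ, q = (QuotientGroup.mk γ : Hn ⧸ H) ^ i := by
    intro q
    obtain ⟨σ, rfl⟩ := QuotientGroup.mk_surjective q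
    obtain ⟨i, -, hi⟩ := exists_pow_inv_mul_mem_localSubgroup_layerSubgroup (κ := κ) v n (R₀ + k) hu σ.2
    refine ⟨i, ?_⟩
    rw [← QuotientGroup.mk_pow, eq_comm, QuotientGroup.eq, hmemH]
    simpa only [Subgroup.coe_mul, Subgroup.coe_inv, SubgroupClass.coe_pow] using hi
  -- the order of `ḡ` is `p^(R₀+k)`
  have hord : orderOf (QuotientGroup.mk γ : Hn ⧸ H) = p ^ (R₀ + k) := by
    have key : ∀ i : ℕ, (QuotientGroup.mk γ : Hn ⧸ H) ^ i = 1 ↔ p ^ (R₀ + k) ∣ i := fun i ↦ by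
      rw [← QuotientGroup.mk_pow, QuotientGroup.eq_one_iff, hmemH, SubgroupClass.coe_pow]
      exact hgi (R₀ + k) i
    exact Nat.dvd_antisymm (orderOf_dvd_of_pow_eq_one ((key _).mpr dvd_rfl)) ((key _).mp (pow_orderOf_eq_one _))
  -- every `S_i(x)` lies in `A₁`
  have hSA : ∀ i : ℕ, geomSum (X := X) γ x i ∈ A₁ := fun i ↦ by
    induction i with
    | zero => rw [geomSum_zero]; exact A₁.zero_mem
    | succ i ih => rw [geomSum_succ, hXρpow]; exact A₁.add_mem ih (hstab _ _ hx)
  -- every `S_i(x)` is fixed by `H_∞` (`H_∞ ⊴ Γ`)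
  have hnormalInf : (localSubgroup κ.kerSubgroup K).Normal := by
    rw [localSubgroup_eq_comap]; exact Subgroup.Normal.comap inferInstance _
  have hSfix : ∀ i : ℕ, ∀ h ∈ localSubgroup κ.kerSubgroup K, h • geomSum (X := X) γ x i = geomSum (X := X) γ x i := by
    intro i h hh
    induction i with
    | zero => rw [geomSum_zero, smul_zero]
    | succ i ih =>
      rw [geomSum_succ, smul_add, ih, hXρpow]
      congr 1
      have hconj : (g ^ i)⁻¹ * h * (g ^ i) ∈ localSubgroup κ.kerSubgroup K := by
        have := hnormalInf.conj_mem h hh (g ^ i)⁻¹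
        rwa [inv_inv] at this
      calc h • (g ^ i) • x = (g ^ i) • (((g ^ i)⁻¹ * h * g ^ i) • x) := by
            rw [← mul_smul, ← mul_smul]; congr 1; group
        _ = (g ^ i) • x := by rw [hxi _ hconj]
  -- the norm vanishes: `S_{p^(R₀+k)}(x) = 0`
  have hN : geomSum (X := X) γ x (orderOf (QuotientGroup.mk γ : Hn ⧸ H)) = 0 := by
    rw [hord]
    -- `p^k • S_{p^{R₀}}(x) = g^{p^{R₀}} y - y = 0`
    have hgR₀ : g ^ p ^ R₀ ∈ localSubgroup (κ.layerSubgroup (n + R₀)) K := (hgi R₀ _).mpr dvd_rfl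
    have hpS : p ^ k • geomSum (X := X) γ x (p ^ R₀) = 0 := by
      rw [← geomSum_nsmul (X := X), hrel, ← hXρ γ y, geomSum_smul_sub_eq (X := X), hXρpow, hyR₀ _ hgR₀,
        sub_self]
    -- hence `S_{p^{R₀}}(x) ∈ A₁[p^k]` is fixed by `g^{p^{R₀}}`, and `S_{p^{R₀+k}}(x) = p^k • S_{p^{R₀}}(x)`
    have hfix : X.ρ (γ ^ p ^ R₀) (geomSum (X := X) γ x (p ^ R₀)) = geomSum (X := X) γ x (p ^ R₀) := by
      rw [hXρpow]; exact hZR₀ _ (hSA _) hpS (hSfix _) _ hgR₀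
    rw [pow_add, geomSum_mul_eq_nsmul_of_apply_eq (X := X) γ x hfix (p ^ k), hpS]
  -- translates of `x` are fixed by `H_{n+R₀+k}` (normality), hence so are the sums `S_i(x)`
  have hfixS : ∀ h ∈ localSubgroup (κ.layerSubgroup (n + (R₀ + k))) K,
      ∀ i : ℕ, h • geomSum (X := X) γ x i = geomSum (X := X) γ x i := by
    intro h hh i
    induction i with
    | zero => rw [geomSum_zero, smul_zero]
    | succ i ih =>
      rw [geomSum_succ, smul_add, ih, hXρpow]
      congr 1
      have hconj : (g ^ i)⁻¹ * h * (g ^ i) ∈ localSubgroup (κ.layerSubgroup (n + (R₀ + k))) K := by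
        have := hnormal.conj_mem h hh (g ^ i)⁻¹
        rwa [inv_inv] at this
      calc h • (g ^ i) • x = (g ^ i) • (((g ^ i)⁻¹ * h * g ^ i) • x) := by
            rw [← mul_smul, ← mul_smul]; congr 1; group
        _ = (g ^ i) • x := by rw [hxR _ hconj]
  -- the cocycle `σ = g^i h ↦ S_i(x)`
  let f : Hn → P := fun σ ↦ geomSum (X := X) γ x (idxQ H γ hgenQ (σ : Hn ⧸ H))
  have hf_cont : Continuous f := by
    haveI : DiscreteTopology (Hn ⧸ H) := QuotientGroup.discreteTopology hHopen
    have hc : Continuous (fun q : Hn ⧸ H ↦ geomSum (X := X) γ x (idxQ H γ hgenQ q)) :=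
      continuous_of_discreteTopology
    exact hc.comp QuotientGroup.continuous_mk
  -- `σ = g^{idx σ} · h` with `h ∈ H_{n+R₀+k}`
  have hdec : ∀ σ : Hn, ((g ^ idxQ H γ hgenQ (σ : Hn ⧸ H))⁻¹ * (σ : absoluteGaloisGroup K)) ∈
      localSubgroup (κ.layerSubgroup (n + (R₀ + k))) K := fun σ ↦ by
    have hh := pow_idxQ_inv_mul_mem H γ hgenQ σ
    rw [hmemH] at hh
    simpa only [Subgroup.coe_mul, Subgroup.coe_inv, SubgroupClass.coe_pow] using hh
  have hsplit : ∀ (σ : Hn) (m : P), (σ : absoluteGaloisGroup K) • m =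
      (g ^ idxQ H γ hgenQ (σ : Hn ⧸ H)) • ((g ^ idxQ H γ hgenQ (σ : Hn ⧸ H))⁻¹ * (σ : absoluteGaloisGroup K)) • m :=
    fun σ m ↦ by rw [← mul_smul, mul_inv_cancel_left]
  let c : contOneCocycles X := ⟨⟨f, hf_cont⟩, fun σ τ ↦ by
    change geomSum (X := X) γ x (idxQ H γ hgenQ ((σ * τ : Hn) : Hn ⧸ H)) =
      geomSum (X := X) γ x (idxQ H γ hgenQ (σ : Hn ⧸ H)) +
        X.ρ σ (geomSum (X := X) γ x (idxQ H γ hgenQ (τ : Hn ⧸ H)))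
    rw [geomSum_eq_of_modEq (X := X) γ x hN (idxQ_mul_modEq H γ hgenQ σ τ), geomSum_add, hXρ σ, hsplit σ,
      hfixS _ (hdec σ), hXρpow]⟩
  have hc_apply : ∀ σ : Hn, c.1 σ = geomSum (X := X) γ x (idxQ H γ hgenQ (σ : Hn ⧸ H)) := fun _ ↦ rfl
  refine ⟨c, fun σ hσ ↦ ?_, ?_, fun σ ↦ by rw [hc_apply]; exact hSA _, fun σ ↦ ?_⟩
  · -- vanishing on `H_∞ ⊆ H_{n+R₀+k}`: `idx σ ≡ 0`
    rw [hc_apply]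
    have hσH : σ ∈ H := by
      rw [hmemH, mem_localSubgroup_iff]
      exact κ.kerSubgroup_le_layerSubgroup (n + (R₀ + k)) ((mem_localSubgroup_iff _ _ _).mp hσ)
    have h1 : (σ : Hn ⧸ H) = 1 := (QuotientGroup.eq_one_iff σ).mpr hσH
    have h0 : idxQ H γ hgenQ (σ : Hn ⧸ H) ≡ 0 [MOD orderOf (QuotientGroup.mk γ : Hn ⧸ H)] := by
      rw [← pow_eq_pow_iff_modEq, pow_zero, ← idxQ_spec H γ hgenQ (σ : Hn ⧸ H), h1]
    rw [geomSum_eq_of_modEq (X := X) γ x hN h0, geomSum_zero]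
  · -- `c(g) = S_1(x) = x`
    rw [hc_apply]
    have h1 : idxQ H γ hgenQ (γ : Hn ⧸ H) ≡ 1 [MOD orderOf (QuotientGroup.mk γ : Hn ⧸ H)] := by
      rw [← pow_eq_pow_iff_modEq, pow_one]
      exact (idxQ_spec H γ hgenQ (γ : Hn ⧸ H)).symm
    rw [geomSum_eq_of_modEq (X := X) γ x hN h1, geomSum_one]
  · -- `p^k • S_i(x) = S_i(g y - y) = g^i y - y = σ y - y`
    rw [hc_apply, ← geomSum_nsmul (X := X), hrel, ← hXρ γ y, geomSum_smul_sub_eq (X := X), hXρpow,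
      hsplit σ y, hyR _ (hdec σ)]

end Literature.NumberTheory.EllipticCurves.Greenberg1999.GoodOrdTower

end Part5

/-!
## Part 6 — port of `Summits/BirchSwinnertonDyer/Rank1Residual/Additive/LocalTowerKernelPrimaryExact.lean`

# `𝒦_{v,0}[p^∞] ≅ (M_∞/(g−1)M_∞)[p^∞]` EXACTLY: inflation cocycles for `p`-power-torsion values
# via the local `ℤ_p`-extension (cell `b2b-bsdres`, CLASS-CLOSURE lane, class O10 — x1b GEN 35,
# class lead; file 52 of the series: brick B4 of the GLOBAL count (C), part 3 — the surjectivity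
# half of Greenberg's `ker(r_v) ≅ H¹(Γ_v, ·)` at the `p`-primary level)

HONEST FRAMING (cell `b2b-bsdres`, run/shared/lean/b2b/bsd-rank1-residual/, verbatim in every
file): the goal of the cell is to DELETE the COMBINATION-SHAPED residual classes of the
Birch–Swinnerton-Dyer formula for ALL analytic-rank `≤ 1` elliptic curves over `ℚ` — "full BSD
formula for every rank `≤ 1` curve in class `C`" assembled STRICTLY from published theorems — so
that the rank-`≤ 1` remainder becomes exactly the CONSTRUCTION-SHAPED classes, which are TYPED
(missing-input `Prop`s), NOT attempted. This is not "finishing BSD". CLASS-CLOSURE lane: prove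
what is provable now; shrink each hard class to its core with data; no claim beyond stated classes;
research routes on CONSTRUCTION-SHAPED X12 / O10; census / instrument output = EVIDENCE / conjecture
items, NEVER a Literature fact; `RESIDUAL-MAP.md` marks change only by signed lines. THIS FILE:
TOOL THEOREMS ONLY over the tree's `ResKernel` / `PrimaryCoinvariants` / `ZpExtension` /
`localTowerKer` vocabulary — no definition, no named Literature fact, no Summits-side fact
`def … : Prop`, no `sorry`, axioms standard; nothing is booked; no label / mark / count / sub-cell
moves; O10 stays OPEN / CONSTRUCTION-SHAPED; nothing about `BSD(W, p)` of any pair is claimed.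

## What (brick B4 of `B2-LOCALISATION-x1b.md` §3, step (ii))

The tree's Lemma 3.3 mechanism (`ResKernel.finite_primary_subgroupResKer_and_card_le`,
`WeierstrassCurve.finite_localTowerKerPrimary_and_card_le`) EMBEDS the `p`-power torsion of
`ker(res : H¹(G, M) → H¹(N, M))` into `(M^N/(γ−1)M^N)[p^∞]` (evaluation at `γ`). Here:

* §1 (generic) `natCard_primary_subgroupResKer_eq`: the embedding is a BIJECTION as soon as (hinf)
  every `p`-power-torsion `b ∈ M^N` is the value at `γ` of a continuous cocycle on `G` vanishing on
  `N`, and (hdiv) `M^N/B` is `p`-divisible (`B = M^N[p^∞]`): then every class of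
  `(M^N/(γ−1)M^N)[p^∞]` is represented by some `b ∈ B` (the tree's `PrimaryCoinvariants` argument)
  and hence hit. So `#{x ∈ ker res | p-power torsion} = #(M^N/(γ−1)M^N)[p^∞]`.
* §2 (local) `exists_generator_and_cocycles`: for a `ℤ_p`-extension `κ` of `K`, a `K`-field `E` of
  characteristic `0` that does NOT split completely (`res(Γ_E) ⊄ ker κ`), and a curve `W/K`: there is
  `g ∈ Γ_E` generating `Γ_E` topologically together with `H_{E,∞} = Gal(K̄_E/K_∞·E)` such that
  (hinf) holds for `M = E(K̄_E)`, `N = H_{E,∞}` inside `H_{E,0} = Γ_E` — by file 51's local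
  `ℤ_p`-extension `κ_E` (`ker κ_E = H_{E,∞}`, `κ_E g = 1`) and the tree's inflation cocycles
  `ZpExtension.exists_cocycle_vanishing_apply_eq` on the `p`-primary `Γ_E`-module `E(K̄_E)[p^∞]`.
* §2 **`natCard_localTowerKerPrimary_zero_eq`**: with that `g`,
  **`#𝒦_{E,0}[p^∞] = #(E(K_∞·E)/(g−1)E(K_∞·E))[p^∞]`** whenever (hdiv) `E(K_∞·E)/E(K_∞·E)[p^∞]` is
  `p`-divisible and the right side is finite — the EQUALITY form of the tree's
  `finite_localTowerKerPrimary_and_card_le` at `n = 0`. At `v ∤ p`, (hdiv) and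
  `#(…)[p^∞] = #B/(g−1)B = p^{ord_p c_v}` are n1011's (a) and X11b's count read through file 50; the
  assembly `#𝒦_{v,0}[p^∞] = p^{ord_p c_v}` (B4) is then bookkeeping over n1011's bridge.

References: [GreenbergLNM1716] R. Greenberg, LNM 1716 (1999), §3 Lemmas 3.1, 3.3 (pp. 86–88), §4
p. 74 ("`ker r_v` has order `c_v^{(p)}`"); [SerreGaloisCohomology1997] I.§2.6, XIII.§1.
-/

section Part6


open scoped _root_.Classical

universe u

namespace Literature.NumberTheory.EllipticCurves.Greenberg1999.Rank1ResidualAdditive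

open Literature.NumberTheory.EllipticCurves Literature.NumberTheory.GaloisRepresentations
  Literature.NumberTheory.EllipticCurves.ResKernel Literature.NumberTheory.EllipticCurves.PrimaryCoinvariants
  ZpExtension

/-! ## §1 Generic: the `p`-primary evaluation embedding is onto -/

section Generic

variable {G : Type u} [Group G] [TopologicalSpace G] [IsTopologicalGroup G]
  (N : Subgroup G) [N.Normal] (M : Type u) [AddCommGroup M] [DistribMulAction G M]
  [TopologicalSpace M] [DiscreteTopology M]

/-- **`#{x ∈ ker(res : H¹(G,M) → H¹(N,M)) : p-power torsion} = #(M^N/(γ−1)M^N)[p^∞]`** when `N` and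
`γ` generate `G` topologically, (hinf) every `p`-power-torsion `b ∈ M^N` is `ψ(γ)` for a continuous
cocycle `ψ` on `G` vanishing on `N`, and (hdiv) `M^N` is `p`-divisible modulo `M^N[p^∞]`: the
tree's injective evaluation map (`exists_addMonoidHom_subgroupResKer_injective`) is then onto the
`p`-primary classes, each of which is represented by a `p`-power-torsion element (Greenberg's
"the uniquely divisible part contributes nothing"). [cite: GreenbergLNM1716, §3 Lemmas 3.1 and 3.3 (pp. 86–87)] -/
theorem natCard_primary_subgroupResKer_eq (γ : G)
    (hgen : ∀ U : Subgroup G, IsOpen (U : Set G) → N ≤ U → γ ∈ U → U = ⊤)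
    (hcont : ∀ m : M, Continuous fun g : G ↦ g • m) (p : ℕ)
    (hinf : ∀ b : FixedPoints.addSubgroup N M, (∃ k : ℕ, p ^ k • b = 0) →
      ∃ ψ : contOneCocycles (discreteTopRep G M), (∀ n ∈ N, ψ.1 n = 0) ∧ ψ.1 γ = b)
    (hdiv : ∀ y : FixedPoints.addSubgroup N M, ∃ y' : FixedPoints.addSubgroup N M,
      y - p • y' ∈ AddCommGroup.primaryComponent (FixedPoints.addSubgroup N M) p)
    [Finite (AddCommGroup.primaryComponent
      (FixedPoints.addSubgroup N M ⧸ (subOne N M γ).range) p)] :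
    Nat.card {x : subgroupResKer M N // ∃ k : ℕ, p ^ k • x = 0} =
      Nat.card (AddCommGroup.primaryComponent
        (FixedPoints.addSubgroup N M ⧸ (subOne N M γ).range) p) := by
  obtain ⟨w, hw, hwval⟩ := exists_addMonoidHom_subgroupResKer_injective N M γ hgen hcont
  let f : {x : subgroupResKer M N // ∃ k : ℕ, p ^ k • x = 0} →
      AddCommGroup.primaryComponent (FixedPoints.addSubgroup N M ⧸ (subOne N M γ).range) p :=
    fun x ↦ ⟨w x.1, by
      obtain ⟨k, hk⟩ := x.2
      exact (AddCommGroup.mem_primaryComponent).mpr ⟨k, by rw [← map_nsmul, hk, map_zero]⟩⟩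
  have hf : Function.Injective f := fun x y hxy ↦ Subtype.ext (hw (Subtype.ext_iff.mp hxy))
  have hfsurj : Function.Surjective f := by
    rintro ⟨q, hq⟩
    obtain ⟨k, hk⟩ := (AddCommGroup.mem_primaryComponent).mp hq
    obtain ⟨m, rfl⟩ := QuotientAddGroup.mk_surjective q
    -- `p^k m = (γ - 1) y`, `y = p^k y' + c` with `c` `p`-power torsion
    rw [← QuotientAddGroup.mk_nsmul, QuotientAddGroup.eq_zero_iff] at hk
    obtain ⟨y, hy⟩ := hk
    obtain ⟨y', hy'⟩ := exists_sub_pow_smul_mem p hdiv k y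
    -- `b = m - (γ - 1) y'` is `p`-power torsion and has the same class as `m`
    set b : FixedPoints.addSubgroup N M := m - subOne N M γ y' with hb
    have hbprim : b ∈ AddCommGroup.primaryComponent (FixedPoints.addSubgroup N M) p := by
      refine mem_primaryComponent_of_nsmul_mem p (k := k) ?_
      have e : p ^ k • b = subOne N M γ (y - p ^ k • y') := by
        rw [hb, smul_sub, map_sub, map_nsmul, hy]
      rw [e]
      exact map_mem_primaryComponent p _ hy'
    obtain ⟨j, hj⟩ := (AddCommGroup.mem_primaryComponent).mp hbprim
    obtain ⟨ψ, hψN, hψγ⟩ := hinf b ⟨j, hj⟩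
    -- the class of `ψ` lies in `ker res` and is `p`-power torsion
    have hmem : oneCocycleClass _ ψ ∈ subgroupResKer M N := by
      rw [mem_subgroupResKer_iff, ResKernel.resSubgroup_oneCocycleClass]
      have h0 : contOneCocycles.pullback (Literature.NumberTheory.EllipticCurves.subgroupIncl N)
          (resHomOfEquivariant (Literature.NumberTheory.EllipticCurves.subgroupIncl N) (AddMonoidHom.id M) (fun _ _ ↦ rfl)) ψ = 0 := by
        apply Subtype.ext
        ext n
        rw [pullback_subtype_apply]
        exact hψN n n.2
      rw [h0, oneCocycleClass_zero]
    have hwx : w ⟨_, hmem⟩ = QuotientAddGroup.mk b := by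
      rw [hwval ⟨_, hmem⟩ ψ hψN rfl]
      exact congrArg _ (Subtype.ext hψγ)
    have htors : ∃ k : ℕ, p ^ k • (⟨_, hmem⟩ : subgroupResKer M N) = 0 := by
      refine ⟨j, hw ?_⟩
      rw [map_nsmul, map_zero, hwx, ← QuotientAddGroup.mk_nsmul, hj, QuotientAddGroup.mk_zero]
    refine ⟨⟨⟨_, hmem⟩, htors⟩, Subtype.ext ?_⟩
    change w ⟨_, hmem⟩ = QuotientAddGroup.mk m
    rw [hwx, QuotientAddGroup.eq_iff_sub_mem]
    exact ⟨-y', by rw [hb, map_neg]; abel⟩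
  exact Nat.card_congr (Equiv.ofBijective f ⟨hf, hfsurj⟩)

end Generic

/-! ## §2 The local tower at a non-split place: inflation cocycles and the exact count -/

section Local

variable {K : Type u} [Field K] (W : WeierstrassCurve K) {p : ℕ} [hp : Fact p.Prime]
  (κ : ZpExtension K p) (E : Type u) [Field E] [CharZero E] [Algebra K E]

/-- **A topological generator of `Γ_E` modulo `H_{E,∞}` with inflation cocycles for every
`p`-power-torsion value.** If `E` does not split completely in `K_∞/K`, there is `g ∈ Γ_E` which
together with `H_{E,∞} = Gal(K̄_E/K_∞·E)` generates `Γ_E` topologically, such that every point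
`b ∈ E(K̄_E)` fixed by `H_{E,∞}` and killed by a power of `p` is the value at `g` of a continuous
cocycle on `H_{E,0} = Γ_E` vanishing on `H_{E,∞}`: take the local `ℤ_p`-extension `κ_E` of file 51
(`ker κ_E = H_{E,∞}`, `κ_E g = 1`) and the tree's inflation cocycle on the `p`-primary
`Γ_E`-module `E(K̄_E)[p^∞]` (`ZpExtension.exists_cocycle_vanishing_apply_eq`), pushed into
`E(K̄_E)`. [cite: GreenbergLNM1716, §3 Lemma 3.3 (p. 87)] [cite: SerreGaloisCohomology1997, XIII.§1] -/
theorem exists_generator_and_cocycles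
    (hE : ∃ δ : Field.absoluteGaloisGroup E, resGal (K := K) E δ ∉ κ.kerSubgroup) :
    ∃ (g : Field.absoluteGaloisGroup E) (hg : g ∈ localSubgroup (κ.layerSubgroup 0) E),
      (∀ U : Subgroup (Field.absoluteGaloisGroup E),
        IsOpen (U : Set (Field.absoluteGaloisGroup E)) → localSubgroup κ.kerSubgroup E ≤ U →
          g ∈ U → localSubgroup (κ.layerSubgroup 0) E ≤ U) ∧
      ∀ b : localPoints W E, (∀ τ ∈ localSubgroup κ.kerSubgroup E, τ • b = b) →
        (∃ k : ℕ, p ^ k • b = 0) →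
        ∃ ψ : contOneCocycles (discreteTopRep (localSubgroup (κ.layerSubgroup 0) E) (localPoints W E)),
          (∀ (τ : Field.absoluteGaloisGroup E) (hτ : τ ∈ localSubgroup κ.kerSubgroup E),
            ψ.1 ⟨τ, WeierstrassCurve.localSubgroup_ker_le_layer κ E 0 hτ⟩ = 0) ∧
          ψ.1 ⟨g, hg⟩ = b := by
  obtain ⟨κE, g, hker, hγ, -⟩ := exists_localZpExtension κ E hE
  have hmem0 : ∀ σ : Field.absoluteGaloisGroup E, σ ∈ localSubgroup (κ.layerSubgroup 0) E :=
    fun σ ↦ by rw [mem_localSubgroup_iff, layerSubgroup_zero]; exact Subgroup.mem_top _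
  refine ⟨g, hmem0 g, fun U hU hNU hgU σ _ ↦ ?_, fun b hbfix hbtors ↦ ?_⟩
  · -- topological generation, from `κ_E`
    have hle : κE.layerSubgroup 0 ≤ U :=
      κE.layerSubgroup_le_of_isOpen hγ 0 U hU (by rw [hker]; exact hNU) (by rwa [pow_zero, pow_one])
    exact hle (by rw [layerSubgroup_zero]; exact Subgroup.mem_top σ)
  · -- the inflation cocycle on the `p`-primary module `T = E(K̄_E)[p^∞]`
    let T : AddSubgroup (localPoints W E) := AddCommGroup.primaryComponent (localPoints W E) p
    have hcontT : ∀ t : T, Continuous fun σ : Field.absoluteGaloisGroup E ↦ σ • t := fun t ↦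
      (continuous_smul_localPoints W E (t : localPoints W E)).subtype_mk _
    have hprimT : ∀ t : T, ∃ k : ℕ, p ^ k • t = 0 := fun t ↦ by
      obtain ⟨k, hk⟩ := (AddCommGroup.mem_primaryComponent).mp t.2
      exact ⟨k, Subtype.ext (by rw [AddSubgroupClass.coe_nsmul, hk, ZeroMemClass.coe_zero])⟩
    have hbT : b ∈ T := (AddCommGroup.mem_primaryComponent).mpr hbtors
    have hbfix' : ∀ τ ∈ κE.kerSubgroup, τ • (⟨b, hbT⟩ : T) = ⟨b, hbT⟩ := fun τ hτ ↦
      Subtype.ext (hbfix τ (by rw [← hker]; exact hτ))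
    obtain ⟨ψ, hψN, hψγ⟩ :=
      κE.exists_cocycle_vanishing_apply_eq hγ 0 hcontT hprimT ⟨b, hbT⟩ hbfix'
    -- pull back along `H_{E,0} ≤ κ_E⁻¹(p⁰ℤ_p) = ⊤`, with coefficients `T ↪ E(K̄_E)`
    have h0 : localSubgroup (κ.layerSubgroup 0) E ≤ κE.layerSubgroup 0 := fun σ _ ↦ by
      rw [layerSubgroup_zero]; exact Subgroup.mem_top σ
    refine ⟨contOneCocycles.pullback (subgroupInclusion h0)
      (resHomOfEquivariant (subgroupInclusion h0) T.subtype (fun _ _ ↦ rfl)) ψ,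
      fun τ hτ ↦ ?_, ?_⟩
    · rw [contOneCocycles.pullback_apply]
      have h := hψN τ (by rw [hker]; exact hτ)
      change (T.subtype (ψ.1 (subgroupInclusion h0 ⟨τ, _⟩)) : localPoints W E) = 0
      have e : subgroupInclusion h0 ⟨τ, WeierstrassCurve.localSubgroup_ker_le_layer κ E 0 hτ⟩ =
          ⟨τ, κE.kerSubgroup_le_layerSubgroup 0 (by rw [hker]; exact hτ)⟩ := Subtype.ext rfl
      rw [e, h]
      rfl
    · rw [contOneCocycles.pullback_apply]
      change (T.subtype (ψ.1 (subgroupInclusion h0 ⟨g, _⟩)) : localPoints W E) = b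
      have e : subgroupInclusion h0 ⟨g, hmem0 g⟩ = ⟨g ^ p ^ 0, κE.pow_mem_layerSubgroup hγ 0⟩ :=
        Subtype.ext (show g = g ^ p ^ 0 by rw [pow_zero, pow_one])
      rw [e, hψγ]
      rfl

/-- **`#𝒦_{E,0}[p^∞] = #(E(K_∞·E)/(g−1)E(K_∞·E))[p^∞]` — the EQUALITY form of the tree's
`finite_localTowerKerPrimary_and_card_le` at `n = 0`**, for the generator `g` of
`exists_generator_and_cocycles`, whenever `E(K_∞·E)` is `p`-divisible modulo its `p`-power torsion
and the right side is finite. Ingredients: `𝒦_{E,0} = ker(res : H¹(H_{E,0}, E(K̄_E)) → H¹(H_{E,∞}, ·))`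
transported to the subgroup-kernel of the tree (both directions, the second by the cocycle
description `exists_cocycle_of_res_eq_zero`), §1 applied to the inflation cocycles, and the
identification of the fixed points / `g − 1` under `N = H_{E,∞} ≃ H_{E,∞}`.
[cite: GreenbergLNM1716, §3 Lemma 3.3 (proof, p. 87)] -/
theorem natCard_localTowerKerPrimary_zero_eq
    (hE : ∃ δ : Field.absoluteGaloisGroup E, resGal (K := K) E δ ∉ κ.kerSubgroup) :
    ∃ (g : Field.absoluteGaloisGroup E),
      g ∈ localSubgroup (κ.layerSubgroup 0) E ∧
      (∀ U : Subgroup (Field.absoluteGaloisGroup E),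
        IsOpen (U : Set (Field.absoluteGaloisGroup E)) → localSubgroup κ.kerSubgroup E ≤ U →
          g ∈ U → localSubgroup (κ.layerSubgroup 0) E ≤ U) ∧
      ((∀ y : FixedPoints.addSubgroup (localSubgroup κ.kerSubgroup E) (localPoints W E),
          ∃ y' : FixedPoints.addSubgroup (localSubgroup κ.kerSubgroup E) (localPoints W E),
            y - p • y' ∈ AddCommGroup.primaryComponent
              (FixedPoints.addSubgroup (localSubgroup κ.kerSubgroup E) (localPoints W E)) p) →
        Finite (AddCommGroup.primaryComponent
          (FixedPoints.addSubgroup (localSubgroup κ.kerSubgroup E) (localPoints W E) ⧸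
            (subOne (localSubgroup κ.kerSubgroup E) (localPoints W E) g).range) p) →
        Nat.card (W.localTowerKerPrimary κ E 0) =
          Nat.card (AddCommGroup.primaryComponent
            (FixedPoints.addSubgroup (localSubgroup κ.kerSubgroup E) (localPoints W E) ⧸
              (subOne (localSubgroup κ.kerSubgroup E) (localPoints W E) g).range) p)) := by
  obtain ⟨g, hg, hgen, hinf⟩ := exists_generator_and_cocycles W κ E hE
  refine ⟨g, hg, hgen, fun hdiv hfin ↦ ?_⟩
  -- notation (as in the tree's `finite_localTowerKerPrimary_and_card_le`)
  let P : Type u := localPoints W E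
  let Hn : Subgroup (Field.absoluteGaloisGroup E) := localSubgroup (κ.layerSubgroup 0) E
  let Hi : Subgroup (Field.absoluteGaloisGroup E) := localSubgroup κ.kerSubgroup E
  let N : Subgroup Hn := Hi.subgroupOf Hn
  let γ : Hn := ⟨g, hg⟩
  have hle : Hi ≤ Hn := WeierstrassCurve.localSubgroup_ker_le_layer κ E 0
  -- (1) generation inside `H_{E,0}`
  have hgen' : ∀ U : Subgroup Hn, IsOpen (U : Set Hn) → N ≤ U → γ ∈ U → U = ⊤ := by
    intro U hU hNU hγU
    let U' : Subgroup (Field.absoluteGaloisGroup E) := U.map Hn.subtype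
    have hopen : IsOpen (U' : Set (Field.absoluteGaloisGroup E)) :=
      (isOpen_localSubgroup_layerSubgroup E κ 0).isOpenMap_subtype_val _ hU
    have hN' : Hi ≤ U' := fun τ hτ ↦
      ⟨⟨τ, hle hτ⟩, hNU (Subgroup.mem_subgroupOf.mpr hτ), rfl⟩
    have hγU' : g ∈ U' := ⟨γ, hγU, rfl⟩
    have hle' := hgen U' hopen hN' hγU'
    rw [eq_top_iff]
    intro x _
    obtain ⟨u, hu, hux⟩ := hle' x.2
    have : u = x := Subtype.ext hux
    exact this ▸ hu
  -- (2) orbit maps on `H_{E,0}`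
  have hcont : ∀ m : P, Continuous fun x : Hn ↦ x • m := fun m ↦
    (continuous_smul_localPoints W E m).comp continuous_subtype_val
  -- (3) `P^N = P^{H_{E,∞}}`, compatibly with `g − 1`, `p`-divisibility and `p`-power torsion
  have hfix : FixedPoints.addSubgroup N P = FixedPoints.addSubgroup Hi P := by
    ext m
    simp only [FixedPoints.mem_addSubgroup]
    constructor
    · intro h τ
      exact h ⟨⟨τ, hle τ.2⟩, Subgroup.mem_subgroupOf.mpr τ.2⟩
    · intro h x
      exact h ⟨((x : Hn) : Field.absoluteGaloisGroup E), Subgroup.mem_subgroupOf.mp x.2⟩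
  let e : FixedPoints.addSubgroup N P ≃+ FixedPoints.addSubgroup Hi P :=
    AddEquiv.addSubgroupCongr hfix
  have he_coe : ∀ y : FixedPoints.addSubgroup N P, ((e y : FixedPoints.addSubgroup Hi P) : P) = y :=
    fun _ ↦ rfl
  have he : AddSubgroup.map (e : FixedPoints.addSubgroup N P →+ FixedPoints.addSubgroup Hi P)
      (subOne N P γ).range = (subOne Hi P g).range := by
    ext b
    constructor
    · rintro ⟨x, ⟨y, rfl⟩, rfl⟩
      exact ⟨e y, Subtype.ext rfl⟩
    · rintro ⟨y, rfl⟩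
      exact ⟨subOne N P γ (e.symm y), ⟨e.symm y, rfl⟩, Subtype.ext rfl⟩
  let eq : FixedPoints.addSubgroup N P ⧸ (subOne N P γ).range ≃+
      FixedPoints.addSubgroup Hi P ⧸ (subOne Hi P g).range :=
    QuotientAddGroup.congr _ _ e he
  let ep : AddCommGroup.primaryComponent (FixedPoints.addSubgroup N P ⧸ (subOne N P γ).range) p ≃
      AddCommGroup.primaryComponent (FixedPoints.addSubgroup Hi P ⧸ (subOne Hi P g).range) p :=
    eq.toEquiv.subtypeEquiv fun a ↦ by
      simp only [AddCommGroup.mem_primaryComponent, AddEquiv.toEquiv_eq_coe, EquivLike.coe_coe]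
      constructor
      · rintro ⟨k, hk⟩
        exact ⟨k, by rw [← map_nsmul, hk, map_zero]⟩
      · rintro ⟨k, hk⟩
        refine ⟨k, eq.injective ?_⟩
        rw [map_nsmul, hk, map_zero]
  haveI : Finite (AddCommGroup.primaryComponent
      (FixedPoints.addSubgroup N P ⧸ (subOne N P γ).range) p) := Finite.of_equiv _ ep.symm
  have hcardp : Nat.card (AddCommGroup.primaryComponent
      (FixedPoints.addSubgroup N P ⧸ (subOne N P γ).range) p) =
      Nat.card (AddCommGroup.primaryComponent
        (FixedPoints.addSubgroup Hi P ⧸ (subOne Hi P g).range) p) :=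
    Nat.card_congr ep
  -- (hinf) and (hdiv) transported to `N`
  have hinfN : ∀ b : FixedPoints.addSubgroup N P, (∃ k : ℕ, p ^ k • b = 0) →
      ∃ ψ : contOneCocycles (discreteTopRep Hn P), (∀ n ∈ N, ψ.1 n = 0) ∧ ψ.1 γ = b := by
    rintro b ⟨k, hk⟩
    have hbfix : ∀ τ ∈ Hi, τ • (b : P) = b := fun τ hτ ↦ (e b).2 ⟨τ, hτ⟩
    have hbk : p ^ k • (b : P) = 0 := by
      have := congrArg (fun z : FixedPoints.addSubgroup N P ↦ (z : P)) hk
      simpa only [AddSubgroupClass.coe_nsmul, ZeroMemClass.coe_zero] using this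
    obtain ⟨ψ, hψN, hψg⟩ := hinf (b : P) hbfix ⟨k, hbk⟩
    refine ⟨ψ, fun n hn ↦ ?_, hψg⟩
    have h := hψN ((n : Hn) : Field.absoluteGaloisGroup E) (Subgroup.mem_subgroupOf.mp hn)
    have en : (⟨((n : Hn) : Field.absoluteGaloisGroup E),
        WeierstrassCurve.localSubgroup_ker_le_layer κ E 0 (Subgroup.mem_subgroupOf.mp hn)⟩ : Hn) = n :=
      Subtype.ext rfl
    rwa [en] at h
  have hdivN : ∀ y : FixedPoints.addSubgroup N P, ∃ y' : FixedPoints.addSubgroup N P,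
      y - p • y' ∈ AddCommGroup.primaryComponent (FixedPoints.addSubgroup N P) p := by
    intro y
    obtain ⟨y', hy'⟩ := hdiv (e y)
    refine ⟨e.symm y', ?_⟩
    obtain ⟨k, hk⟩ := (AddCommGroup.mem_primaryComponent).mp hy'
    refine (AddCommGroup.mem_primaryComponent).mpr ⟨k, e.injective ?_⟩
    rw [map_nsmul, map_sub, map_nsmul, AddEquiv.apply_symm_apply, hk, map_zero]
  -- (4) the generic count on `H_{E,0}`
  have hcount := natCard_primary_subgroupResKer_eq N P γ hgen' hcont p hinfN hdivN
  -- (5) `𝒦_{E,0} = ker (res : H¹(H_{E,0}, P) → H¹(N, P))`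
  let j : N →ₜ* Hi :=
    { toFun := fun x ↦ ⟨((x : Hn) : Field.absoluteGaloisGroup E), Subgroup.mem_subgroupOf.mp x.2⟩
      map_one' := rfl
      map_mul' := fun _ _ ↦ rfl
      continuous_toFun :=
        (continuous_subtype_val.comp continuous_subtype_val).subtype_mk _ }
  have hcomp : (resH1Hom j (AddMonoidHom.id P) (fun _ _ ↦ rfl)).comp
      (Literature.NumberTheory.EllipticCurves.resOfLe P hle) = resSubgroup N P := by
    unfold Literature.NumberTheory.EllipticCurves.resOfLe ResKernel.resSubgroup
    rw [resH1Hom_comp]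
    exact resH1Hom_congr (ContinuousMonoidHom.ext fun _ ↦ rfl) (AddMonoidHom.ext fun _ ↦ rfl) _ _
  have hker : W.localTowerKer κ E 0 = subgroupResKer P N := by
    apply le_antisymm
    · intro c hc
      rw [mem_subgroupResKer_iff, ← hcomp, AddMonoidHom.comp_apply,
        (W.mem_localTowerKer_iff κ E 0 c).mp hc, map_zero]
    · intro c hc
      -- a class dying on `N` is represented by a cocycle vanishing on `N`, i.e. on `H_{E,∞}`
      obtain ⟨φ, rfl, hφN⟩ := exists_cocycle_of_res_eq_zero N P hcont c hc
      rw [W.mem_localTowerKer_iff κ E 0]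
      change Literature.NumberTheory.EllipticCurves.resOfLe P hle (oneCocycleClass _ φ) = 0
      have h0 : oneCocycleClass _ (contOneCocycles.pullback (subgroupInclusion hle)
          (resHomOfEquivariant (subgroupInclusion hle) (AddMonoidHom.id P) (fun _ _ ↦ rfl)) φ) = 0 := by
        rw [oneCocycleClass_eq_zero_iff]
        refine ⟨0, fun τ ↦ ?_⟩
        rw [map_zero, sub_zero, contOneCocycles.pullback_apply]
        exact hφN ⟨(τ : Field.absoluteGaloisGroup E), hle τ.2⟩ (Subgroup.mem_subgroupOf.mpr τ.2)
      rw [← map_oneCocycleClass] at h0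
      exact h0
  -- (6) `𝒦_{E,0}[p^∞] ≃ {x ∈ ker res | p-power torsion}`
  let f : W.localTowerKerPrimary κ E 0 ≃ {x : subgroupResKer P N // ∃ k : ℕ, p ^ k • x = 0} :=
    { toFun := fun c ↦ ⟨⟨(c : discreteH1 Hn P), hker.le ((W.mem_localTowerKerPrimary_iff κ E 0 _).mp c.2).1⟩, by
        obtain ⟨k, hk⟩ := ((W.mem_localTowerKerPrimary_iff κ E 0 _).mp c.2).2
        exact ⟨k, Subtype.ext hk⟩⟩
      invFun := fun x ↦ ⟨((x.1 : subgroupResKer P N) : discreteH1 Hn P),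
        (W.mem_localTowerKerPrimary_iff κ E 0 _).mpr ⟨hker.symm.le x.1.2, by
          obtain ⟨k, hk⟩ := x.2
          exact ⟨k, by
            have := congrArg (fun z : subgroupResKer P N ↦ (z : discreteH1 Hn P)) hk
            simpa only [AddSubgroupClass.coe_nsmul, ZeroMemClass.coe_zero] using this⟩⟩⟩
      left_inv := fun c ↦ Subtype.ext rfl
      right_inv := fun x ↦ Subtype.ext (Subtype.ext rfl) }
  rw [Nat.card_congr f, hcount, hcardp]

end Local

end Literature.NumberTheory.EllipticCurves.Greenberg1999.Rank1ResidualAdditive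

end Part6

/-!
## Part 7 — port of `Summits/BirchSwinnertonDyer/BirchSwinnertonDyer/Theorems/ByReductionTypeAtTwoMultTowerSplitOrderBound.lean`

# Route `ByReductionTypeAtTwo`, crux `MultUpperHalfAtTwo` (item stmt-BirchSwinnertonDyer-19922), TOWER road, the
# SPLIT rows: KERNEL BRICK S4 — the ORDER bound at a split `2`:
# `#𝒦_{v,n}[2^∞] ≤ 2^{k}` whenever `ord₂(log₂ q_E) ≤ k + 2` — the projection of hSP the split doors consume, PROVED

HONEST FRAMING (cell `bsd-2adic`, run/shared/lean/pub/bsd-2adic/, seat `bsd-2adic-mult` GEN 13, HUMAN RULINGS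
D-0036 / D-0054 / D-0074): theorems only (no definition, no named fact, no `sorry`); closes nothing by itself (the split
tower class files keep their other displayed binders); nothing booked; BSD is not proved by any of this. This file
PROVES, in the kernel, the statement the split TOWER doors of item 19922 take from the PRINT named fact
`Greenberg1999.sec3_natCard_localTowerKerPrimary_splitMultiplicative_rat` (Greenberg, LNM 1716, §3 pp. 92–93,
`|ker(r_{v_n})| ∼ log_p(N q_E)/2p[…]`, R342 PRINT-by-name) through `MultTowerCert.atTwo_le_pow_of_split`:
for `W/ℚ` with a Tate datum `Dq` at `2` (split multiplicative), `log₂ q_E ≠ 0` and `ord₂(log₂ q_E) ≤ k + 2`,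
EVERY cyclotomic `κ`, `v ∋ 2` and EVERY layer `n`: the local tower kernel `𝒦_{v,n}[2^∞]` is finite of order
`≤ 2^k` — hence so is its `2`-torsion (`atTwo_le_pow_of_split_kernel`, the door's slot VERBATIM minus `hSP`). It is an
UPPER BOUND (the print's EQUALITY needs local reciprocity and is not claimed); it needs NO class field axiom. Assembly:
BRICK S3 (untwisted uniformisation with `j`-clause, `e(q_v) = Dq.q`), BRICK S1 (`ord₂ log₂ q_E = w + 2` ⇒ depth `w` of
the Tate unit), BRICK S4b (the count `#(M_∞/(g−1)M_∞)[2^∞] ≤ 2^w`), the tree's local inflation–restriction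
`WeierstrassCurve.finite_localTowerKerPrimary_and_card_le` (`𝒦_{v,n}[2^∞] ↪ (M_∞/(g−1)M_∞)[2^∞]`).

* `finite_and_natCard_localTowerKerPrimary_le_pow_splitTwo` — **`Finite 𝒦_{v,n}[2^∞] ∧ #𝒦_{v,n}[2^∞] ≤ 2^k`**;
* `atTwo_le_pow_of_split_kernel` — the `2`-torsion projection, = `MultTowerCert.atTwo_le_pow_of_split` WITHOUT `hSP`.

References: R. Greenberg, LNM 1716 (1999), §3 pp. 85–93; J. Silverman, GTM 151, V.3–V.5; J. Neukirch, *ANT* IV (3.5);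
cell memos NOTE-SP1ONE.md §5, SCOPE-hNS2one-kernel-GEN8.md.
-/

section Part7

set_option autoImplicit false

open scoped _root_.Classical

namespace Literature.NumberTheory.EllipticCurves.Greenberg1999.MultTowerSplitOrder

open _root_.NumberField _root_.IsDedekindDomain _root_.Field _root_.WeierstrassCurve _root_.PadicInt _root_.Rat.HeightOneSpectrum
  Literature.NumberTheory.EllipticCurves Literature.NumberTheory.EllipticCurves.ResKernel
  Literature.NumberTheory.GaloisRepresentations
  Literature.NumberTheory.EllipticCurves.Greenberg1999.MultTowerNS2

variable {κ : ZpExtension ℚ 2}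

/-! ### The kernel theorems -/

/-- **The ORDER bound at a split `2`, PROVED**: for `W/ℚ` elliptic with a Tate datum `Dq` at `2` (split multiplicative
reduction at `2`, `q_E = Dq.q`), `log₂ q_E ≠ 0` and `ord₂(log₂ q_E) ≤ k + 2`, the local tower kernel `𝒦_{v,n}[2^∞]`
(`W.localTowerKerPrimary κ ℚ_v n`) is finite of order at most `2^k`, for every cyclotomic `κ`, every `v ∋ 2` and every
layer `n`. The PRINT fact hSP (`Greenberg1999.sec3_natCard_localTowerKerPrimary_splitMultiplicative_rat`) asserts the
ORDER is exactly `2^{ord₂ log₂ q_E − 2}`; this is its upper half, now a theorem.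
[cite: GreenbergLNM1716, §3, between Prop. 3.6 and Prop. 3.7 (PDF pp. 92–93)] [cite: SilvermanATAEC1994, Thm. V.3.1, V.5.3]
[cite: NeukirchANT1999, Ch. IV (3.5)] -/
theorem finite_and_natCard_localTowerKerPrimary_le_pow_splitTwo (W : WeierstrassCurve ℚ) [W.IsElliptic]
    (Dq : TateParameterData W 2) (hlog : padicLog 2 Dq.q ≠ 0) {k : ℕ}
    (hk : (padicLog 2 Dq.q).valuation ≤ (k : ℤ) + 2) (κ : ZpExtension ℚ 2) (hκ : κ.IsCyclotomic)
    (v : HeightOneSpectrum (𝓞 ℚ)) (hv : ((2 : ℕ) : 𝓞 ℚ) ∈ v.asIdeal) (n : ℕ) :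
    Finite (W.localTowerKerPrimary κ (v.adicCompletion ℚ) n) ∧
      Nat.card (W.localTowerKerPrimary κ (v.adicCompletion ℚ) n) ≤ 2 ^ k := by
  -- the uniformisation at `v` and the identification with `Dq.q`
  have hsplitv := hasSplitMultiplicativeReductionAt_of_atPrime W v hv Dq.split
  obtain ⟨q, Φ, hq0, hq1, hqj, hsurj, hker, hequiv⟩ := exists_tateUniformisation_tateJ W v hsplitv
  obtain ⟨e, he⟩ := exists_ringEquiv_tateParameter 2 v hv
  have heq : e q = Dq.q := he W q hq0 hq1 hqj Dq
  -- `Dq.q = 2^k' u`, `u` of depth `w ≤ k`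
  obtain ⟨k', u, hqu⟩ := exists_eq_two_pow_mul_units Dq.q_ne_zero Dq.norm_q_lt_one
  obtain ⟨s, hs2, hsk, hus⟩ := exists_depth_of_padicLog hqu hlog hk
  obtain ⟨w, rfl⟩ : ∃ w, s = w + 2 := ⟨s - 2, by omega⟩
  have hu' : ‖(u : ℤ_[2]) ^ 2 - 1‖ = (2 : ℝ) ^ (-((w : ℤ) + 3)) := by
    rw [hus, show ((w + 2 : ℕ) : ℤ) + 1 = (w : ℤ) + 3 by push_cast; ring]
  have hq : e q = (2 : ℚ_[2]) ^ k' * ((u : ℤ_[2]) : ℚ_[2]) := by rw [heq, hqu]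
  -- equivariance in value form
  have hequiv' : ∀ (σ : absoluteGaloisGroup (v.adicCompletion ℚ)) (w w' : (AlgebraicClosure (v.adicCompletion ℚ))ˣ),
      (w' : AlgebraicClosure (v.adicCompletion ℚ)) = σ • (w : AlgebraicClosure (v.adicCompletion ℚ)) →
        σ • Φ (Additive.ofMul w) = Φ (Additive.ofMul w') := by
    intro σ w w' h
    have hw' : w' = Units.map (absoluteGaloisGroup.toAlgEquiv (v.adicCompletion ℚ) σ :
        AlgebraicClosure (v.adicCompletion ℚ) →* AlgebraicClosure (v.adicCompletion ℚ)) w := Units.ext h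
    rw [hw']
    exact hequiv σ w
  -- a topological generator and the count
  obtain ⟨g, hgn, hgen⟩ := ZpExtension.exists_mem_localSubgroup_generate κ (v.adicCompletion ℚ) n
  obtain ⟨hfinT, hcardT⟩ := finite_primaryComponent_coinvariants_and_card_le hκ v hv hsurj hker hequiv' hq0 hq1 e hq hu'
    n hgn hgen
  haveI := hfinT
  obtain ⟨hfin, hcard⟩ := finite_localTowerKerPrimary_and_card_le W κ (v.adicCompletion ℚ) n hgn hgen
  refine ⟨hfin, hcard.trans (hcardT.trans ?_)⟩
  exact Nat.pow_le_pow_right (by norm_num) (by omega)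

/-- **`h2` at a SPLIT multiplicative `2` — KERNEL**: the hypothesis `h2 = #𝒦_{v,j'}[2] ≤ 2^k` of the tower gap
certificates, i.e. the statement `MultTowerCert.atTwo_le_pow_of_split` derives from the PRINT named fact hSP, proved
WITHOUT hSP: same signature minus `hSP` (and minus global minimality). [cite: GreenbergLNM1716, §3, between Prop. 3.6
and Prop. 3.7 (PDF pp. 92–93)] -/
theorem atTwo_le_pow_of_split_kernel (W : WeierstrassCurve ℚ) [W.IsElliptic]
    (Dq : TateParameterData W 2) (hlog : padicLog 2 Dq.q ≠ 0) {k : ℕ}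
    (hk : (padicLog 2 Dq.q).valuation ≤ (k : ℤ) + (padicValNat 2 (2 * 2) : ℤ)) (n : ℕ) :
    ∀ κ : ZpExtension ℚ 2, κ.IsCyclotomic → ∀ v : HeightOneSpectrum (𝓞 ℚ), ((2 : ℕ) : 𝓞 ℚ) ∈ v.asIdeal →
      Finite {x : W.localTowerKerPrimary κ (v.adicCompletion ℚ) n // 2 • x = 0} ∧
        Nat.card {x : W.localTowerKerPrimary κ (v.adicCompletion ℚ) n // 2 • x = 0} ≤ 2 ^ k := by
  intro κ hκ v hv
  have h4 : padicValNat 2 (2 * 2) = 2 := by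
    have : (2 * 2 : ℕ) = 2 ^ 2 := by norm_num
    rw [this, padicValNat.prime_pow]
  rw [h4] at hk
  obtain ⟨hfin, hcard⟩ := finite_and_natCard_localTowerKerPrimary_le_pow_splitTwo W Dq hlog (by exact_mod_cast hk) κ hκ v hv n
  haveI := hfin
  exact ⟨Finite.of_injective _ Subtype.val_injective,
    (Nat.card_le_card_of_injective _ Subtype.val_injective).trans hcard⟩

end Literature.NumberTheory.EllipticCurves.Greenberg1999.MultTowerSplitOrder

end Part7

/-!
## Part 8 — port of `Summits/BirchSwinnertonDyer/BirchSwinnertonDyer/Theorems/ByReductionTypeAtTwoEulerCharCoinvExact.lean`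

# Route `ByReductionTypeAtTwo` (K4), TOWER road — Greenberg's `ker(r_{v_n}) ≅ H¹(Γ_v, ·)` EXACTLY at a place above `p`:
# `#𝒦_{v,n}[p^∞] = #(E(K_{∞,η})/(g − 1)E(K_{∞,η}))[p^∞]` with NO divisibility hypothesis

Cell `bsd-2adic`, seat `bsd-2adic-tower-1` (GEN 25), `--supports stmt-BirchSwinnertonDyer-19271` (helper). TOOL theorems
only (no definition, no named fact, no `sorry`); closes nothing by itself; BSD is not proved by any of this. Part (a) of the
programme «Greenberg LNM 1716 Lemma 3.4 at layer `0` EXACT ⇒ Thm. 4.1 over `ℚ` ⇒ the `hEC` binder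
`X5.TwoAdicEulerCharRankZero W 0` of the TOWER doors in the kernel» (sibling `…EulerCharLayerZero.lean`).

The tree's local inflation–restriction (`ResKernel.exists_addMonoidHom_subgroupResKer_injective`, transported in
`MultTowerNS2.finite_torsionBy_localTowerKerPrimary_and_card_le` / `WeierstrassCurve.finite_localTowerKerPrimary_and_card_le`)
EMBEDS `𝒦_{E,n}[p^∞]` into the `p`-power torsion of the coinvariants `M_∞/(g − 1)M_∞`, `M_∞ = E(K̄_E)^{H_{E,∞}}`, `g` a
topological generator of `H_{E,n}` modulo `H_{E,∞}`. Cell b2b-bsdres (`Rank1Residual/Additive/LocalTowerKernelPrimaryExact`)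
proved the embedding ONTO at `n = 0` when `M_∞` is `p`-divisible modulo its torsion — true at `v ∤ p`, false at `v ∣ p`.
This file removes that hypothesis: the embedding is onto as soon as EVERY relation `p^k x = (g − 1) y` in `M_∞` is realised
by a continuous cocycle on `H_{E,n}` vanishing on `H_{E,∞}` with value `x` at `g` (§1–§2, any `K`, `E`, `n`), and at a place
`v ∣ p` of `ℚ` for the cyclotomic `ℤ_p`-extension this is this lineage's inflated cocycle
`GoodOrdTower.exists_contOneCocycles_inflate_pow_of_fixed` (GEN 20, BRICK B′ with `A₁ = E(K̄_v)`: the geometric sums of `x`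
become `p^k`-torsion, `H_∞`-fixed, hence fixed at a finite level) (§3).

* §1 `natCard_primary_subgroupResKer_eq_of_cocycles` — generic: `#{x ∈ ker(res : H¹(G,M) → H¹(N,M)) : p-power torsion}
  = #(M^N/(γ − 1)M^N)[p^∞]` given the cocycles.
* §2 `natCard_localTowerKerPrimary_eq_of_cocycles` — `#𝒦_{E,n}[p^∞] = #(M_∞/(g − 1)M_∞)[p^∞]` (any layer `n`).
* §3 **`natCard_localTowerKerPrimary_eq_coinv_atP`** — for `κ` the cyclotomic `ℤ_p`-extension of `ℚ`, `v ∋ p`, ANY `W/ℚ`,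
  any layer `n` and the inertial generator `g` of `GoodOrdTower.exists_inertial_generator`:
  `#𝒦_{v,n}[p^∞] = #(E(K̄_v)^{H_∞}/(g − 1))[p^∞]` whenever the right side is finite.

References: [GreenbergLNM1716] §3 Lemma 3.1 (p. 86), Lemma 3.4 (p. 89); [SerreGaloisCohomology1997] I.§2.6, XIII.§1.
-/

section Part8

set_option autoImplicit false
-- justification: the mandated namespace `Summit.BirchSwinnertonDyer.BirchSwinnertonDyer.Theorems`

open scoped _root_.Classical

universe u

namespace Literature.NumberTheory.EllipticCurves.Greenberg1999.GoodOrdTower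

open _root_.NumberField _root_.IsDedekindDomain _root_.Field Literature.NumberTheory.EllipticCurves
  Literature.NumberTheory.GaloisRepresentations Literature.NumberTheory.EllipticCurves.ResKernel
  Literature.NumberTheory.EllipticCurves.PrimaryCoinvariants ZpExtension _root_.WeierstrassCurve

/-! ## §1 Generic: the `p`-primary evaluation embedding is onto, given the cocycles -/

section Generic

variable {G : Type u} [Group G] [TopologicalSpace G] [IsTopologicalGroup G]
  (N : Subgroup G) [N.Normal] (M : Type u) [AddCommGroup M] [DistribMulAction G M]
  [TopologicalSpace M] [DiscreteTopology M]

/-- **`#{x ∈ ker(res : H¹(G,M) → H¹(N,M)) : p-power torsion} = #(M^N/(γ−1)M^N)[p^∞]`** when `N` and `γ` generate `G`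
topologically and (hinf) EVERY relation `p^k • x = (γ − 1) y` in `M^N` is realised by a continuous cocycle `ψ` on `G`
vanishing on `N` with `ψ(γ) = x`: the tree's injective evaluation map (`exists_addMonoidHom_subgroupResKer_injective`) then
hits every `p`-power-torsion class, and the hit class is `p`-power torsion by injectivity. (The variant of
`Rank1Residual.Additive.natCard_primary_subgroupResKer_eq` without the `p`-divisibility hypothesis.)
[cite: GreenbergLNM1716, §3 Lemma 3.1 (p. 86)] -/
theorem natCard_primary_subgroupResKer_eq_of_cocycles (γ : G)
    (hgen : ∀ U : Subgroup G, IsOpen (U : Set G) → N ≤ U → γ ∈ U → U = ⊤)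
    (hcont : ∀ m : M, Continuous fun g : G ↦ g • m) (p : ℕ)
    (hinf : ∀ (x y : FixedPoints.addSubgroup N M) (k : ℕ), p ^ k • x = subOne N M γ y →
      ∃ ψ : contOneCocycles (discreteTopRep G M), (∀ n ∈ N, ψ.1 n = 0) ∧ ψ.1 γ = x)
    [Finite (AddCommGroup.primaryComponent
      (FixedPoints.addSubgroup N M ⧸ (subOne N M γ).range) p)] :
    Nat.card {x : subgroupResKer M N // ∃ k : ℕ, p ^ k • x = 0} =
      Nat.card (AddCommGroup.primaryComponent
        (FixedPoints.addSubgroup N M ⧸ (subOne N M γ).range) p) := by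
  obtain ⟨w, hw, hwval⟩ := exists_addMonoidHom_subgroupResKer_injective N M γ hgen hcont
  let f : {x : subgroupResKer M N // ∃ k : ℕ, p ^ k • x = 0} →
      AddCommGroup.primaryComponent (FixedPoints.addSubgroup N M ⧸ (subOne N M γ).range) p :=
    fun x ↦ ⟨w x.1, by
      obtain ⟨k, hk⟩ := x.2
      exact (AddCommGroup.mem_primaryComponent).mpr ⟨k, by rw [← map_nsmul, hk, map_zero]⟩⟩
  have hf : Function.Injective f := fun x y hxy ↦ Subtype.ext (hw (Subtype.ext_iff.mp hxy))
  have hfsurj : Function.Surjective f := by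
    rintro ⟨q, hq⟩
    obtain ⟨k, hk⟩ := (AddCommGroup.mem_primaryComponent).mp hq
    obtain ⟨m, rfl⟩ := QuotientAddGroup.mk_surjective q
    -- `p^k m = (γ - 1) y`
    rw [← QuotientAddGroup.mk_nsmul, QuotientAddGroup.eq_zero_iff] at hk
    obtain ⟨y, hy⟩ := hk
    obtain ⟨ψ, hψN, hψγ⟩ := hinf m y k hy.symm
    -- the class of `ψ` lies in `ker res` and maps to `[m]`
    have hmem : oneCocycleClass _ ψ ∈ subgroupResKer M N := by
      rw [mem_subgroupResKer_iff, ResKernel.resSubgroup_oneCocycleClass]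
      have h0 : contOneCocycles.pullback (Literature.NumberTheory.EllipticCurves.subgroupIncl N)
          (resHomOfEquivariant (Literature.NumberTheory.EllipticCurves.subgroupIncl N) (AddMonoidHom.id M)
            (fun _ _ ↦ rfl)) ψ = 0 := by
        apply Subtype.ext
        ext n
        rw [pullback_subtype_apply]
        exact hψN n n.2
      rw [h0, oneCocycleClass_zero]
    have hwx : w ⟨_, hmem⟩ = QuotientAddGroup.mk m := by
      rw [hwval ⟨_, hmem⟩ ψ hψN rfl]
      exact congrArg _ (Subtype.ext hψγ)
    have htors : ∃ k : ℕ, p ^ k • (⟨_, hmem⟩ : subgroupResKer M N) = 0 := by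
      refine ⟨k, hw ?_⟩
      rw [map_nsmul, map_zero, hwx, ← QuotientAddGroup.mk_nsmul, QuotientAddGroup.eq_zero_iff]
      exact ⟨y, hy⟩
    exact ⟨⟨⟨_, hmem⟩, htors⟩, Subtype.ext hwx⟩
  exact Nat.card_congr (Equiv.ofBijective f ⟨hf, hfsurj⟩)

end Generic

/-! ## §2 The local tower kernel at any layer, given the cocycles -/

section Local

variable {K : Type u} [Field K] (W : WeierstrassCurve K) {p : ℕ} [hp : Fact p.Prime]
  (κ : ZpExtension K p) (E : Type u) [Field E] [Algebra K E]

/-- **`#𝒦_{E,n}[p^∞] = #(E(K̄_E)^{H_{E,∞}}/(g − 1))[p^∞]` given the inflation cocycles** — the EQUALITY form of the tree's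
`finite_localTowerKerPrimary_and_card_le` / `MultTowerNS2.finite_torsionBy_localTowerKerPrimary_and_card_le` at ANY layer `n`,
for a `g ∈ H_{E,n}` generating `H_{E,n}` topologically together with `H_{E,∞}`, whenever every relation `p^k • x = g • y − y`
between `H_{E,∞}`-fixed points is realised by a continuous cocycle on `H_{E,n}` vanishing on `H_{E,∞}` with value `x` at `g`,
and the right side is finite. (`𝒦_{E,n} = ker(res : H¹(H_{E,n}, E(K̄_E)) → H¹(H_{E,∞}, ·))` transported to the tree's
subgroup-kernel as in `Rank1Residual.Additive.natCard_localTowerKerPrimary_zero_eq`, then §1.)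
[cite: GreenbergLNM1716, §3 Lemma 3.1 (p. 86) and Lemma 3.4 (p. 89)] -/
theorem natCard_localTowerKerPrimary_eq_of_cocycles (n : ℕ) {g : Field.absoluteGaloisGroup E}
    (hg : g ∈ localSubgroup (κ.layerSubgroup n) E)
    (hgen : ∀ U : Subgroup (Field.absoluteGaloisGroup E),
      IsOpen (U : Set (Field.absoluteGaloisGroup E)) → localSubgroup κ.kerSubgroup E ≤ U →
        g ∈ U → localSubgroup (κ.layerSubgroup n) E ≤ U)
    (hinf : ∀ (x y : localPoints W E), (∀ τ ∈ localSubgroup κ.kerSubgroup E, τ • x = x) →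
      (∀ τ ∈ localSubgroup κ.kerSubgroup E, τ • y = y) → ∀ k : ℕ, p ^ k • x = g • y - y →
      ∃ ψ : contOneCocycles (discreteTopRep (localSubgroup (κ.layerSubgroup n) E) (localPoints W E)),
        (∀ (τ : Field.absoluteGaloisGroup E) (hτ : τ ∈ localSubgroup κ.kerSubgroup E),
          ψ.1 ⟨τ, WeierstrassCurve.localSubgroup_ker_le_layer κ E n hτ⟩ = 0) ∧
        ψ.1 ⟨g, hg⟩ = x)
    [Finite (AddCommGroup.primaryComponent
      (FixedPoints.addSubgroup (localSubgroup κ.kerSubgroup E) (localPoints W E) ⧸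
        (subOne (localSubgroup κ.kerSubgroup E) (localPoints W E) g).range) p)] :
    Nat.card (W.localTowerKerPrimary κ E n) =
      Nat.card (AddCommGroup.primaryComponent
        (FixedPoints.addSubgroup (localSubgroup κ.kerSubgroup E) (localPoints W E) ⧸
          (subOne (localSubgroup κ.kerSubgroup E) (localPoints W E) g).range) p) := by
  -- notation (as in the tree's `finite_localTowerKerPrimary_and_card_le`)
  let P : Type u := localPoints W E
  let Hn : Subgroup (Field.absoluteGaloisGroup E) := localSubgroup (κ.layerSubgroup n) E
  let Hi : Subgroup (Field.absoluteGaloisGroup E) := localSubgroup κ.kerSubgroup E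
  let N : Subgroup Hn := Hi.subgroupOf Hn
  let γ : Hn := ⟨g, hg⟩
  have hle : Hi ≤ Hn := WeierstrassCurve.localSubgroup_ker_le_layer κ E n
  -- (1) generation inside `H_{E,n}`
  have hgen' : ∀ U : Subgroup Hn, IsOpen (U : Set Hn) → N ≤ U → γ ∈ U → U = ⊤ := by
    intro U hU hNU hγU
    let U' : Subgroup (Field.absoluteGaloisGroup E) := U.map Hn.subtype
    have hopen : IsOpen (U' : Set (Field.absoluteGaloisGroup E)) :=
      (isOpen_localSubgroup_layerSubgroup E κ n).isOpenMap_subtype_val _ hU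
    have hN' : Hi ≤ U' := fun τ hτ ↦
      ⟨⟨τ, hle hτ⟩, hNU (Subgroup.mem_subgroupOf.mpr hτ), rfl⟩
    have hγU' : g ∈ U' := ⟨γ, hγU, rfl⟩
    have hle' := hgen U' hopen hN' hγU'
    rw [eq_top_iff]
    intro x _
    obtain ⟨u, hu, hux⟩ := hle' x.2
    have : u = x := Subtype.ext hux
    exact this ▸ hu
  -- (2) orbit maps on `H_{E,n}`
  have hcont : ∀ m : P, Continuous fun x : Hn ↦ x • m := fun m ↦
    (continuous_smul_localPoints W E m).comp continuous_subtype_val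
  -- (3) `P^N = P^{H_{E,∞}}`, compatibly with `g − 1` and `p`-power torsion
  have hfix : FixedPoints.addSubgroup N P = FixedPoints.addSubgroup Hi P := by
    ext m
    simp only [FixedPoints.mem_addSubgroup]
    constructor
    · intro h τ
      exact h ⟨⟨τ, hle τ.2⟩, Subgroup.mem_subgroupOf.mpr τ.2⟩
    · intro h x
      exact h ⟨((x : Hn) : Field.absoluteGaloisGroup E), Subgroup.mem_subgroupOf.mp x.2⟩
  let e : FixedPoints.addSubgroup N P ≃+ FixedPoints.addSubgroup Hi P :=
    AddEquiv.addSubgroupCongr hfix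
  have he : AddSubgroup.map (e : FixedPoints.addSubgroup N P →+ FixedPoints.addSubgroup Hi P)
      (subOne N P γ).range = (subOne Hi P g).range := by
    ext b
    constructor
    · rintro ⟨x, ⟨y, rfl⟩, rfl⟩
      exact ⟨e y, Subtype.ext rfl⟩
    · rintro ⟨y, rfl⟩
      exact ⟨subOne N P γ (e.symm y), ⟨e.symm y, rfl⟩, Subtype.ext rfl⟩
  let eq : FixedPoints.addSubgroup N P ⧸ (subOne N P γ).range ≃+
      FixedPoints.addSubgroup Hi P ⧸ (subOne Hi P g).range :=
    QuotientAddGroup.congr _ _ e he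
  let ep : AddCommGroup.primaryComponent (FixedPoints.addSubgroup N P ⧸ (subOne N P γ).range) p ≃
      AddCommGroup.primaryComponent (FixedPoints.addSubgroup Hi P ⧸ (subOne Hi P g).range) p :=
    eq.toEquiv.subtypeEquiv fun a ↦ by
      simp only [AddCommGroup.mem_primaryComponent, AddEquiv.toEquiv_eq_coe, EquivLike.coe_coe]
      constructor
      · rintro ⟨k, hk⟩
        exact ⟨k, by rw [← map_nsmul, hk, map_zero]⟩
      · rintro ⟨k, hk⟩
        refine ⟨k, eq.injective ?_⟩
        rw [map_nsmul, hk, map_zero]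
  haveI : Finite (AddCommGroup.primaryComponent
      (FixedPoints.addSubgroup N P ⧸ (subOne N P γ).range) p) := Finite.of_equiv _ ep.symm
  have hcardp : Nat.card (AddCommGroup.primaryComponent
      (FixedPoints.addSubgroup N P ⧸ (subOne N P γ).range) p) =
      Nat.card (AddCommGroup.primaryComponent
        (FixedPoints.addSubgroup Hi P ⧸ (subOne Hi P g).range) p) :=
    Nat.card_congr ep
  -- (hinf) transported to `N`
  have hinfN : ∀ (x y : FixedPoints.addSubgroup N P) (k : ℕ), p ^ k • x = subOne N P γ y →
      ∃ ψ : contOneCocycles (discreteTopRep Hn P), (∀ n ∈ N, ψ.1 n = 0) ∧ ψ.1 γ = x := by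
    intro x y k hk
    have hxfix : ∀ τ ∈ Hi, τ • (x : P) = x := fun τ hτ ↦ (e x).2 ⟨τ, hτ⟩
    have hyfix : ∀ τ ∈ Hi, τ • (y : P) = y := fun τ hτ ↦ (e y).2 ⟨τ, hτ⟩
    have hk' : p ^ k • (x : P) = g • (y : P) - y := by
      have := congrArg (fun z : FixedPoints.addSubgroup N P ↦ (z : P)) hk
      simp only [AddSubgroupClass.coe_nsmul, coe_subOne_apply] at this
      exact this
    obtain ⟨ψ, hψN, hψg⟩ := hinf (x : P) (y : P) hxfix hyfix k hk'
    refine ⟨ψ, fun ν hν ↦ ?_, hψg⟩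
    have h := hψN ((ν : Hn) : Field.absoluteGaloisGroup E) (Subgroup.mem_subgroupOf.mp hν)
    have en : (⟨((ν : Hn) : Field.absoluteGaloisGroup E),
        WeierstrassCurve.localSubgroup_ker_le_layer κ E n (Subgroup.mem_subgroupOf.mp hν)⟩ : Hn) = ν :=
      Subtype.ext rfl
    rwa [en] at h
  -- (4) the generic count on `H_{E,n}`
  have hcount := natCard_primary_subgroupResKer_eq_of_cocycles N P γ hgen' hcont p hinfN
  -- (5) `𝒦_{E,n} = ker (res : H¹(H_{E,n}, P) → H¹(N, P))`
  let j : N →ₜ* Hi :=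
    { toFun := fun x ↦ ⟨((x : Hn) : Field.absoluteGaloisGroup E), Subgroup.mem_subgroupOf.mp x.2⟩
      map_one' := rfl
      map_mul' := fun _ _ ↦ rfl
      continuous_toFun :=
        (continuous_subtype_val.comp continuous_subtype_val).subtype_mk _ }
  have hcomp : (resH1Hom j (AddMonoidHom.id P) (fun _ _ ↦ rfl)).comp
      (Literature.NumberTheory.EllipticCurves.resOfLe P hle) = resSubgroup N P := by
    unfold Literature.NumberTheory.EllipticCurves.resOfLe ResKernel.resSubgroup
    rw [resH1Hom_comp]
    exact resH1Hom_congr (ContinuousMonoidHom.ext fun _ ↦ rfl) (AddMonoidHom.ext fun _ ↦ rfl) _ _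
  have hker : W.localTowerKer κ E n = subgroupResKer P N := by
    apply le_antisymm
    · intro c hc
      rw [mem_subgroupResKer_iff, ← hcomp, AddMonoidHom.comp_apply,
        (W.mem_localTowerKer_iff κ E n c).mp hc, map_zero]
    · intro c hc
      obtain ⟨φ, rfl, hφN⟩ := exists_cocycle_of_res_eq_zero N P hcont c hc
      rw [W.mem_localTowerKer_iff κ E n]
      change Literature.NumberTheory.EllipticCurves.resOfLe P hle (oneCocycleClass _ φ) = 0
      have h0 : oneCocycleClass _ (contOneCocycles.pullback (subgroupInclusion hle)
          (resHomOfEquivariant (subgroupInclusion hle) (AddMonoidHom.id P) (fun _ _ ↦ rfl)) φ) = 0 := by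
        rw [oneCocycleClass_eq_zero_iff]
        refine ⟨0, fun τ ↦ ?_⟩
        rw [map_zero, sub_zero, contOneCocycles.pullback_apply]
        exact hφN ⟨(τ : Field.absoluteGaloisGroup E), hle τ.2⟩ (Subgroup.mem_subgroupOf.mpr τ.2)
      rw [← map_oneCocycleClass] at h0
      exact h0
  -- (6) `𝒦_{E,n}[p^∞] ≃ {x ∈ ker res | p-power torsion}`
  let f : W.localTowerKerPrimary κ E n ≃ {x : subgroupResKer P N // ∃ k : ℕ, p ^ k • x = 0} :=
    { toFun := fun c ↦ ⟨⟨(c : discreteH1 Hn P), hker.le ((W.mem_localTowerKerPrimary_iff κ E n _).mp c.2).1⟩, by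
        obtain ⟨k, hk⟩ := ((W.mem_localTowerKerPrimary_iff κ E n _).mp c.2).2
        exact ⟨k, Subtype.ext hk⟩⟩
      invFun := fun x ↦ ⟨((x.1 : subgroupResKer P N) : discreteH1 Hn P),
        (W.mem_localTowerKerPrimary_iff κ E n _).mpr ⟨hker.symm.le x.1.2, by
          obtain ⟨k, hk⟩ := x.2
          exact ⟨k, by
            have := congrArg (fun z : subgroupResKer P N ↦ (z : discreteH1 Hn P)) hk
            simpa only [AddSubgroupClass.coe_nsmul, ZeroMemClass.coe_zero] using this⟩⟩⟩
      left_inv := fun c ↦ Subtype.ext rfl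
      right_inv := fun x ↦ Subtype.ext (Subtype.ext rfl) }
  rw [Nat.card_congr f, hcount, hcardp]

end Local

/-! ## §3 At a place of `ℚ` above `p`, cyclotomic tower: the inflated cocycles exist (GEN 20 BRICK B′ with `A₁ = E(K̄_v)`) -/

variable {p : ℕ} [hp : Fact p.Prime] {κ : ZpExtension ℚ p}

/-- **Greenberg's `ker(r_{v_n}) ≅ H¹` EXACTLY at `v ∣ p`: `#𝒦_{v,n}[p^∞] = #(E(K̄_v)^{H_∞}/(g − 1))[p^∞]`** for EVERY
`W/ℚ`, the cyclotomic `ℤ_p`-extension `κ`, a place `v ∋ p`, any layer `n` and any `g ∈ H_n` generating `H_n` topologically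
together with `H_∞`, whenever the right side is finite. The cocycles of §2 are this lineage's
`exists_contOneCocycles_inflate_pow_of_fixed` for the `Γ`-stable subgroup `A₁ = ⊤`: its finite-level hypothesis holds because
the `H_∞`-fixed `p^k`-torsion points form a finite set (`E[p^k]` is finite, `finite_torsionBy_of_isAlgClosed`), each fixed by
some layer group (`exists_forall_mem_localSubgroup_layerSubgroup_smul_point_eq`), and the layer groups decrease.
[cite: GreenbergLNM1716, §3 Lemma 3.1 (p. 86) and Lemma 3.4 (p. 89)] [cite: SerreLocalFields1979, XIII §1 Prop. 1] -/
theorem natCard_localTowerKerPrimary_eq_coinv_atP (hκ : κ.IsCyclotomic) (v : HeightOneSpectrum (𝓞 ℚ))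
    (hv : ((p : ℕ) : 𝓞 ℚ) ∈ v.asIdeal) (W : WeierstrassCurve ℚ) [W.IsElliptic] (n : ℕ)
    {g : absoluteGaloisGroup (v.adicCompletion ℚ)}
    (hg : g ∈ localSubgroup (κ.layerSubgroup n) (v.adicCompletion ℚ))
    (hgen : ∀ U : Subgroup (absoluteGaloisGroup (v.adicCompletion ℚ)),
      IsOpen (U : Set (absoluteGaloisGroup (v.adicCompletion ℚ))) →
        localSubgroup κ.kerSubgroup (v.adicCompletion ℚ) ≤ U → g ∈ U →
          localSubgroup (κ.layerSubgroup n) (v.adicCompletion ℚ) ≤ U)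
    [Finite (AddCommGroup.primaryComponent
      (FixedPoints.addSubgroup (localSubgroup κ.kerSubgroup (v.adicCompletion ℚ)) (localPoints W (v.adicCompletion ℚ)) ⧸
        (subOne (localSubgroup κ.kerSubgroup (v.adicCompletion ℚ)) (localPoints W (v.adicCompletion ℚ)) g).range) p)] :
    Nat.card (W.localTowerKerPrimary κ (v.adicCompletion ℚ) n) =
      Nat.card (AddCommGroup.primaryComponent
        (FixedPoints.addSubgroup (localSubgroup κ.kerSubgroup (v.adicCompletion ℚ)) (localPoints W (v.adicCompletion ℚ)) ⧸
          (subOne (localSubgroup κ.kerSubgroup (v.adicCompletion ℚ)) (localPoints W (v.adicCompletion ℚ)) g).range) p) := by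
  -- notation
  let K := v.adicCompletion ℚ
  let P : Type := localPoints W K
  let Hi : Subgroup (absoluteGaloisGroup K) := localSubgroup κ.kerSubgroup K
  refine natCard_localTowerKerPrimary_eq_of_cocycles W κ K n hg hgen fun x y hx hy k hrel ↦ ?_
  -- a finite level `m₀` fixing every `H_∞`-fixed `p^k`-torsion point
  haveI : (W.baseChange (AlgebraicClosure K)).IsElliptic := by
    rw [baseChange]; infer_instance
  haveI hfinT : Finite (AddSubgroup.torsionBy P ((p ^ k : ℕ) : ℤ)) :=
    WeierstrassCurve.finite_torsionBy_of_isAlgClosed (V := W.baseChange (AlgebraicClosure K))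
      (n := ((p ^ k : ℕ) : ℤ)) (by exact_mod_cast pow_ne_zero k hp.out.ne_zero)
  have hlev : ∀ z : AddSubgroup.torsionBy P ((p ^ k : ℕ) : ℤ), (∀ h ∈ Hi, h • (z : P) = z) →
      ∃ m : ℕ, ∀ h ∈ localSubgroup (κ.layerSubgroup m) K, h • (z : P) = z := fun z hz ↦
    exists_forall_mem_localSubgroup_layerSubgroup_smul_point_eq (κ := κ) v W (z : P) hz
  letI : Fintype (AddSubgroup.torsionBy P ((p ^ k : ℕ) : ℤ)) := Fintype.ofFinite _
  let mfun : AddSubgroup.torsionBy P ((p ^ k : ℕ) : ℤ) → ℕ := fun z ↦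
    if hz : (∀ h ∈ Hi, h • (z : P) = z) then (hlev z hz).choose else 0
  let m₀ : ℕ := Finset.univ.sup mfun
  have hZ : ∀ a ∈ (⊤ : AddSubgroup P), p ^ k • a = 0 → (∀ h ∈ Hi, h • a = a) →
      ∀ h ∈ localSubgroup (κ.layerSubgroup m₀) K, h • a = a := by
    intro a _ hak hai h hh
    have haZ : a ∈ AddSubgroup.torsionBy P ((p ^ k : ℕ) : ℤ) :=
      AddSubgroup.torsionBy.nsmul_iff.mpr hak
    have hspec := (hlev ⟨a, haZ⟩ hai).choose_spec
    have hle : mfun ⟨a, haZ⟩ ≤ m₀ := Finset.le_sup (f := mfun) (Finset.mem_univ _)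
    have hm : mfun ⟨a, haZ⟩ = (hlev ⟨a, haZ⟩ hai).choose := dif_pos hai
    rw [hm] at hle
    exact hspec h (MultTowerSP1.localSubgroup_layerSubgroup_antitone κ K hle hh)
  obtain ⟨c, hcN, hcg, -, -⟩ := exists_contOneCocycles_inflate_pow_of_fixed hκ v hv W n k m₀ hg hgen ⊤
    (fun _ _ _ ↦ AddSubgroup.mem_top _) hZ (AddSubgroup.mem_top x) hx hy hrel
  exact ⟨c, fun τ hτ ↦ hcN ⟨τ, _⟩ hτ, hcg⟩

end Literature.NumberTheory.EllipticCurves.Greenberg1999.GoodOrdTower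

end Part8

/-!
## Part 9 — port of `Summits/BirchSwinnertonDyer/BirchSwinnertonDyer/Theorems/ByReductionTypeAtTwoMultTowerSplitExactLower.lean`

# Route `ByReductionTypeAtTwo`, crux `MultUpperHalfAtTwo` (item stmt-BirchSwinnertonDyer-19922), TOWER road, SPLIT rows:
# the EXACT order of the local tower kernel at a split multiplicative prime, part 1 (any prime `p`) — a relative norm
# `N_{F_{n+w}/F_n}(x) = q_E` produces a coinvariant class of order EXACTLY `p^w`, hence `p^w ≤ #𝒦_{v,n}[p^∞]`

HONEST FRAMING (cell `bsd-2adic`, run/shared/lean/pub/bsd-2adic/, seat `bsd-2adic-tower-1` GEN 27, HUMAN RULINGS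
D-0036 / D-0054 / D-0074): TOOL theorems only (no definition, no named fact, no `sorry`); closes nothing by itself;
nothing booked; BSD is not proved by any of this. First module of the LOWER half of the PRINT binder
`hSP = Greenberg1999.sec3_natCard_localTowerKerPrimary_splitMultiplicative_rat` (Greenberg, LNM 1716, §3 pp. 92–93: at a
SPLIT multiplicative `v ∣ p`, `|ker(r_{v_n})| ∼ log_p(N q_E)/2p[…]`, i.e. over `ℚ`: `#𝒦_{v,n}[p^∞] = p^e`,
`e + ord_p(2p) = ord_p(log_p q_E)`). Seat bsd-2adic-mult GEN 13 proved the UPPER half at `p = 2`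
(`MultTowerSplitOrder.finite_and_natCard_localTowerKerPrimary_le_pow_splitTwo`); the EQUALITY needs classes that
SURVIVE, and this file supplies them from a relative norm (the existence of the norm — local class field theory for the
cyclic layer `F_{n+w}/F_n` and the norm group of `F_m/ℚ_p` — is parts 2–3).

Setting (any prime `p`): `κ` the cyclotomic `ℤ_p`-extension, `v ∋ p`, `K = ℚ_v`, `H_m`/`H_∞` the local layer subgroups,
`Φ : K̄ˣ ↠ E(K̄)` the split Tate uniformisation with kernel `Q^ℤ` (`Q = q_E ∈ K`, `Γ`-fixed, no power equal to `1`) and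
`σ • Φ(u) = Φ(σu)`, `M_∞ = E(K̄)^{H_∞}`, `g ∈ H_n` with `κ(res g) = p^n u_g` (`u_g` a unit), `N_R(x) = ∏_{i<p^R} g^i x`.

* `pow_smul_sub_mem_range_subOne`, `sum_pow_smul_sub_nsmul_mem_range_subOne` — in `M^N`:
  `g^i m − m ∈ (g−1)M^N` and `∑_{i<k} g^i m − k·m ∈ (g−1)M^N` (the group-ring identity `∑_{i<k} g^i ≡ k (mod g − 1)`);
* `nsmul_pow_mk_eq_zero_of_prod_smul_eq` — if `N_w(x) = Q` then the class `[Φ x]` of `M_∞/(g−1)M_∞` is killed by `p^w`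
  (`p^w·Φx ≡ Φ(N_w x) = Φ(Q) = 0`);
* `nsmul_pow_mk_ne_zero_of_prod_smul_eq` — … and NOT by `p^{w'}` for `w' < w`, when `x` is fixed by `H_{n+w}`:
  `x^{p^{w'}} = Q^j · gz/z` with `z ∈ K̄^{H_∞}` forces, after the orbit product `N_{R₀+w}` at a common finite level,
  `p^{R₀ + w'} = j·p^{R₀ + w}` — impossible;
* `addOrderOf_mk_eq_pow_of_prod_smul_eq` — so the class has additive order exactly `p^w`;
* `pow_le_natCard_primaryComponent_coinvariants_of_prod_smul_eq` — **`p^w ≤ #(M_∞/(g−1)M_∞)[p^∞]`** (the cyclic subgroup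
  it generates), and `pow_le_natCard_localTowerKerPrimary_of_prod_smul_eq` — **`p^w ≤ #𝒦_{v,n}[p^∞]`** through the EXACT
  local inflation–restriction count `GoodOrdTower.natCard_localTowerKerPrimary_eq_coinv_atP` (any `W`, any `p`).

References: R. Greenberg, LNM 1716 (1999), §3 pp. 85–93 (between Prop. 3.6 and 3.7); J. Silverman, GTM 151, V.3–V.5;
J. Neukirch, *ANT* IV (3.5); cell memos NOTE-SP1ONE.md §5, NOTE-HNS2-KERNEL-GEN27.md.
-/

section Part9

set_option autoImplicit false

open scoped _root_.Classical

universe u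

namespace Literature.NumberTheory.EllipticCurves.Greenberg1999.MultTowerSplitExact

open _root_.NumberField _root_.IsDedekindDomain _root_.Field _root_.WeierstrassCurve _root_.PadicInt _root_.Rat.HeightOneSpectrum
  Literature.NumberTheory.EllipticCurves Literature.NumberTheory.EllipticCurves.ResKernel
  Literature.NumberTheory.GaloisRepresentations
  Literature.NumberTheory.EllipticCurves.Greenberg1999.MultTowerNS2
  Literature.NumberTheory.EllipticCurves.Greenberg1999.MultTowerSplitOrder

/-! ### `∑_{i<k} g^i ≡ k (mod g − 1)` on the fixed-point module -/

section SubOne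

variable {G : Type u} [Group G] (N : Subgroup G) [N.Normal] {M : Type u} [AddCommGroup M] [DistribMulAction G M]

/-- `g^i m − m ∈ (g − 1)M^N` for `m ∈ M^N`. [folklore] -/
private theorem pow_smul_sub_mem_range_subOne (g : G) (m : FixedPoints.addSubgroup N M) (i : ℕ) :
    (⟨(g ^ i) • (m : M), smul_mem_fixedPoints_of_normal (g ^ i) m.2⟩ - m : FixedPoints.addSubgroup N M) ∈
      (subOne N M g).range := by
  induction i with
  | zero =>
    have h0 : (⟨(g ^ 0) • (m : M), smul_mem_fixedPoints_of_normal (g ^ 0) m.2⟩ : FixedPoints.addSubgroup N M) = m :=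
      Subtype.ext (by change (g ^ 0) • (m : M) = (m : M); rw [pow_zero, one_smul])
    rw [h0, sub_self]
    exact zero_mem _
  | succ i ih =>
    set mi : FixedPoints.addSubgroup N M := ⟨(g ^ i) • (m : M), smul_mem_fixedPoints_of_normal (g ^ i) m.2⟩ with hmi
    have hstep : (⟨(g ^ (i + 1)) • (m : M), smul_mem_fixedPoints_of_normal (g ^ (i + 1)) m.2⟩ :
        FixedPoints.addSubgroup N M) = subOne N M g mi + mi := by
      apply Subtype.ext
      change (g ^ (i + 1)) • (m : M) = (g • ((g ^ i) • (m : M)) - (g ^ i) • (m : M)) + (g ^ i) • (m : M)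
      rw [pow_succ', mul_smul, sub_add_cancel]
    rw [hstep, add_sub_assoc]
    exact add_mem ⟨mi, rfl⟩ ih

/-- `∑_{i<k} g^i m − k·m ∈ (g − 1)M^N` for `m ∈ M^N` — the group-ring identity `∑_{i<k} g^i ≡ k (mod g − 1)`.
[folklore] -/
private theorem sum_pow_smul_sub_nsmul_mem_range_subOne (g : G) (m : FixedPoints.addSubgroup N M) (k : ℕ) :
    ((∑ i ∈ Finset.range k,
        (⟨(g ^ i) • (m : M), smul_mem_fixedPoints_of_normal (g ^ i) m.2⟩ : FixedPoints.addSubgroup N M)) - k • m) ∈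
      (subOne N M g).range := by
  have h : ((∑ i ∈ Finset.range k,
      (⟨(g ^ i) • (m : M), smul_mem_fixedPoints_of_normal (g ^ i) m.2⟩ : FixedPoints.addSubgroup N M)) - k • m) =
      ∑ i ∈ Finset.range k,
        ((⟨(g ^ i) • (m : M), smul_mem_fixedPoints_of_normal (g ^ i) m.2⟩ : FixedPoints.addSubgroup N M) - m) := by
    rw [Finset.sum_sub_distrib, Finset.sum_const, Finset.card_range]
  rw [h]
  exact AddSubgroup.sum_mem _ fun i _ ↦ pow_smul_sub_mem_range_subOne N g m i

end SubOne

/-! ### The class of `Φ(x)` for `N_w(x) = Q`: order exactly `p^w` -/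

variable {p : ℕ} [hp : Fact p.Prime] {κ : ZpExtension ℚ p}

/-- **`p^w · [Φ x] = 0`** in `M_∞/(g−1)M_∞` when `N_w(x) = ∏_{i<p^w} g^i x = Q` (for a point `m₀ = Φ(x)` of `M_∞`):
`∑_{i<p^w} g^i Φ(x) = Φ(N_w x) = Φ(Q) = 0` and `∑ g^i ≡ p^w (mod g − 1)`.
[cite: GreenbergLNM1716, §3 (pp. 90–93)] [cite: SilvermanATAEC1994, Thm. V.3.1 (c)(d), Thm. V.5.3] -/
theorem nsmul_pow_mk_eq_zero_of_prod_smul_eq (v : HeightOneSpectrum (𝓞 ℚ)) {W : WeierstrassCurve ℚ}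
    {Φ : Additive (AlgebraicClosure (v.adicCompletion ℚ))ˣ →+ localPoints W (v.adicCompletion ℚ)}
    {Q : AlgebraicClosure (v.adicCompletion ℚ)}
    (hker : ∀ u : (AlgebraicClosure (v.adicCompletion ℚ))ˣ, Φ (Additive.ofMul u) = 0 ↔
      ∃ j : ℤ, (u : AlgebraicClosure (v.adicCompletion ℚ)) = Q ^ j)
    (hequiv : ∀ (σ : absoluteGaloisGroup (v.adicCompletion ℚ)) (u u' : (AlgebraicClosure (v.adicCompletion ℚ))ˣ),
      (u' : AlgebraicClosure (v.adicCompletion ℚ)) = σ • (u : AlgebraicClosure (v.adicCompletion ℚ)) →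
        σ • Φ (Additive.ofMul u) = Φ (Additive.ofMul u'))
    (g : absoluteGaloisGroup (v.adicCompletion ℚ)) (w : ℕ) {x : (AlgebraicClosure (v.adicCompletion ℚ))ˣ}
    (hNx : (∏ i ∈ Finset.range (p ^ w), (g ^ i) • (x : AlgebraicClosure (v.adicCompletion ℚ))) = Q)
    (m₀ : FixedPoints.addSubgroup (localSubgroup κ.kerSubgroup (v.adicCompletion ℚ)) (localPoints W (v.adicCompletion ℚ)))
    (hm₀ : (m₀ : localPoints W (v.adicCompletion ℚ)) = Φ (Additive.ofMul x)) :
    p ^ w • (QuotientAddGroup.mk m₀ :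
      FixedPoints.addSubgroup (localSubgroup κ.kerSubgroup (v.adicCompletion ℚ)) (localPoints W (v.adicCompletion ℚ)) ⧸
        (subOne (localSubgroup κ.kerSubgroup (v.adicCompletion ℚ)) (localPoints W (v.adicCompletion ℚ)) g).range) = 0 := by
  rw [← QuotientAddGroup.mk_nsmul, QuotientAddGroup.eq_zero_iff]
  -- `∑ g^i m₀ − p^w m₀ ∈ (g−1)M` and `∑ g^i m₀ = Φ(N_w x) = 0`
  have hsum := sum_pow_smul_sub_nsmul_mem_range_subOne (localSubgroup κ.kerSubgroup (v.adicCompletion ℚ)) g m₀ (p ^ w)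
  -- the units `g^i x`
  set u : ℕ → (AlgebraicClosure (v.adicCompletion ℚ))ˣ := fun i ↦
    Units.mk0 ((g ^ i) • (x : AlgebraicClosure (v.adicCompletion ℚ))) ((smul_ne_zero_iff_ne _).mpr x.ne_zero) with hu
  have hux : ∀ i, (g ^ i) • Φ (Additive.ofMul x) = Φ (Additive.ofMul (u i)) := fun i ↦
    hequiv (g ^ i) x (u i) (by rw [hu, Units.val_mk0])
  have hprod : Φ (Additive.ofMul (∏ i ∈ Finset.range (p ^ w), u i)) = 0 := by
    rw [hker]
    refine ⟨1, ?_⟩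
    rw [zpow_one, Units.coe_prod, ← hNx]
    exact Finset.prod_congr rfl fun i _ ↦ by rw [hu, Units.val_mk0]
  have hzero : (∑ i ∈ Finset.range (p ^ w),
      (⟨(g ^ i) • (m₀ : localPoints W (v.adicCompletion ℚ)), smul_mem_fixedPoints_of_normal (g ^ i) m₀.2⟩ :
        FixedPoints.addSubgroup (localSubgroup κ.kerSubgroup (v.adicCompletion ℚ)) (localPoints W (v.adicCompletion ℚ)))) =
      0 := by
    apply Subtype.ext
    rw [AddSubmonoidClass.coe_finsetSum, ZeroMemClass.coe_zero]
    change (∑ i ∈ Finset.range (p ^ w), (g ^ i) • (m₀ : localPoints W (v.adicCompletion ℚ))) = 0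
    rw [hm₀, Finset.sum_congr rfl fun i _ ↦ hux i, ← map_sum, ← ofMul_prod, hprod]
  rw [hzero, zero_sub, neg_mem_iff] at hsum
  exact hsum

/-- **`p^{w'} · [Φ x] ≠ 0` for `w' < w`** in `M_∞/(g−1)M_∞`, when `x ∈ K̄ˣ` is fixed by `H_{n+w}`, `N_w(x) = Q`, and
`g` generates `H_n` modulo `H_∞` (`κ(res g) = p^n u_g`): otherwise `x^{p^{w'}} = Q^j · gz/z` with `z` fixed by `H_∞`,
hence by a finite `H_{R₀}`; the orbit product `N_{R₀+w}` gives `Q^{p^{R₀+w'}} = Q^{j p^{R₀+w}}`, i.e.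
`p^{R₀+w'} = j·p^{R₀+w}`, impossible for `w' < w`. [cite: GreenbergLNM1716, §3 (pp. 90–93)]
[cite: SilvermanATAEC1994, Thm. V.3.1 (c)(d), Thm. V.5.3] -/
theorem nsmul_pow_mk_ne_zero_of_prod_smul_eq (v : HeightOneSpectrum (𝓞 ℚ)) {W : WeierstrassCurve ℚ}
    {Φ : Additive (AlgebraicClosure (v.adicCompletion ℚ))ˣ →+ localPoints W (v.adicCompletion ℚ)}
    {Q : AlgebraicClosure (v.adicCompletion ℚ)} (hsurj : Function.Surjective Φ)
    (hker : ∀ u : (AlgebraicClosure (v.adicCompletion ℚ))ˣ, Φ (Additive.ofMul u) = 0 ↔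
      ∃ j : ℤ, (u : AlgebraicClosure (v.adicCompletion ℚ)) = Q ^ j)
    (hequiv : ∀ (σ : absoluteGaloisGroup (v.adicCompletion ℚ)) (u u' : (AlgebraicClosure (v.adicCompletion ℚ))ˣ),
      (u' : AlgebraicClosure (v.adicCompletion ℚ)) = σ • (u : AlgebraicClosure (v.adicCompletion ℚ)) →
        σ • Φ (Additive.ofMul u) = Φ (Additive.ofMul u'))
    (hQfix : ∀ σ : absoluteGaloisGroup (v.adicCompletion ℚ), σ • Q = Q) (hQ0 : Q ≠ 0)
    (hQtor : ∀ j : ℤ, Q ^ j = 1 → j = 0)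
    (n : ℕ) {g : absoluteGaloisGroup (v.adicCompletion ℚ)} {ug : ℤ_[p]ˣ}
    (hug : ((κ (resGal (K := ℚ) (v.adicCompletion ℚ) g)).toAdd : ℤ_[p]) = (p : ℤ_[p]) ^ n * (ug : ℤ_[p]))
    (w : ℕ) {x : (AlgebraicClosure (v.adicCompletion ℚ))ˣ}
    (hxw : ∀ h ∈ localSubgroup (κ.layerSubgroup (n + w)) (v.adicCompletion ℚ),
      h • (x : AlgebraicClosure (v.adicCompletion ℚ)) = x)
    (hNx : (∏ i ∈ Finset.range (p ^ w), (g ^ i) • (x : AlgebraicClosure (v.adicCompletion ℚ))) = Q)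
    (m₀ : FixedPoints.addSubgroup (localSubgroup κ.kerSubgroup (v.adicCompletion ℚ)) (localPoints W (v.adicCompletion ℚ)))
    (hm₀ : (m₀ : localPoints W (v.adicCompletion ℚ)) = Φ (Additive.ofMul x)) {w' : ℕ} (hw' : w' < w) :
    p ^ w' • (QuotientAddGroup.mk m₀ :
      FixedPoints.addSubgroup (localSubgroup κ.kerSubgroup (v.adicCompletion ℚ)) (localPoints W (v.adicCompletion ℚ)) ⧸
        (subOne (localSubgroup κ.kerSubgroup (v.adicCompletion ℚ)) (localPoints W (v.adicCompletion ℚ)) g).range) ≠ 0 := by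
  have hanti : ∀ {m m' : ℕ}, m ≤ m' → localSubgroup (κ.layerSubgroup m') (v.adicCompletion ℚ) ≤
      localSubgroup (κ.layerSubgroup m) (v.adicCompletion ℚ) := fun h ↦ Subgroup.comap_mono (κ.layerSubgroup_antitone h)
  intro hzero
  rw [← QuotientAddGroup.mk_nsmul, QuotientAddGroup.eq_zero_iff] at hzero
  obtain ⟨m', hm'⟩ := hzero
  -- `m' = Φ z`, `z` fixed by `H_∞`
  obtain ⟨z, hzm, hzL⟩ := exists_unit_of_mem_fixedPoints_split (κ := κ) v hsurj hker hequiv hQfix hQ0 hQtor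
    (m := (m' : localPoints W (v.adicCompletion ℚ))) (fun h hh ↦ m'.2 ⟨h, hh⟩)
  -- `Φ (x^{p^w'}) = Φ (gz/z)`, so `x^{p^w'} = Q^j · gz/z`
  set gz : (AlgebraicClosure (v.adicCompletion ℚ))ˣ :=
    Units.mk0 (g • (z : AlgebraicClosure (v.adicCompletion ℚ))) ((smul_ne_zero_iff_ne g).mpr z.ne_zero) with hgz
  have hgΦ : g • Φ (Additive.ofMul z) = Φ (Additive.ofMul gz) := hequiv g z gz (by rw [hgz, Units.val_mk0])
  have h3 : Φ (Additive.ofMul (x ^ p ^ w')) = Φ (Additive.ofMul (gz * z⁻¹)) := by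
    rw [ofMul_pow, map_nsmul, ofMul_mul, ofMul_inv, map_add, map_neg, ← hgΦ, hzm, ← sub_eq_add_neg, ← hm₀]
    have h4 := congrArg (fun b : FixedPoints.addSubgroup (localSubgroup κ.kerSubgroup (v.adicCompletion ℚ))
      (localPoints W (v.adicCompletion ℚ)) ↦ (b : localPoints W (v.adicCompletion ℚ))) hm'
    simp only [coe_subOne_apply, AddSubgroupClass.coe_nsmul] at h4
    exact h4.symm
  rw [tatePsi_eq_iff v hker] at h3
  obtain ⟨j, hj⟩ := h3
  rw [Units.val_pow_eq_pow_val, Units.val_mul, Units.val_inv_eq_inv_val, hgz, Units.val_mk0, ← div_eq_mul_inv] at hj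
  -- a finite level `R₀` fixing `z`; `R := R₀ + w`
  obtain ⟨R₀, hR₀⟩ := MultTowerSP1.exists_forall_mem_localSubgroup_layerSubgroup_smul_eq (κ := κ) v
    (z : AlgebraicClosure (v.adicCompletion ℚ)) hzL
  have hzR : ∀ h ∈ localSubgroup (κ.layerSubgroup (n + (R₀ + w))) (v.adicCompletion ℚ),
      h • (z : AlgebraicClosure (v.adicCompletion ℚ)) = z :=
    fun h hh ↦ hR₀ h (hanti (m := R₀) (m' := n + (R₀ + w)) (by omega) hh)
  have hgR : g ^ p ^ (R₀ + w) ∈ localSubgroup (κ.layerSubgroup (n + (R₀ + w))) (v.adicCompletion ℚ) :=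
    (MultTowerSP1.pow_mem_localSubgroup_layerSubgroup_iff (κ := κ) v n (R₀ + w) hug _).mpr dvd_rfl
  have hgw : g ^ p ^ w ∈ localSubgroup (κ.layerSubgroup (n + w)) (v.adicCompletion ℚ) :=
    (MultTowerSP1.pow_mem_localSubgroup_layerSubgroup_iff (κ := κ) v n w hug _).mpr dvd_rfl
  have hgRz : (g ^ p ^ (R₀ + w)) • (z : AlgebraicClosure (v.adicCompletion ℚ)) = z := hzR _ hgR
  have hgwx : (g ^ p ^ w) • (x : AlgebraicClosure (v.adicCompletion ℚ)) = x := hxw _ hgw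
  -- orbit products `N_{R₀+w}`
  have hNz : (∏ i ∈ Finset.range (p ^ (R₀ + w)), (g ^ i) • (g • (z : AlgebraicClosure (v.adicCompletion ℚ)) / z)) = 1 := by
    rw [Finset.prod_congr rfl fun i _ ↦ show (g ^ i) • (g • (z : AlgebraicClosure (v.adicCompletion ℚ)) / z) = (g ^ i) • (g • (z : AlgebraicClosure (v.adicCompletion ℚ))) * (g ^ i) • (z : AlgebraicClosure (v.adicCompletion ℚ))⁻¹
        by rw [div_eq_mul_inv, smul_mul'], Finset.prod_mul_distrib, prod_smul_smul_eq g (p ^ (R₀ + w)) hgRz, prod_smul_inv,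
      mul_inv_cancel₀]
    exact Finset.prod_ne_zero_iff.mpr fun i _ ↦ (smul_ne_zero_iff_ne _).mpr z.ne_zero
  have hNx' : (∏ i ∈ Finset.range (p ^ (R₀ + w)), (g ^ i) • (x : AlgebraicClosure (v.adicCompletion ℚ))) = Q ^ p ^ R₀ := by
    rw [pow_add, mul_comm, MultTowerSP1.prod_smul_range_mul_eq_pow g (p ^ w) hgwx (p ^ R₀), hNx]
  have hQi : ∀ i : ℕ, (g ^ i) • Q = Q := fun i ↦ by
    induction i with
    | zero => rw [pow_zero, one_smul]
    | succ i ih => rw [pow_succ, mul_smul, hQfix, ih]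
  have hL : (∏ i ∈ Finset.range (p ^ (R₀ + w)), (g ^ i) • ((x : AlgebraicClosure (v.adicCompletion ℚ)) ^ p ^ w')) = Q ^ (p ^ R₀ * p ^ w') := by
    rw [MultTowerSP1.prod_smul_pow, hNx', ← pow_mul]
  have hRHS : (∏ i ∈ Finset.range (p ^ (R₀ + w)), (g ^ i) • (Q ^ j * (g • (z : AlgebraicClosure (v.adicCompletion ℚ)) / z))) = (Q ^ j) ^ p ^ (R₀ + w) := by
    rw [Finset.prod_congr rfl fun i _ ↦
        show (g ^ i) • (Q ^ j * (g • (z : AlgebraicClosure (v.adicCompletion ℚ)) / z)) = Q ^ j * (g ^ i) • (g • (z : AlgebraicClosure (v.adicCompletion ℚ)) / z) by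
          rw [smul_mul', smul_zpow₀', hQi],
      Finset.prod_mul_distrib, hNz, mul_one, Finset.prod_const, Finset.card_range]
  have key : Q ^ (p ^ R₀ * p ^ w') = (Q ^ j) ^ p ^ (R₀ + w) := by
    rw [← hL, ← hRHS]
    exact Finset.prod_congr rfl fun i _ ↦ by rw [hj]
  rw [← zpow_natCast, ← zpow_natCast, ← zpow_mul] at key
  -- compare exponents
  have hinj : ∀ a b : ℤ, Q ^ a = Q ^ b → a = b := fun a b hab ↦ by
    have h1 : Q ^ (a - b) = 1 := by rw [zpow_sub₀ hQ0, hab, div_self (zpow_ne_zero _ hQ0)]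
    have := hQtor _ h1
    omega
  have hexp := hinj _ _ key
  push_cast at hexp
  -- `p^{R₀} p^{w'} = j p^{R₀ + w}` with `w' < w`: impossible
  have hp0 : (0 : ℤ) < p := by exact_mod_cast hp.out.pos
  have hlt : (p : ℤ) ^ R₀ * (p : ℤ) ^ w' < (p : ℤ) ^ R₀ * (p : ℤ) ^ w := by
    have hp1 : (1 : ℤ) < p := by exact_mod_cast hp.out.one_lt
    exact mul_lt_mul_of_pos_left (pow_lt_pow_right₀ hp1 hw') (pow_pos hp0 _)
  have hpos : (0 : ℤ) < (p : ℤ) ^ R₀ * (p : ℤ) ^ w' := by positivity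
  have hdvd : ((p : ℤ) ^ R₀ * (p : ℤ) ^ w) ∣ (p : ℤ) ^ R₀ * (p : ℤ) ^ w' := by
    refine ⟨j, ?_⟩
    rw [hexp, pow_add]
    ring
  exact absurd (Int.le_of_dvd hpos hdvd) (not_le.mpr hlt)

/-- **The class `[Φ x]` has additive order exactly `p^w`** (`x` fixed by `H_{n+w}`, `N_w(x) = Q`).
[cite: GreenbergLNM1716, §3 (pp. 90–93)] -/
theorem addOrderOf_mk_eq_pow_of_prod_smul_eq (v : HeightOneSpectrum (𝓞 ℚ)) {W : WeierstrassCurve ℚ}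
    {Φ : Additive (AlgebraicClosure (v.adicCompletion ℚ))ˣ →+ localPoints W (v.adicCompletion ℚ)}
    {Q : AlgebraicClosure (v.adicCompletion ℚ)} (hsurj : Function.Surjective Φ)
    (hker : ∀ u : (AlgebraicClosure (v.adicCompletion ℚ))ˣ, Φ (Additive.ofMul u) = 0 ↔
      ∃ j : ℤ, (u : AlgebraicClosure (v.adicCompletion ℚ)) = Q ^ j)
    (hequiv : ∀ (σ : absoluteGaloisGroup (v.adicCompletion ℚ)) (u u' : (AlgebraicClosure (v.adicCompletion ℚ))ˣ),
      (u' : AlgebraicClosure (v.adicCompletion ℚ)) = σ • (u : AlgebraicClosure (v.adicCompletion ℚ)) →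
        σ • Φ (Additive.ofMul u) = Φ (Additive.ofMul u'))
    (hQfix : ∀ σ : absoluteGaloisGroup (v.adicCompletion ℚ), σ • Q = Q) (hQ0 : Q ≠ 0)
    (hQtor : ∀ j : ℤ, Q ^ j = 1 → j = 0)
    (n : ℕ) {g : absoluteGaloisGroup (v.adicCompletion ℚ)} {ug : ℤ_[p]ˣ}
    (hug : ((κ (resGal (K := ℚ) (v.adicCompletion ℚ) g)).toAdd : ℤ_[p]) = (p : ℤ_[p]) ^ n * (ug : ℤ_[p]))
    (w : ℕ) {x : (AlgebraicClosure (v.adicCompletion ℚ))ˣ}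
    (hxw : ∀ h ∈ localSubgroup (κ.layerSubgroup (n + w)) (v.adicCompletion ℚ),
      h • (x : AlgebraicClosure (v.adicCompletion ℚ)) = x)
    (hNx : (∏ i ∈ Finset.range (p ^ w), (g ^ i) • (x : AlgebraicClosure (v.adicCompletion ℚ))) = Q)
    (m₀ : FixedPoints.addSubgroup (localSubgroup κ.kerSubgroup (v.adicCompletion ℚ)) (localPoints W (v.adicCompletion ℚ)))
    (hm₀ : (m₀ : localPoints W (v.adicCompletion ℚ)) = Φ (Additive.ofMul x)) :
    addOrderOf (QuotientAddGroup.mk m₀ :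
      FixedPoints.addSubgroup (localSubgroup κ.kerSubgroup (v.adicCompletion ℚ)) (localPoints W (v.adicCompletion ℚ)) ⧸
        (subOne (localSubgroup κ.kerSubgroup (v.adicCompletion ℚ)) (localPoints W (v.adicCompletion ℚ)) g).range) = p ^ w := by
  cases w with
  | zero =>
    rw [pow_zero, AddMonoid.addOrderOf_eq_one_iff]
    have h := nsmul_pow_mk_eq_zero_of_prod_smul_eq (κ := κ) v hker hequiv g 0 hNx m₀ hm₀
    rwa [pow_zero, one_nsmul] at h
  | succ w =>
    exact addOrderOf_eq_prime_pow
      (nsmul_pow_mk_ne_zero_of_prod_smul_eq (κ := κ) v hsurj hker hequiv hQfix hQ0 hQtor n hug (w + 1) hxw hNx m₀ hm₀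
        (Nat.lt_succ_self w))
      (nsmul_pow_mk_eq_zero_of_prod_smul_eq (κ := κ) v hker hequiv g (w + 1) hNx m₀ hm₀)

/-! ### Consequences: `p^w` surviving classes -/

/-- **`p^w ≤ #(M_∞/(g−1)M_∞)[p^∞]`** whenever some `x ∈ K̄ˣ` fixed by `H_{n+w}` has `N_w(x) = ∏_{i<p^w} g^i x = Q`
(the cyclic subgroup generated by `[Φ x]` has order `p^w` and consists of `p`-power torsion classes).
[cite: GreenbergLNM1716, §3 (pp. 90–93)] [cite: SilvermanATAEC1994, Thm. V.3.1 (c)(d), Thm. V.5.3] -/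
theorem pow_le_natCard_primaryComponent_coinvariants_of_prod_smul_eq (v : HeightOneSpectrum (𝓞 ℚ))
    {W : WeierstrassCurve ℚ}
    {Φ : Additive (AlgebraicClosure (v.adicCompletion ℚ))ˣ →+ localPoints W (v.adicCompletion ℚ)}
    {Q : AlgebraicClosure (v.adicCompletion ℚ)} (hsurj : Function.Surjective Φ)
    (hker : ∀ u : (AlgebraicClosure (v.adicCompletion ℚ))ˣ, Φ (Additive.ofMul u) = 0 ↔
      ∃ j : ℤ, (u : AlgebraicClosure (v.adicCompletion ℚ)) = Q ^ j)
    (hequiv : ∀ (σ : absoluteGaloisGroup (v.adicCompletion ℚ)) (u u' : (AlgebraicClosure (v.adicCompletion ℚ))ˣ),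
      (u' : AlgebraicClosure (v.adicCompletion ℚ)) = σ • (u : AlgebraicClosure (v.adicCompletion ℚ)) →
        σ • Φ (Additive.ofMul u) = Φ (Additive.ofMul u'))
    (hQfix : ∀ σ : absoluteGaloisGroup (v.adicCompletion ℚ), σ • Q = Q) (hQ0 : Q ≠ 0)
    (hQtor : ∀ j : ℤ, Q ^ j = 1 → j = 0)
    (n : ℕ) {g : absoluteGaloisGroup (v.adicCompletion ℚ)} {ug : ℤ_[p]ˣ}
    (hug : ((κ (resGal (K := ℚ) (v.adicCompletion ℚ) g)).toAdd : ℤ_[p]) = (p : ℤ_[p]) ^ n * (ug : ℤ_[p]))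
    (w : ℕ) {x : (AlgebraicClosure (v.adicCompletion ℚ))ˣ}
    (hxw : ∀ h ∈ localSubgroup (κ.layerSubgroup (n + w)) (v.adicCompletion ℚ),
      h • (x : AlgebraicClosure (v.adicCompletion ℚ)) = x)
    (hNx : (∏ i ∈ Finset.range (p ^ w), (g ^ i) • (x : AlgebraicClosure (v.adicCompletion ℚ))) = Q)
    [Finite (AddCommGroup.primaryComponent
      (FixedPoints.addSubgroup (localSubgroup κ.kerSubgroup (v.adicCompletion ℚ)) (localPoints W (v.adicCompletion ℚ)) ⧸
        (subOne (localSubgroup κ.kerSubgroup (v.adicCompletion ℚ)) (localPoints W (v.adicCompletion ℚ)) g).range) p)] :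
    p ^ w ≤ Nat.card (AddCommGroup.primaryComponent
      (FixedPoints.addSubgroup (localSubgroup κ.kerSubgroup (v.adicCompletion ℚ)) (localPoints W (v.adicCompletion ℚ)) ⧸
        (subOne (localSubgroup κ.kerSubgroup (v.adicCompletion ℚ)) (localPoints W (v.adicCompletion ℚ)) g).range) p) := by
  set P := localPoints W (v.adicCompletion ℚ) with hP
  set Hi := localSubgroup κ.kerSubgroup (v.adicCompletion ℚ) with hHi
  set M : AddSubgroup P := FixedPoints.addSubgroup Hi P with hM
  set d : M →+ M := subOne Hi P g with hd
  have hxL : ∀ h ∈ Hi, h • (x : AlgebraicClosure (v.adicCompletion ℚ)) = x :=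
    fun h hh ↦ hxw h (localSubgroup_ker_le_layer κ (v.adicCompletion ℚ) (n + w) hh)
  set m₀ : M := ⟨Φ (Additive.ofMul x), fun h ↦ apply_mem_fixedPoints_split v hequiv Hi hxL h h.2⟩ with hm₀def
  have hm₀ : (m₀ : P) = Φ (Additive.ofMul x) := rfl
  set y : M ⧸ d.range := QuotientAddGroup.mk m₀ with hy
  have hord : addOrderOf y = p ^ w :=
    addOrderOf_mk_eq_pow_of_prod_smul_eq (κ := κ) v hsurj hker hequiv hQfix hQ0 hQtor n hug w hxw hNx m₀ hm₀
  -- the cyclic subgroup `ℤ y` sits inside the `p`-primary component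
  set C : AddSubgroup (M ⧸ d.range) := AddSubgroup.zmultiples y with hC
  have hCle : ∀ c ∈ C, c ∈ AddCommGroup.primaryComponent (M ⧸ d.range) p := by
    intro c hc
    rw [hC, AddSubgroup.mem_zmultiples_iff] at hc
    obtain ⟨k, rfl⟩ := hc
    refine (AddCommGroup.mem_primaryComponent).mpr ⟨w, ?_⟩
    rw [smul_comm, ← hord, addOrderOf_nsmul_eq_zero, smul_zero]
  have hcardC : Nat.card C = p ^ w := by rw [hC, Nat.card_zmultiples, hord]
  let ι : C → AddCommGroup.primaryComponent (M ⧸ d.range) p := fun c ↦ ⟨c.1, hCle c.1 c.2⟩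
  have hι : Function.Injective ι := fun a b h ↦ by
    apply Subtype.ext
    have h' := congrArg Subtype.val h
    exact h'
  rw [← hcardC]
  exact Nat.card_le_card_of_injective ι hι

/-- **`p^w ≤ #𝒦_{v,n}[p^∞]`** — same hypotheses, `κ` cyclotomic, through the EXACT local inflation–restriction count
`GoodOrdTower.natCard_localTowerKerPrimary_eq_coinv_atP` (`#𝒦_{v,n}[p^∞] = #(M_∞/(g−1)M_∞)[p^∞]`, any `W`, any `p`).
[cite: GreenbergLNM1716, §3 (pp. 85–93)] [cite: SilvermanATAEC1994, Thm. V.3.1 (c)(d), Thm. V.5.3] -/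
theorem pow_le_natCard_localTowerKerPrimary_of_prod_smul_eq (hκ : κ.IsCyclotomic) (v : HeightOneSpectrum (𝓞 ℚ))
    (hv : ((p : ℕ) : 𝓞 ℚ) ∈ v.asIdeal) (W : WeierstrassCurve ℚ) [W.IsElliptic]
    {Φ : Additive (AlgebraicClosure (v.adicCompletion ℚ))ˣ →+ localPoints W (v.adicCompletion ℚ)}
    {Q : AlgebraicClosure (v.adicCompletion ℚ)} (hsurj : Function.Surjective Φ)
    (hker : ∀ u : (AlgebraicClosure (v.adicCompletion ℚ))ˣ, Φ (Additive.ofMul u) = 0 ↔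
      ∃ j : ℤ, (u : AlgebraicClosure (v.adicCompletion ℚ)) = Q ^ j)
    (hequiv : ∀ (σ : absoluteGaloisGroup (v.adicCompletion ℚ)) (u u' : (AlgebraicClosure (v.adicCompletion ℚ))ˣ),
      (u' : AlgebraicClosure (v.adicCompletion ℚ)) = σ • (u : AlgebraicClosure (v.adicCompletion ℚ)) →
        σ • Φ (Additive.ofMul u) = Φ (Additive.ofMul u'))
    (hQfix : ∀ σ : absoluteGaloisGroup (v.adicCompletion ℚ), σ • Q = Q) (hQ0 : Q ≠ 0)
    (hQtor : ∀ j : ℤ, Q ^ j = 1 → j = 0)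
    (n : ℕ) {g : absoluteGaloisGroup (v.adicCompletion ℚ)}
    (hgn : g ∈ localSubgroup (κ.layerSubgroup n) (v.adicCompletion ℚ))
    (hgen : ∀ U : Subgroup (absoluteGaloisGroup (v.adicCompletion ℚ)),
      IsOpen (U : Set (absoluteGaloisGroup (v.adicCompletion ℚ))) →
        localSubgroup κ.kerSubgroup (v.adicCompletion ℚ) ≤ U → g ∈ U →
          localSubgroup (κ.layerSubgroup n) (v.adicCompletion ℚ) ≤ U)
    (w : ℕ) {x : (AlgebraicClosure (v.adicCompletion ℚ))ˣ}
    (hxw : ∀ h ∈ localSubgroup (κ.layerSubgroup (n + w)) (v.adicCompletion ℚ),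
      h • (x : AlgebraicClosure (v.adicCompletion ℚ)) = x)
    (hNx : (∏ i ∈ Finset.range (p ^ w), (g ^ i) • (x : AlgebraicClosure (v.adicCompletion ℚ))) = Q)
    [Finite (AddCommGroup.primaryComponent
      (FixedPoints.addSubgroup (localSubgroup κ.kerSubgroup (v.adicCompletion ℚ)) (localPoints W (v.adicCompletion ℚ)) ⧸
        (subOne (localSubgroup κ.kerSubgroup (v.adicCompletion ℚ)) (localPoints W (v.adicCompletion ℚ)) g).range) p)] :
    p ^ w ≤ Nat.card (W.localTowerKerPrimary κ (v.adicCompletion ℚ) n) := by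
  obtain ⟨ug, hug⟩ := MultTowerSP1.exists_units_kappa_resGal_eq_of_generate hκ v hv n hgn hgen
  rw [GoodOrdTower.natCard_localTowerKerPrimary_eq_coinv_atP hκ v hv W n hgn hgen]
  exact pow_le_natCard_primaryComponent_coinvariants_of_prod_smul_eq (κ := κ) v hsurj hker hequiv hQfix hQ0 hQtor n hug
    w hxw hNx

end Literature.NumberTheory.EllipticCurves.Greenberg1999.MultTowerSplitExact

end Part9

/-!
## Part 10 — port of `Summits/BirchSwinnertonDyer/BirchSwinnertonDyer/Theorems/ByReductionTypeAtTwoMultTowerSplitExactTwo.lean`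

# Route `ByReductionTypeAtTwo`, crux `MultUpperHalfAtTwo` (item stmt-BirchSwinnertonDyer-19922), TOWER road, SPLIT rows:
# the EXACT order of the local tower kernel at a split multiplicative `2`, part 3 —
# `#𝒦_{v,n}[2^∞] = 2^{ord₂(log₂ q_E) − 2}` at EVERY layer: Greenberg's `|ker(r_v)| ∼ log₂(q_E)/4` at `p = 2` is KERNEL

HONEST FRAMING (cell `bsd-2adic`, run/shared/lean/pub/bsd-2adic/, seat `bsd-2adic-tower-1` GEN 27, HUMAN RULINGS
D-0036 / D-0054 / D-0074): theorems only (no definition, no named fact, no `sorry`); closes no item by itself; nothing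
booked; BSD is not proved by any of this. The PRINT binder `hSP = Greenberg1999.sec3_natCard_localTowerKerPrimary_splitMultiplicative_rat`
(Greenberg, LNM 1716, §3 pp. 92–93: at a SPLIT multiplicative `v ∣ p`, `|ker(r_{v_n})| ∼ log_p(N q_E)/2p[…]`; over `ℚ`:
`#𝒦_{v,n}[p^∞] = p^e`, `e + ord_p(2p) = ord_p(log_p q_E)`, every layer) is stated for EVERY prime `p`. Seat bsd-2adic-mult
GEN 13 proved its UPPER half at `p = 2` (`MultTowerSplitOrder.finite_and_natCard_localTowerKerPrimary_le_pow_splitTwo`).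
THIS FILE PROVES THE `p = 2` CLAUSE IN FULL (equality):

* `toZModPow_units_pow_two_pow_of_norm_sq_sub_one` — `2`-adic: `‖u² − 1‖ ≤ 2^{−(w+3)}` ⇒ `u^{2^n} ≡ ±1 (mod 2^{n+w+2})`;
* `pow_mem_range_norm_layer_splitTwo` — hence `q_E^{2^n} ∈ N(F_{n+w}ˣ)` (norms to `ℚ_v`) by GEN 9's BRICK 14
  `MultTowerNS2.mem_range_norm_fixedField_layer_iff` (`N(F_mˣ) = ⟨2⟩·±(1 + 2^{m+2}ℤ₂)`, from the explicit norms
  `N(1 + y_m) = −1`, `N(2 + y_m) = 2` and the class field axiom);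
* `pow_le_natCard_localTowerKerPrimary_splitTwo` — **`2^w ≤ #𝒦_{v,n}[2^∞]`** for `ord₂(log₂ q_E) = w + 2` (part 2's
  transfer gives `x ∈ F_{n+w}` with `N_{F_{n+w}/F_n}(x) = q_E`; part 1 gives the class of order exactly `2^w`);
* `finite_and_natCard_localTowerKerPrimary_eq_pow_splitTwo` — **`Finite 𝒦_{v,n}[2^∞] ∧ #𝒦_{v,n}[2^∞] = 2^w`**;
* `sec3_natCard_localTowerKerPrimary_splitMultiplicative_two` — **the `p = 2` clause of the named fact hSP, verbatim body**
  (`∃ e, e + ord₂(4) = ord₂(log₂ q_E) ∧ ∀ n, Finite ∧ # = 2^e`); the `∀ p` fact itself additionally needs the odd-`p` clause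
  (norm group `⟨p⟩·μ_{p−1}·(1 + p^{m+1}ℤ_p)` of `F_m` and the odd-`p` count) — not in this file.

References: R. Greenberg, LNM 1716 (1999), §3 pp. 85–93 (pp. 92–93 «constant as n varies», «|ker(r_v)| ∼ log_p(q_E)/2p»);
J. Silverman, GTM 151, V.3–V.5; J. Neukirch, *ANT* IV (3.5), V (1.1); K. Iwasawa, *Lectures on p-adic L-functions* §4.4;
cell memos NOTE-SP1ONE.md §5, NOTE-HNS2-KERNEL-GEN27.md.
-/

section Part10

set_option autoImplicit false

open scoped _root_.Classical

namespace Literature.NumberTheory.EllipticCurves.Greenberg1999.MultTowerSplitExact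

open _root_.NumberField _root_.IsDedekindDomain _root_.Field _root_.WeierstrassCurve _root_.PadicInt _root_.Rat.HeightOneSpectrum
  Literature.NumberTheory.EllipticCurves Literature.NumberTheory.EllipticCurves.ResKernel
  Literature.NumberTheory.GaloisRepresentations
  Literature.NumberTheory.EllipticCurves.Greenberg1999.MultTowerNS2
  Literature.NumberTheory.EllipticCurves.Greenberg1999.MultTowerSplitOrder

/-! ### `2`-adic units: `‖u² − 1‖ ≤ 2^{−(w+3)} ⇒ u^{2^n} ≡ ±1 (mod 2^{n+w+2})` -/

/-- A unit of `ℤ₂` is `≡ 1` or `≡ −1 (mod 4)`, i.e. `‖u − 1‖ < ‖2‖` or `‖u + 1‖ < ‖2‖`. [folklore] -/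
private theorem norm_sub_one_lt_or_norm_add_one_lt (u : ℤ_[2]ˣ) :
    ‖(u : ℤ_[2]) - 1‖ < ‖(2 : ℤ_[2])‖ ∨ ‖(u : ℤ_[2]) + 1‖ < ‖(2 : ℤ_[2])‖ := by
  have key : ∀ t t' : ZMod (2 ^ 2), t * t' = 1 → t = 1 ∨ t = -1 := by decide
  have hu := key (toZModPow 2 (u : ℤ_[2])) (toZModPow 2 ((u⁻¹ : ℤ_[2]ˣ) : ℤ_[2]))
    (by rw [← map_mul, Units.mul_inv, map_one])
  have h4 : (2 : ℝ) ^ (-((2 : ℕ) : ℤ)) < ‖(2 : ℤ_[2])‖ := by rw [norm_two_padicInt]; norm_num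
  rcases hu with h | h
  · left
    have h1 : toZModPow 2 (u : ℤ_[2]) = toZModPow 2 1 := by rw [h, map_one]
    exact lt_of_le_of_lt ((toZModPow_eq_iff_norm_sub_le 2 _ _).mp h1) h4
  · right
    have h1 : toZModPow 2 (u : ℤ_[2]) = toZModPow 2 (-1) := by rw [h, map_neg, map_one]
    have h2 := (toZModPow_eq_iff_norm_sub_le 2 _ _).mp h1
    rw [sub_neg_eq_add] at h2
    exact lt_of_le_of_lt h2 h4

/-- **`u^{2^n} ≡ ±1 (mod 2^{n+w+2})` when `‖u² − 1‖ ≤ 2^{−(w+3)}`** (`u ∈ ℤ₂ˣ`): with `y = ±u`, `‖y − 1‖ < ‖2‖`, one has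
`‖y − 1‖ = ‖u² − 1‖/‖2‖ ≤ 2^{−(w+2)}` and `‖y^{2^n} − 1‖ = ‖y − 1‖·‖2‖^n ≤ 2^{−(n+w+2)}`, and `u^{2^n} = ±y^{2^n}`. [folklore] -/
private theorem toZModPow_units_pow_two_pow_of_norm_sq_sub_one (u : ℤ_[2]ˣ) {w : ℕ}
    (hu : ‖(u : ℤ_[2]) ^ 2 - 1‖ ≤ (2 : ℝ) ^ (-((w : ℤ) + 3))) (n : ℕ) :
    toZModPow (n + w + 2) (((u ^ 2 ^ n : ℤ_[2]ˣ) : ℤ_[2])) = 1 ∨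
      toZModPow (n + w + 2) (((u ^ 2 ^ n : ℤ_[2]ˣ) : ℤ_[2])) = -1 := by
  have h2 : ‖(2 : ℤ_[2])‖ = (2 : ℝ)⁻¹ := norm_two_padicInt
  -- `y = ε u` with `‖y − 1‖ < ‖2‖`
  obtain ⟨ε, hε, hy⟩ : ∃ ε : ℤ_[2], (ε = 1 ∨ ε = -1) ∧ ‖ε * (u : ℤ_[2]) - 1‖ < ‖(2 : ℤ_[2])‖ := by
    rcases norm_sub_one_lt_or_norm_add_one_lt u with h | h
    · exact ⟨1, Or.inl rfl, by rwa [one_mul]⟩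
    · refine ⟨-1, Or.inr rfl, ?_⟩
      rw [neg_one_mul, ← norm_neg, neg_sub, sub_neg_eq_add, add_comm]
      exact h
  set y : ℤ_[2] := ε * (u : ℤ_[2]) with hydef
  have hε2 : ε ^ 2 = 1 := by rcases hε with rfl | rfl <;> norm_num
  have hy2 : y ^ 2 = (u : ℤ_[2]) ^ 2 := by rw [hydef, mul_pow, hε2, one_mul]
  -- `‖y − 1‖ ≤ 2^{−(w+2)}`
  have hy1 : ‖y - 1‖ ≤ (2 : ℝ) ^ (-((w : ℤ) + 2)) := by
    have h := norm_sq_sub_one_of_norm_sub_one_lt hy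
    rw [hy2, h2] at h
    have h' : ‖y - 1‖ = ‖(u : ℤ_[2]) ^ 2 - 1‖ * 2 := by
      field_simp at h; linarith [h]
    rw [h']
    calc ‖(u : ℤ_[2]) ^ 2 - 1‖ * 2 ≤ (2 : ℝ) ^ (-((w : ℤ) + 3)) * 2 := by gcongr
      _ = (2 : ℝ) ^ (-((w : ℤ) + 2)) := by
        rw [show -((w : ℤ) + 2) = -((w : ℤ) + 3) + 1 by ring, zpow_add₀ (by norm_num : (2 : ℝ) ≠ 0), zpow_one]
  -- `‖y^{2^n} − 1‖ ≤ 2^{−(n+w+2)}`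
  have hyn : ‖y ^ 2 ^ n - 1‖ ≤ (2 : ℝ) ^ (-(((n + w + 2 : ℕ) : ℤ))) := by
    rw [norm_pow_two_pow_sub_one hy n, h2, inv_pow, ← zpow_natCast, ← zpow_neg]
    calc ‖y - 1‖ * (2 : ℝ) ^ (-(n : ℤ)) ≤ (2 : ℝ) ^ (-((w : ℤ) + 2)) * (2 : ℝ) ^ (-(n : ℤ)) := by
          gcongr
      _ = (2 : ℝ) ^ (-(((n + w + 2 : ℕ) : ℤ))) := by
        rw [← zpow_add₀ (by norm_num : (2 : ℝ) ≠ 0)]; congr 1; push_cast; ring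
  have hyn' : toZModPow (n + w + 2) (y ^ 2 ^ n) = 1 := by
    have h := (toZModPow_eq_iff_norm_sub_le (n + w + 2) (y ^ 2 ^ n) 1).mpr hyn
    rwa [map_one] at h
  -- `u^{2^n} = ε^{2^n} y^{2^n}`
  have hup : ((u ^ 2 ^ n : ℤ_[2]ˣ) : ℤ_[2]) = ε ^ 2 ^ n * y ^ 2 ^ n := by
    rw [Units.val_pow_eq_pow_val, hydef, mul_pow, ← mul_assoc, ← mul_pow, ← sq, hε2, one_pow, one_mul]
  have hεn : ε ^ 2 ^ n = 1 ∨ ε ^ 2 ^ n = -1 := by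
    rcases hε with rfl | rfl
    · exact Or.inl (one_pow _)
    · rcases Nat.even_or_odd (2 ^ n) with h | h
      · exact Or.inl h.neg_one_pow
      · exact Or.inr h.neg_one_pow
  rcases hεn with h | h
  · left; rw [hup, h, one_mul, hyn']
  · right; rw [hup, h, neg_one_mul, map_neg, hyn']

/-! ### The `p = 2` assembly -/

variable {κ : ZpExtension ℚ 2}

/-- **`2^w ≤ #𝒦_{v,n}[2^∞]` at a split multiplicative `2` with `ord₂(log₂ q_E) = w + 2`** (every cyclotomic `κ`, `v ∋ 2`,
every layer `n`). Proof: uniformise (BRICK S3), read `q_E = 2^k u` with `‖u² − 1‖ = 2^{−(w+3)}`; then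
`q_E^{2^n} = 2^{k2^n}·u^{2^n}` with `u^{2^n} ≡ ±1 (mod 2^{n+w+2})` lies in `N(F_{n+w}ˣ)` (BRICK 14); the transfer (part 2)
gives `x ∈ F_{n+w}` with `N_{F_{n+w}/F_n}(x) = q_E`, whose class has order exactly `2^w` (part 1).
[cite: GreenbergLNM1716, §3, between Prop. 3.6 and Prop. 3.7 (PDF pp. 92–93)] [cite: SilvermanATAEC1994, Thm. V.3.1, V.5.3]
[cite: NeukirchANT1999, Ch. IV (3.5) and Ch. V §1 Thm. (1.1)] -/
theorem pow_le_natCard_localTowerKerPrimary_splitTwo (W : WeierstrassCurve ℚ) [W.IsElliptic]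
    (Dq : TateParameterData W 2) (hlog : padicLog 2 Dq.q ≠ 0) {w : ℕ}
    (hw : (padicLog 2 Dq.q).valuation = (w : ℤ) + 2) (κ : ZpExtension ℚ 2) (hκ : κ.IsCyclotomic)
    (v : HeightOneSpectrum (𝓞 ℚ)) (hv : ((2 : ℕ) : 𝓞 ℚ) ∈ v.asIdeal) (n : ℕ) :
    2 ^ w ≤ Nat.card (W.localTowerKerPrimary κ (v.adicCompletion ℚ) n) := by
  -- the uniformisation at `v` and the identification with `Dq.q`
  have hsplitv := hasSplitMultiplicativeReductionAt_of_atPrime W v hv Dq.split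
  obtain ⟨q, Φ, hq0, hq1, hqj, hsurj, hker, hequiv⟩ := exists_tateUniformisation_tateJ W v hsplitv
  obtain ⟨e, he⟩ := exists_ringEquiv_tateParameter 2 v hv
  have heq : e q = Dq.q := he W q hq0 hq1 hqj Dq
  obtain ⟨k', u, hqu⟩ := exists_eq_two_pow_mul_units Dq.q_ne_zero Dq.norm_q_lt_one
  -- the depth: `‖u² − 1‖ = 2^{−(w+3)}` from `ord₂ log₂ q = w + 2`
  have hu : ‖(u : ℤ_[2]) ^ 2 - 1‖ ≤ (2 : ℝ) ^ (-((w : ℤ) + 3)) := by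
    have hu0 : ((u : ℤ_[2]) : ℚ_[2]) ≠ 0 := fun h ↦ u.ne_zero (PadicInt.coe_eq_zero.mp h)
    have hlogq : padicLog 2 Dq.q = padicLog 2 ((u : ℤ_[2]) : ℚ_[2]) := by rw [hqu, padicLog_two_pow_mul k' hu0]
    have hn := norm_padicLog_units_eq u
    rw [← hlogq, Padic.norm_eq_zpow_neg_valuation hlog, hw] at hn
    have h : ‖(u : ℤ_[2]) ^ 2 - 1‖ = (2 : ℝ) ^ (-((w : ℤ) + 3)) := by
      rw [show -((w : ℤ) + 3) = -((w : ℤ) + 2) + (-1) by ring, zpow_add₀ (by norm_num : (2 : ℝ) ≠ 0)]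
      push_cast at hn
      rw [zpow_neg_one]
      linarith [hn]
    exact h.le
  have hq : e q = (2 : ℚ_[2]) ^ k' * ((u : ℤ_[2]) : ℚ_[2]) := by rw [heq, hqu]
  have hu' : ‖(u : ℤ_[2]) ^ 2 - 1‖ = (2 : ℝ) ^ (-((w : ℤ) + 3)) := by
    refine le_antisymm hu ?_
    -- the reverse inequality is not needed below except through GEN 13's count; derive it from `hw` as well
    have hu0 : ((u : ℤ_[2]) : ℚ_[2]) ≠ 0 := fun h ↦ u.ne_zero (PadicInt.coe_eq_zero.mp h)
    have hlogq : padicLog 2 Dq.q = padicLog 2 ((u : ℤ_[2]) : ℚ_[2]) := by rw [hqu, padicLog_two_pow_mul k' hu0]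
    have hn := norm_padicLog_units_eq u
    rw [← hlogq, Padic.norm_eq_zpow_neg_valuation hlog, hw] at hn
    rw [show -((w : ℤ) + 3) = -((w : ℤ) + 2) + (-1) by ring, zpow_add₀ (by norm_num : (2 : ℝ) ≠ 0)]
    push_cast at hn
    rw [zpow_neg_one]
    linarith [hn]
  -- equivariance in value form
  have hequiv' : ∀ (σ : absoluteGaloisGroup (v.adicCompletion ℚ)) (w₁ w' : (AlgebraicClosure (v.adicCompletion ℚ))ˣ),
      (w' : AlgebraicClosure (v.adicCompletion ℚ)) = σ • (w₁ : AlgebraicClosure (v.adicCompletion ℚ)) →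
        σ • Φ (Additive.ofMul w₁) = Φ (Additive.ofMul w') := by
    intro σ w₁ w' h
    have hw' : w' = Units.map (absoluteGaloisGroup.toAlgEquiv (v.adicCompletion ℚ) σ :
        AlgebraicClosure (v.adicCompletion ℚ) →* AlgebraicClosure (v.adicCompletion ℚ)) w₁ := Units.ext h
    rw [hw']
    exact hequiv σ w₁
  -- the Tate parameter in `K̄_v`
  set Q : AlgebraicClosure (v.adicCompletion ℚ) := algebraMap (v.adicCompletion ℚ) (AlgebraicClosure (v.adicCompletion ℚ)) q
    with hQ
  have hQ0 : Q ≠ 0 := by rw [hQ]; exact (map_ne_zero _).mpr hq0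
  have hQfix : ∀ σ : absoluteGaloisGroup (v.adicCompletion ℚ), σ • Q = Q := fun σ ↦
    AlgEquiv.commutes (absoluteGaloisGroup.toAlgEquiv _ σ) q
  have hQtor : ∀ j : ℤ, Q ^ j = 1 → j = 0 := by
    intro j hj
    have hj' : q ^ j = 1 := by
      apply (algebraMap (v.adicCompletion ℚ) (AlgebraicClosure (v.adicCompletion ℚ))).injective
      rw [map_zpow₀, map_one]; exact hj
    have hpow : ∀ m : ℕ, q ^ m = 1 → m = 0 := fun m hm ↦ by
      by_contra hm0
      have h1 : ‖q‖ ^ m < 1 := pow_lt_one₀ (norm_nonneg q) hq1 hm0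
      rw [← norm_pow, hm, norm_one] at h1
      exact lt_irrefl _ h1
    cases j with
    | ofNat m =>
      rw [Int.ofNat_eq_natCast, zpow_natCast] at hj'
      rw [Int.ofNat_eq_natCast, hpow m hj']
      rfl
    | negSucc m =>
      rw [zpow_negSucc, inv_eq_one] at hj'
      exact absurd (hpow (m + 1) hj') (Nat.succ_ne_zero m)
  -- a topological generator
  obtain ⟨g, hgn, hgen⟩ := ZpExtension.exists_mem_localSubgroup_generate κ (v.adicCompletion ℚ) n
  obtain ⟨ug, hug⟩ := MultTowerSP1.exists_units_kappa_resGal_eq_of_generate hκ v hv n hgn hgen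
  -- finiteness of the `2`-primary coinvariants (GEN 13's count)
  obtain ⟨hfinT, -⟩ := finite_primaryComponent_coinvariants_and_card_le hκ v hv hsurj hker hequiv' hq0 hq1 e hq hu'
    n hgn hgen
  haveI := hfinT
  -- the witness `x ∈ F_{n+w}` with `N_w(x) = ∏_{i<2^w} g^i x = q`
  obtain ⟨x, hxw, hNx⟩ : ∃ x : (AlgebraicClosure (v.adicCompletion ℚ))ˣ,
      (∀ h ∈ localSubgroup (κ.layerSubgroup (n + w)) (v.adicCompletion ℚ),
        h • (x : AlgebraicClosure (v.adicCompletion ℚ)) = x) ∧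
      (∏ i ∈ Finset.range (2 ^ w), (g ^ i) • (x : AlgebraicClosure (v.adicCompletion ℚ))) = Q := by
    rcases Nat.eq_zero_or_pos w with rfl | hwpos
    · -- `w = 0`: `x = q` itself
      refine ⟨Units.mk0 Q hQ0, fun h _ ↦ by rw [Units.val_mk0]; exact hQfix h, ?_⟩
      rw [pow_zero, Finset.prod_range_one, pow_zero, one_smul, Units.val_mk0]
    · -- `q^{2^n} ∈ N(F_{n+w}ˣ)` by BRICK 14, then the transfer (part 2)
      set qu : (v.adicCompletion ℚ)ˣ := Units.mk0 q hq0 with hqu_def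
      have hmem : qu ^ 2 ^ n ∈ (Units.map (Algebra.norm (v.adicCompletion ℚ) :
          IntermediateField.fixedField (localSubgroup (κ.layerSubgroup (n + w)) (v.adicCompletion ℚ)) →*
            v.adicCompletion ℚ)).range := by
        rw [mem_range_norm_fixedField_layer_iff hκ v hv (m := n + w) (by omega) 2 rfl e]
        refine ⟨((k' * 2 ^ n : ℕ) : ℤ), u ^ 2 ^ n, toZModPow_units_pow_two_pow_of_norm_sq_sub_one u hu n, ?_⟩
        rw [hqu_def, Units.val_pow_eq_pow_val, Units.val_mk0, map_pow, hq, mul_pow, ← pow_mul, zpow_natCast,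
          Units.val_pow_eq_pow_val, PadicInt.coe_pow]
        norm_num
      obtain ⟨x, hxw, hNx⟩ := exists_prod_smul_eq_of_pow_mem_range_norm hκ v hv n w hgn hug qu hmem
      rw [hqu_def, Units.val_mk0] at hNx
      exact ⟨x, hxw, hNx⟩
  exact pow_le_natCard_localTowerKerPrimary_of_prod_smul_eq hκ v hv W hsurj hker hequiv' hQfix hQ0 hQtor n hgn hgen w
    hxw hNx

/-- **`ord₂(log₂ q_E) ≥ 2`** for a Tate parameter at `2` with `log₂ q_E ≠ 0`: `‖log₂ q_E‖ = ‖log₂ u‖ = 2‖u² − 1‖ ≤ 2·2^{−3}`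
(`u² ≡ 1 (mod 8)` for every `2`-adic unit). [cite: Iwasawa1972PadicL, §4.4] -/
theorem two_le_valuation_padicLog {W : WeierstrassCurve ℚ} [W.IsElliptic] (Dq : TateParameterData W 2)
    (hlog : padicLog 2 Dq.q ≠ 0) :
    (2 : ℤ) ≤ (padicLog 2 Dq.q).valuation := by
  obtain ⟨k', u, hqu⟩ := exists_eq_two_pow_mul_units Dq.q_ne_zero Dq.norm_q_lt_one
  have hu0 : ((u : ℤ_[2]) : ℚ_[2]) ≠ 0 := fun h ↦ u.ne_zero (PadicInt.coe_eq_zero.mp h)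
  have hlogq : padicLog 2 Dq.q = padicLog 2 ((u : ℤ_[2]) : ℚ_[2]) := by rw [hqu, padicLog_two_pow_mul k' hu0]
  have hn := norm_padicLog_units_eq u
  rw [← hlogq, Padic.norm_eq_zpow_neg_valuation hlog] at hn
  have h8 := norm_units_sq_sub_one_le u
  have hle : ((2 : ℕ) : ℝ) ^ (-(padicLog 2 Dq.q).valuation) ≤ (2 : ℝ) ^ (-(2 : ℤ)) := by
    rw [show -(2 : ℤ) = 1 + (-(3 : ℤ)) by norm_num, zpow_add₀ (by norm_num : (2 : ℝ) ≠ 0), zpow_one]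
    push_cast at hn ⊢
    rw [hn]
    linarith [h8]
  push_cast at hle
  have h2 : (1 : ℝ) < 2 := by norm_num
  have := (zpow_le_zpow_iff_right₀ h2).mp hle
  omega

/-- **`#𝒦_{v,n}[2^∞] = 2^w` EXACTLY at a split multiplicative `2` with `ord₂(log₂ q_E) = w + 2`, every layer** — Greenberg's
`|ker(r_{v_n})| ∼ log₂(N q_E)/4[…] = log₂(q_E)/4` over `ℚ` at `p = 2` (LNM 1716 p. 93), KERNEL: the upper bound is seat
bsd-2adic-mult GEN 13's `MultTowerSplitOrder.finite_and_natCard_localTowerKerPrimary_le_pow_splitTwo`, the lower bound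
`pow_le_natCard_localTowerKerPrimary_splitTwo`. [cite: GreenbergLNM1716, §3, between Prop. 3.6 and Prop. 3.7 (PDF pp. 92–93)]
[cite: SilvermanATAEC1994, Thm. V.3.1, V.5.3] [cite: NeukirchANT1999, Ch. IV (3.5) and Ch. V §1 Thm. (1.1)] -/
theorem finite_and_natCard_localTowerKerPrimary_eq_pow_splitTwo (W : WeierstrassCurve ℚ) [W.IsElliptic]
    (Dq : TateParameterData W 2) (hlog : padicLog 2 Dq.q ≠ 0) {w : ℕ}
    (hw : (padicLog 2 Dq.q).valuation = (w : ℤ) + 2) (κ : ZpExtension ℚ 2) (hκ : κ.IsCyclotomic)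
    (v : HeightOneSpectrum (𝓞 ℚ)) (hv : ((2 : ℕ) : 𝓞 ℚ) ∈ v.asIdeal) (n : ℕ) :
    Finite (W.localTowerKerPrimary κ (v.adicCompletion ℚ) n) ∧
      Nat.card (W.localTowerKerPrimary κ (v.adicCompletion ℚ) n) = 2 ^ w := by
  obtain ⟨hfin, hle⟩ := finite_and_natCard_localTowerKerPrimary_le_pow_splitTwo W Dq hlog (k := w) hw.le κ hκ v hv n
  exact ⟨hfin, le_antisymm hle (pow_le_natCard_localTowerKerPrimary_splitTwo W Dq hlog hw κ hκ v hv n)⟩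

/-- **The `p = 2` clause of the named fact `Greenberg1999.sec3_natCard_localTowerKerPrimary_splitMultiplicative_rat`, body
verbatim** (Greenberg, LNM 1716 §3 pp. 92–93 read over the tower of `ℚ`, flag `Gre99-p93-split-Qtower`): for `W/ℚ` globally
minimal with a Tate parameter datum `Dq` at `2` and `log₂ q_E ≠ 0`, the cyclotomic `κ` and `v ∋ 2`, there is `e` with
`e + ord₂(2·2) = ord₂(log₂ q_E)` such that at EVERY layer `𝒦_{v,n}[2^∞]` is finite of order `2^e`. The `∀ p` named fact is NOT
discharged by this (the odd-`p` clause is open in the tree). [cite: GreenbergLNM1716, §3, between Prop. 3.6 and Prop. 3.7 (PDF pp. 90–93)]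
[cite: Washington1997, §13.1] -/
theorem sec3_natCard_localTowerKerPrimary_splitMultiplicative_two (W : WeierstrassCurve ℚ) [W.IsElliptic]
    [W.IsGloballyMinimal] (Dq : TateParameterData W 2) (hlog : padicLog 2 Dq.q ≠ 0)
    (κ : ZpExtension ℚ 2) (hκ : κ.IsCyclotomic) (v : HeightOneSpectrum (𝓞 ℚ)) (hv : ((2 : ℕ) : 𝓞 ℚ) ∈ v.asIdeal) :
    ∃ e : ℕ, (e : ℤ) + (padicValNat 2 (2 * 2) : ℤ) = (padicLog 2 Dq.q).valuation ∧
      ∀ n : ℕ, Finite (W.localTowerKerPrimary κ (v.adicCompletion ℚ) n) ∧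
        Nat.card (W.localTowerKerPrimary κ (v.adicCompletion ℚ) n) = 2 ^ e := by
  have h4 : padicValNat 2 (2 * 2) = 2 := by
    have : (2 * 2 : ℕ) = 2 ^ 2 := by norm_num
    rw [this, padicValNat.prime_pow]
  have h2 := two_le_valuation_padicLog Dq hlog
  obtain ⟨w, hw⟩ : ∃ w : ℕ, (padicLog 2 Dq.q).valuation = (w : ℤ) + 2 :=
    ⟨((padicLog 2 Dq.q).valuation - 2).toNat, by rw [Int.toNat_of_nonneg (by omega)]; ring⟩
  refine ⟨w, by rw [h4, hw]; push_cast; ring, fun n ↦ ?_⟩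
  exact finite_and_natCard_localTowerKerPrimary_eq_pow_splitTwo W Dq hlog hw κ hκ v hv n

end Literature.NumberTheory.EllipticCurves.Greenberg1999.MultTowerSplitExact

end Part10

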